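import Literature.Probability.RandomPlanarGeometry.YangBaxterSAW
import Literature.Probability.RandomPlanarGeometry.SAWParafermion
import HarnessLib

/-!
# Barrier (SAWScalingLimit): the discretely holomorphic square-lattice weights are not the uniform SAW's

On the square lattice, discrete holomorphicity of the `O(n)` parafermion forces the Yang–Baxter
(Nienhuis) plaquette weights (Ikhlef–Cardy 2009); at `n = 0`, `θ = π/2` these weights are not
those of the uniform (vertex) self-avoiding walk. This file PROVES the weight comparison and
DEFINES the technique class it bears on (an exact local linear relation for the library's uniform
`ℤ²` observable); the classification itself and the non-integrability of the uniform walk are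
quoted, not formalised (see `scope_caveats`).

Barrier catalogue `Literature/Barriers/CriticalPhenomena/` (D-0021), sub-problem
`SAWScalingLimit` (the critical SAW on `δℤ²` converges to SLE_{8/3},
`Literature.Probability.RandomPlanarGeometry.SAW.SAWScalingLimit`).

## What the sources print

* Ikhlef–Cardy 2009, §1 and §3: for the `O(n)` loop model on the square lattice (nine
  plaquette configurations with weights `t, u₁, u₂, v, w₁, w₂`, loop weight `n`; Nienhuis 1990),
  requiring the parafermionic observable `F_s(z) = Σ P(G) e^{-isθ(z)}` to satisfy the discrete
  holomorphicity relation `Σ_{(ij) ∈ ◇} F((z_i+z_j)/2)(z_j - z_i) = 0` around every plaquette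
  "yields the linear system for the Boltzmann weights" (four complex equations in
  `t, u₁, u₂, v, w₁, w₂`); for generic `n` its solutions with `v ≠ 0` exist iff the spin satisfies
  `cos 4πs = cos 6η` and are an explicit trigonometric family of weights, and "A remarkable fact is
  that [these] weights are a solution of the Yang–Baxter equations for the `O(n)` loop model on the
  square lattice … So, by solving the holomorphicity equations … on a deformed lattice, we
  recovered the integrable weights"; abstract: the observables "are discretely holomorphic
  … as long as the Boltzmann weights satisfy certain linear constraints. In the cases
  considered, the weights then also satisfy the critical Yang–Baxter equations".
* Duminil-Copin 2013 (Ensaios Mat. 25), §12.5: Remark 12.13 — "`u₁ = u₂ = v = x`, `t = 1` and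
  `w₁ = w₂ = n = 0` corresponds to vertex self-avoiding walks on the square lattice"; eq. (12.7)
  — for each `n`, spin `σ` and rhombus angle `θ` "the unique solution [of the local relations]
  is given by the following weights" (Glazman's parametrisation); §12.5.1 — "Unfortunately, the
  observable satisfies only some of the discrete Cauchy–Riemann equations except for the Ising
  case. Interestingly, weights for which there exists a “half-holomorphic” observable which is
  not degenerate in the scaling limit always correspond to weights for which the famous
  Yang–Baxter relation … holds. A perfect example is the system of solutions given in the
  previous section for the `O(n)`-model on the square lattice."
* Glazman 2015 (ECP 20, no. 86), p. 1: "Since the self-avoiding walk on the square lattice does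
  not seem to be integrable, it is not reasonable to expect any explicit formula for the
  connective constant in this case"; Thm 1.1 with (1.1)–(1.5) (the `n = 0` weights, normalised
  by `t = 1`; these are `Literature.SAW.YangBaxter.weightU1 … weightW2` of `YangBaxterSAW.lean`,
  Glazman–Manolescu 2019, eq. (1)); p. 3: "In the case `θ = π/2` the weights are symmetric, i.e.
  `u₁ = u₂` and `w₁ = w₂`. One can view a walk as a self-avoiding walk on `ℤ²` which is allowed
  to touch itself but each time gets penalised by `w₁/u₁² ≈ 0.675` and that gets penalised by
  `v/u₁ ≈ 0.785` for each vertex it passes without a turn … `1/u₁(π/2) = 2.448…` This is below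
  the predicted value `≈ 2.638` for a connective constant of `ℤ²`."
* Glazman–Manolescu 2019 (arXiv:1708.00395), p. 1: "Self-avoiding walk on the square lattice is
  not believed to be integrable, therefore it is not reasonable to expect any explicit formula
  for the connective constant in this case, nor the existence of a well-behaved equivalent
  observable."

## What is formalised

`PlaquetteWeights` (the six local weights), `nienhuisWeights θ` (the integrable = discretely
holomorphic weights at `n = 0`, from `YangBaxterSAW.lean`), `vertexSAWWeights x` (Remark
12.13), the closed-form values at the square-lattice angle `θ = π/2` (PROVED:
`u₁ = u₂`, `w₁ = w₂`, `0 < w₁`, `0 < u₁`, `v < u₁`), the technique class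
`ExactVertexRelationZ2 x σ c` / `HasExactVertexRelationZ2` (an exact local linear relation, with
vertex-independent coefficients, for the uniform square-lattice mid-edge observable
`Literature.Probability.RandomPlanarGeometry.SAW.midEdgeParafermionicObservable` of `SAWParafermion.lean` — the shape of DCS Lemma 1;
its negation is the route guard `NoExactVertexRelation` of route `SAWParafermion`), and the
barrier statement `NienhuisWeightsExcludeVertexSAW : ∀ x, nienhuisWeights (π/2) ≠
vertexSAWWeights x`, PROVED (`nienhuisWeights_pi_div_two_ne_vertexSAWWeights`,
`NienhuisWeightsExcludeVertexSAW_holds`). NOT formalised: the `O(n)` plaquette model with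
general weights and its observable, hence not the holomorphic ⇒ Nienhuis classification
(IC09 §3; DC13 (12.7)), which stays quoted. ADDED by the barrier audit (appendix at the end of
this file, namespace `NoVertexRelation`): the technique class is EMPTY —
`not_hasExactVertexRelationZ2 : ¬ HasExactVertexRelationZ2` is PROVED, independently of the quoted
classification, by evaluating the library's observable on six explicit finite domains
(kernel-checked walk enumerations) followed by an elimination (`vertexStencil_eq_zero_of_rows`);
for relations of this shape the cited authors' expectation ("nor the existence of a well-behaved
equivalent observable") is thereby a theorem. ADDED by the second barrier audit (Appendix B = companion module
`Literature.Barriers.CriticalPhenomena.NienhuisWeightsExcludeVertexSAWStarConvex`, kept apart only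
because of the gate's file-size cap): the STRONGER named fact `NoExactVertexRelationZ2SC`, PROVED there (`NoExactVertexRelationZ2SC_holds`)
— the relation already fails when it is demanded only on discrete domains cut out by COMPACT
STAR-SHAPED plane sets (the plus, two closed unit squares and a closed `1 × 2` rectangle with
pendant unit edges, all rooted at a leaf), so the holes of Appendix A's domains `T`, `O` are
inessential; Appendix A's theorem is re-derived from it (`not_hasExactVertexRelationZ2_of_SC`).

## Verdict clean-up (2026-08-16): `HasExactVertexRelationZ2` is a refuted record, not a named fact

The closed `Prop` `HasExactVertexRelationZ2` (the technique class in inhabited form: SOME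
`x ∈ (0,1)`, `σ`, `c ≠ 0` with `ExactVertexRelationZ2 x σ c`) was written as the explicit object the
barrier bears on, and its negation is proved here (`not_hasExactVertexRelationZ2`) and, more
strongly, in the companion module (`NoExactVertexRelationZ2SC_holds`). Counted as a vendored named
fact it could never be discharged — no source asserts it (Glazman–Manolescu 2019, p. 1, quoted
above, expects the opposite) and it is false. Its tenured prove-seat returned the verdict
"refuted in tree / not a fact (technique class)"; re-verified 2026-08-16 against the tree (the
refuting theorem elaborates, axioms standard) and the source (arXiv:1708.00395, p. 1, the sentence
quoted under "What the sources print"). Treatment (human ruling 2026-08-15 on refuted facts: keep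
the `¬`-theorem, retire the def from debt; deprecate rather than delete when it has users): the
def KEEPS its name and body and is marked `@[deprecated]` with a pointer to
`not_hasExactVertexRelationZ2`; the refuting theorem (and `not_hasExactVertexRelationZ2_of_SC` in
the companion module) name it on purpose under `set_option linter.deprecated false in`. Nothing
else changes: the technique class proper is the parametrised predicate `ExactVertexRelationZ2`,
whose emptiness in positive form is `exactVertexRelationZ2_eq_zero`; routes and idea cards that
must address this barrier (D-0021) keep citing `not_hasExactVertexRelationZ2`.
-/

noncomputable section

open Real

namespace Literature.Barriers.CriticalPhenomena

open Literature.Probability.RandomPlanarGeometry.SAW.YangBaxter Literature.Probability.LatticeModels Literature.Probability.Percolation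

/-- The six local Boltzmann weights of the `O(n)` plaquette (loop) model on the square lattice:
empty plaquette `t`, one arc turning at a `θ`-corner `u₁`, one arc at a `(π-θ)`-corner `u₂`,
one straight arc `v`, two `θ`-corner arcs `w₁`, two `(π-θ)`-corner arcs `w₂` (Duminil-Copin
2013, Fig. 12.3; Ikhlef–Cardy 2009, Fig. 4; Glazman 2015, Fig. 1).
[cite: DuminilCopin2013Parafermion, §12.5, Fig. 12.3] -/
structure PlaquetteWeights where
  /-- weight of an empty plaquette -/
  t : ℝ
  /-- weight of a plaquette crossed by one arc turning at a `θ`-corner -/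
  u₁ : ℝ
  /-- weight of a plaquette crossed by one arc turning at a `(π - θ)`-corner -/
  u₂ : ℝ
  /-- weight of a plaquette crossed straight -/
  v : ℝ
  /-- weight of a plaquette crossed by two arcs at the two `θ`-corners -/
  w₁ : ℝ
  /-- weight of a plaquette crossed by two arcs at the two `(π - θ)`-corners -/
  w₂ : ℝ

/-- The weights of the **uniform (vertex) self-avoiding walk on `ℤ²` with fugacity `x`** seen
as an `n = 0` plaquette model: "`u₁ = u₂ = v = x`, `t = 1` and `w₁ = w₂ = n = 0` corresponds to
vertex self-avoiding walks on the square lattice" (a plaquette of the dual lattice is a vertex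
of `ℤ²`; a vertex is visited at most once, with the same weight whether the walk turns or goes
straight). [cite: DuminilCopin2013Parafermion, Remark 12.13] -/
def vertexSAWWeights (x : ℝ) : PlaquetteWeights :=
  ⟨1, x, x, x, 0, 0⟩

/-- **Nienhuis's integrable weights at `n = 0`** for a rhombus of angle `θ ∈ [π/3, 2π/3]`,
normalised by `t = 1`: `(1, u₁(θ), u₂(θ), v(θ), w₁(θ), w₂(θ))` of Glazman 2015, (1.1)–(1.5) =
Glazman–Manolescu 2019, eq. (1) (`Literature.Probability.RandomPlanarGeometry.SAW.YangBaxter.weightU1`, …). "The weights (1.1)–(1.5)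
were discovered by B. Nienhuis in 1990 as solutions of the Yang–Baxter equation. They were
rediscovered by J. Cardy and Y. Ikhlef in 2009 as the weights for which the parafermionic
observable satisfies some particular equations" (Glazman 2015, p. 3).
[cite: Glazman2015WeightedSAW, Theorem 1.1, (1.1)–(1.5)] -/
def nienhuisWeights (θ : ℝ) : PlaquetteWeights :=
  ⟨1, weightU1 θ, weightU2 θ, weightV θ, weightW1 θ, weightW2 θ⟩

/-! ### The square-lattice point `θ = π/2`: closed forms -/

/-- `sin(3π/16) > 0`. [folklore] -/
theorem sin_three_pi_div_sixteen_pos : 0 < sin (3 * π / 16) :=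
  sin_pos_of_pos_of_lt_pi (by positivity) (by nlinarith [pi_pos])

/-- `sin(π/16) > 0`. [folklore] -/
theorem sin_pi_div_sixteen_pos : 0 < sin (π / 16) :=
  sin_pos_of_pos_of_lt_pi (by positivity) (by nlinarith [pi_pos])

/-- `sin(7π/16) > 0`. [folklore] -/
theorem sin_seven_pi_div_sixteen_pos : 0 < sin (7 * π / 16) :=
  sin_pos_of_pos_of_lt_pi (by positivity) (by nlinarith [pi_pos])

/-- `sin(3π/16) < sin(π/4) = √2/2`. [folklore] -/
theorem sin_three_pi_div_sixteen_lt : sin (3 * π / 16) < sin (π / 4) :=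
  sin_lt_sin_of_lt_of_le_pi_div_two (by nlinarith [pi_pos]) (by nlinarith [pi_pos])
    (by nlinarith [pi_pos])

/-- The common denominator at `θ = π/2`: `sin(23π/16) sin(7π/16) = -sin(7π/16)² < 0`.
[cite: Glazman2015WeightedSAW, (1.1)] -/
theorem weightDen_pi_div_two : weightDen (π / 2) = -(sin (7 * π / 16) * sin (7 * π / 16)) := by
  unfold weightDen
  rw [show 5 * π / 4 + 3 * (π / 2) / 8 = 7 * π / 16 + π by ring, sin_add_pi,
    show 5 * π / 8 - 3 * (π / 2) / 8 = 7 * π / 16 by ring]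
  ring

/-- The denominator at `θ = π/2` is negative. [cite: Glazman2015WeightedSAW, (1.1)] -/
theorem weightDen_pi_div_two_neg : weightDen (π / 2) < 0 := by
  rw [weightDen_pi_div_two, neg_lt_zero]
  exact mul_pos sin_seven_pi_div_sixteen_pos sin_seven_pi_div_sixteen_pos

/-- `u₁(π/2) = sin(5π/4) sin(3π/16) / den` (using `sin(13π/16) = sin(3π/16)`).
[cite: Glazman2015WeightedSAW, (1.1)] -/
theorem weightU1_pi_div_two :
    weightU1 (π / 2) = sin (5 * π / 4) * sin (3 * π / 16) / weightDen (π / 2) := by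
  unfold weightU1
  rw [show 5 * π / 8 + 3 * (π / 2) / 8 = π - 3 * π / 16 by ring, sin_pi_sub]

/-- `u₂(π/2) = sin(5π/4) sin(3π/16) / den`. [cite: Glazman2015WeightedSAW, (1.2)] -/
theorem weightU2_pi_div_two :
    weightU2 (π / 2) = sin (5 * π / 4) * sin (3 * π / 16) / weightDen (π / 2) := by
  unfold weightU2
  rw [show 3 * (π / 2) / 8 = 3 * π / 16 by ring]

/-- `v(π/2) = -sin(3π/16)² / den`. [cite: Glazman2015WeightedSAW, (1.3)] -/
theorem weightV_pi_div_two :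
    weightV (π / 2) = sin (3 * π / 16) * -sin (3 * π / 16) / weightDen (π / 2) := by
  unfold weightV
  rw [show 5 * π / 8 + 3 * (π / 2) / 8 = π - 3 * π / 16 by ring, sin_pi_sub,
    show -(3 * (π / 2) / 8) = -(3 * π / 16) by ring, sin_neg]

/-- `w₁(π/2) = -sin(3π/16) sin(π/16) / den` (using `sin(17π/16) = -sin(π/16)`).
[cite: Glazman2015WeightedSAW, (1.4)] -/
theorem weightW1_pi_div_two :
    weightW1 (π / 2) = sin (3 * π / 16) * -sin (π / 16) / weightDen (π / 2) := by
  unfold weightW1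
  rw [show 5 * π / 8 + 3 * (π / 2) / 8 = π - 3 * π / 16 by ring, sin_pi_sub,
    show 5 * π / 4 - 3 * (π / 2) / 8 = π / 16 + π by ring, sin_add_pi]

/-- `w₂(π/2) = -sin(π/16) sin(3π/16) / den` (using `sin(33π/16) = sin(π/16)`).
[cite: Glazman2015WeightedSAW, (1.5)] -/
theorem weightW2_pi_div_two :
    weightW2 (π / 2) = sin (π / 16) * -sin (3 * π / 16) / weightDen (π / 2) := by
  unfold weightW2
  rw [show 15 * π / 8 + 3 * (π / 2) / 8 = π / 16 + 2 * π by ring, sin_add_two_pi,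
    show -(3 * (π / 2) / 8) = -(3 * π / 16) by ring, sin_neg]

/-- "In the case `θ = π/2` the weights are symmetric, i.e. `u₁ = u₂`".
[cite: Glazman2015WeightedSAW, p. 3] -/
theorem weightU1_eq_weightU2_pi_div_two : weightU1 (π / 2) = weightU2 (π / 2) := by
  rw [weightU1_pi_div_two, weightU2_pi_div_two]

/-- "In the case `θ = π/2` the weights are symmetric, i.e. … `w₁ = w₂`".
[cite: Glazman2015WeightedSAW, p. 3] -/
theorem weightW1_eq_weightW2_pi_div_two : weightW1 (π / 2) = weightW2 (π / 2) := by
  rw [weightW1_pi_div_two, weightW2_pi_div_two]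
  ring

/-- At `θ = π/2` a rhombus crossed twice has POSITIVE weight `w₁ = w₂ > 0` ("a self-avoiding
walk on `ℤ²` which is allowed to touch itself but each time gets penalised by `w₁/u₁²`").
[cite: Glazman2015WeightedSAW, p. 3] -/
theorem weightW1_pi_div_two_pos : 0 < weightW1 (π / 2) := by
  rw [weightW1_pi_div_two]
  refine div_pos_iff.2 (Or.inr ⟨?_, weightDen_pi_div_two_neg⟩)
  have h1 := sin_three_pi_div_sixteen_pos
  have h2 := sin_pi_div_sixteen_pos
  nlinarith

/-- At `θ = π/2` the turning weight is positive, `u₁ > 0`. [cite: Glazman2015WeightedSAW, p. 3] -/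
theorem weightU1_pi_div_two_pos : 0 < weightU1 (π / 2) := by
  rw [weightU1_pi_div_two]
  refine div_pos_iff.2 (Or.inr ⟨?_, weightDen_pi_div_two_neg⟩)
  have h1 := sin_three_pi_div_sixteen_pos
  have h2 : sin (5 * π / 4) < 0 := by
    rw [show 5 * π / 4 = π / 4 + π by ring, sin_add_pi, sin_pi_div_four]
    have : (0 : ℝ) < √2 := Real.sqrt_pos.2 (by norm_num)
    linarith
  nlinarith

/-- At `θ = π/2` a straight crossing is penalised relative to a turn: `v < u₁` (numerically
`v/u₁ = √2 sin(3π/16) ≈ 0.785`, "penalised by `v/u₁ ≈ 0.785` for each vertex it passes without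
a turn"). [cite: Glazman2015WeightedSAW, p. 3] -/
theorem weightV_lt_weightU1_pi_div_two : weightV (π / 2) < weightU1 (π / 2) := by
  rw [weightV_pi_div_two, weightU1_pi_div_two, div_lt_div_right_of_neg weightDen_pi_div_two_neg]
  have h1 := sin_three_pi_div_sixteen_pos
  have h2 : sin (5 * π / 4) = -sin (π / 4) := by
    rw [show 5 * π / 4 = π / 4 + π by ring, sin_add_pi]
  have h3 := sin_three_pi_div_sixteen_lt
  rw [h2]
  nlinarith

/-! ### The technique class: an exact local linear relation for the uniform `ℤ²` observable -/

/-- The four lattice directions `e₀, e₁, -e₀, -e₁` of `ℤ²`. [folklore] -/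
def dirZ2 : Fin 4 → Site 2 := ![![1, 0], ![0, 1], ![-1, 0], ![0, -1]]

/-- **Technique class (explicit).** `ExactVertexRelationZ2 x σ c`: the coefficients
`c : Fin 4 → ℂ` give an EXACT LOCAL LINEAR RELATION, at fugacity `x` and spin `σ`, for the
uniform square-lattice SAW's mid-edge parafermionic observable
`F = Literature.SAW.midEdgeParafermionicObservable Ω δ a x σ` — for every discrete domain `Ω_δ ⊆ δℤ²`,
every root `a ∈ Ω_δ` on its boundary (some lattice neighbour of `a` falls outside `Ω`) and every
vertex `v` whose four neighbours are joined to it in `Ω_δ`,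
`Σᵢ cᵢ F({v, v + dirᵢ}) = 0`. This is the square-lattice shape of Duminil-Copin–Smirnov's
hexagonal Lemma 1 (there `c = (p - v, q - v, r - v)`, `x = x_c`, `σ = 5/8`); the term is that
of the guard `NoExactVertexRelation` of route `CriticalPhenomena/SAWScalingLimit/SAWParafermion`.
[cite: DuminilCopinSmirnov2012, Lemma 1 (shape of the relation)] -/
def ExactVertexRelationZ2 (x σ : ℝ) (c : Fin 4 → ℂ) : Prop :=
  ∀ (Ω : Set ℂ) (δ : ℝ) (a v : Site 2), 0 < δ → a ∈ meshDomain Ω δ →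
    (∃ w : Site 2, (zdGraph 2).Adj a w ∧ meshPoint δ w ∉ Ω) →
    (∀ i : Fin 4, (discreteDomainGraph Ω δ).Adj v (v + dirZ2 i)) →
      ∑ i : Fin 4, c i * Literature.Probability.RandomPlanarGeometry.SAW.midEdgeParafermionicObservable Ω δ a x σ s(v, v + dirZ2 i) = 0

/-- **Technique class, inhabited form (REFUTED — deprecated record, verdict clean-up
2026-08-16).** The uniform square-lattice SAW observable admits SOME exact local linear relation
with non-zero vertex-independent coefficients at some fugacity `x ∈ (0, 1)` and spin `σ` — the
discrete-holomorphicity route to `μ(ℤ²)` and to the observable's scaling limit, transplanted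
verbatim from the hexagonal lattice (the shape of Duminil-Copin–Smirnov 2012, Lemma 1). This
closed `Prop` is NOT a published result and can never be discharged: the cited authors expect its
NEGATION (Glazman–Manolescu 2019, p. 1: the square-lattice walk "is not believed to be integrable,
therefore it is not reasonable to expect any explicit formula for the connective constant in this
case, nor the existence of a well-behaved equivalent observable"), route `SAWParafermion` records
that negation as the guard `NoExactVertexRelation`, and the negation is a THEOREM of this file:
**`not_hasExactVertexRelationZ2 : ¬ HasExactVertexRelationZ2`** (Appendix A, kept), strengthened
to compact star-shaped domains by `NoExactVertexRelationZ2SC_holds`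
(`Literature.Barriers.CriticalPhenomena.NienhuisWeightsExcludeVertexSAWStarConvex`). The
statement is therefore retired from the named-fact ledger (deprecated, not deleted: the refuting
theorems and the companion module name it, six `SAWScalingLimit` theses name it in prose and
thirteen more name its refutation); its body is unchanged. **Use instead:** the explicit
technique class is the parametrised predicate `ExactVertexRelationZ2 x σ c` (above); its
emptiness in positive form is
`exactVertexRelationZ2_eq_zero : 0 < x → x < 1 → ExactVertexRelationZ2 x σ c → c = 0`, in
negative form `not_hasExactVertexRelationZ2`. No `HasExactVertexRelationZ2_holds` can exist.
[cite: DuminilCopinSmirnov2012, Lemma 1 (shape of the relation)] -/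
@[deprecated "refuted technique-class statement, never dischargeable: its negation is the theorem \
Literature.Barriers.CriticalPhenomena.not_hasExactVertexRelationZ2 (this file, Appendix A; on compact \
star-shaped domains: NoExactVertexRelationZ2SC_holds, module NienhuisWeightsExcludeVertexSAWStarConvex); \
the technique class itself is the predicate ExactVertexRelationZ2 x σ c, empty by \
exactVertexRelationZ2_eq_zero" (since := "2026-08-16")]
def HasExactVertexRelationZ2 : Prop :=
  ∃ (x σ : ℝ) (c : Fin 4 → ℂ), 0 < x ∧ x < 1 ∧ c ≠ 0 ∧ ExactVertexRelationZ2 x σ c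

/-! ### The barrier -/

/-- **Barrier `NienhuisWeightsExcludeVertexSAW`.** At the square-lattice angle `θ = π/2`, the
`n = 0` plaquette weights singled out by discrete holomorphicity of the parafermionic
observable — which are Nienhuis's Yang–Baxter-integrable weights (Ikhlef–Cardy 2009, §3;
Duminil-Copin 2013, eq. (12.7): "the unique solution"; Glazman 2015, Thm 1.1) — are NOT the
weights `(1, x, x, x, 0, 0)` of the uniform vertex self-avoiding walk on `ℤ²` (Duminil-Copin
2013, Remark 12.13), for any fugacity `x`: they charge a positive weight `w₁ = w₂ > 0` to a
plaquette crossed twice and penalise straight crossings, `v < u₁` (Glazman 2015, p. 3), and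
their growth constant `1/u₁(π/2) = 2.448…` "is below the predicted value `≈ 2.638` for a
connective constant of `ℤ²`" (ibid.). PROVED below (`NienhuisWeightsExcludeVertexSAW_holds`);
the audit appendix adds the proof that the technique class itself is empty
(`not_hasExactVertexRelationZ2`; see `scope_caveats`).

BARRIER (structured block, D-0021):
- technique_class: discrete-holomorphicity parafermionic-observable yang-baxter-integrability exact-local-relation — explicitly the predicate `ExactVertexRelationZ2 x σ c` (an exact local linear relation `Σᵢ cᵢ F({v, v+dirᵢ}) = 0`, `c` vertex-independent, for the uniform `ℤ²` observable `Literature.Probability.RandomPlanarGeometry.SAW.midEdgeParafermionicObservable` at fugacity `x` and spin `σ`); its inhabited form `HasExactVertexRelationZ2` (some `x ∈ (0,1)`, `σ`, `c ≠ 0`) is REFUTED in this file (`not_hasExactVertexRelationZ2`; positive form `exactVertexRelationZ2_eq_zero`) and is kept only as a `@[deprecated]` record (verdict clean-up 2026-08-16)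
- blocks: obtaining, for the UNIFORM self-avoiding walk on `ℤ²` (the lattice of `Literature.Probability.RandomPlanarGeometry.SAW.SAWScalingLimit`), an exact local linear relation of the Duminil-Copin–Smirnov type (`HasExactVertexRelationZ2`) by the plaquette/vertex discrete-holomorphicity computation that yields Lemma 1 on the hexagonal lattice (⇒ `μ(ℍ) = √(2+√2)`, `Literature.Probability.RandomPlanarGeometry.SAW.DuminilCopinSmirnov2012_thm1`) and DCS Conjecture 2's programme (route `SAWParafermion` r2, guard `NoExactVertexRelation`); a closed form for `μ(ℤ²)` by this method [cite: Glazman2015WeightedSAW, p. 1] [cite: GlazmanManolescu2019, p. 1]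
- because: on the (deformed) square lattice the plaquette holomorphicity relations for the `O(n)` parafermion form a linear system in the six local weights `t, u₁, u₂, v, w₁, w₂` whose non-degenerate (`v ≠ 0`) solutions are exactly Nienhuis's integrable weights [cite: IkhlefCardy2009, §3 (holomorphicity linear system and its solutions)] ("the unique solution", [cite: DuminilCopin2013Parafermion, §12.5, eq. (12.7)]; "half-holomorphic observables … always correspond to weights for which the Yang–Baxter relation holds", [cite: DuminilCopin2013Parafermion, §12.5.1]); at `θ = π/2`, `n = 0` these weights allow self-touching (`w₁ > 0`) and weigh turns and straight steps differently (`v < u₁`), so they are not the uniform SAW's `(1,x,x,x,0,0)` (this file, proved) and give growth constant `2.448… < 2.638…` [cite: Glazman2015WeightedSAW, p. 3]; the uniform square-lattice SAW "does not seem to be integrable" [cite: Glazman2015WeightedSAW, p. 1], "is not believed to be integrable, therefore it is not reasonable to expect any explicit formula for the connective constant in this case, nor the existence of a well-behaved equivalent observable" [cite: GlazmanManolescu2019, p. 1]; for `n = 0` the classification is Glazman's Lemma 3.1: for `σ = ℓ/8`, `ℓ` odd, the weights for which the observable satisfies the half-Cauchy–Riemann relation around a rhombus are UNIQUE (and are (1.1)–(1.5)),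 for `σ = 1` they form the degenerate family `u₁ + u₂ = 1, w₁ = u₁, w₂ = u₂`, and "for all other values of `σ` the weights … exist only for some specific values of `θ`" [cite: Glazman2015WeightedSAW, Lemma 3.1] (audit computation on the Ikhlef–Cardy system at `n = 0`, `α = π/2`: its rank drops exactly at `σ ∈ {1/8, 3/8, 5/8, 7/8} + ℤ` — "a priori four possible choices for `σ`" [cite: DuminilCopin2013Parafermion, §12.5] — and at odd `σ` (the `v = 0` family), and no solution has `w₁ = w₂ = 0`); for the formal technique class the obstruction is unconditional and elementary (this file, `not_hasExactVertexRelationZ2`, and on compact star-shaped domains `NoExactVertexRelationZ2SC_holds` of the companion module): on the plus-shaped 5-site domain the relation forces the discrete Cauchy–Riemann stencil `c ∝ (1, ±i, -1, ∓i)` and `x = 1/(1 + 2|sin(πσ/2)|)` (extension groups: a walk reaching a neighbour of `v` against its three continuations through `v`), a walk returning to the neighbourhood of `v` through two ADJACENT exits forces `e^{-5iπσ/2} = ±i`, one returning through OPPOSITE exits forces `e^{-3iπσ} = 1`, and the three conditions are incompatible — the degree-4 vertex of `ℤ²` has two inequivalent loop-return classes where the degree-3 hexagonal vertex has one (there the pairs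 fix `σ = 5/8` and the triples fix `x_c = 1/√(2+√2)`) [cite: DuminilCopinSmirnov2012, Lemma 1]
- evasions_known: work on the integrable neighbours and transfer — Glazman 2015 Thm 1.1 (connective constant `1/u₁(θ)` of the Yang–Baxter-weighted walk, all `θ ∈ [π/3, 2π/3]`) [cite: Glazman2015WeightedSAW, Theorem 1.1]; Glazman–Manolescu: the Yang–Baxter walks on rhombic tilings of `ℤ²` have the same boundary two-point function and critical fugacity as the hexagonal walk (`Literature.Probability.RandomPlanarGeometry.SAW.YangBaxter.GlazmanManolescu2019_thm1`, `_thm3`) [cite: GlazmanManolescu2019, Theorems 1–3] (route `SAWHexUniversality`); statements about the scaling LIMIT of a `ℤ²` observable (DCS Conjecture 2 transposed) do not require an exact lattice identity [cite: DuminilCopinSmirnov2012, §4, Conjecture 2]; INEXACT identities: on `ℤ²` strips the Duminil-Copin–Smirnov boundary identity fails at every finite width but is observed numerically to hold asymptotically with lattice-dependent constants (`c_α/c_β = 0.382683(2)`, "close to, and probably equal to" `cos(3π/8)`; `A_T(z_c) → a₀ ≈ 1.024966/cos(3π/8)`), which estimates `z_c(ℤ²) = 0.3790522775(5)` [cite: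 BeatonGuttmannJensen2012, pp. 2, 5, 13] — identities with a remainder vanishing in the limit lie outside the technique class; no EXACT identity is published for the uniform `ℤ²` walk itself ("there is no known appropriate parafermionic observable satisfying an identity like (1)" [cite: BeatonGuttmannJensen2012, p. 2])
- scope_caveats: the formal content is the weight comparison `nienhuisWeights (π/2) ≠ vertexSAWWeights x` (with `u₁ = u₂`, `w₁ = w₂ > 0`, `v < u₁` at `θ = π/2`), the DEFINITION of the technique class `ExactVertexRelationZ2 x σ c` (inhabited form: the deprecated record `HasExactVertexRelationZ2`), and (audit appendices) its EMPTINESS `not_hasExactVertexRelationZ2` (Appendix A, six instances) together with the stronger `NoExactVertexRelationZ2SC_holds` (Appendix B = module `NienhuisWeightsExcludeVertexSAWStarConvex`, seven instances on compact star-shaped domains); caveats on the latter two: (a) Appendix A exercises the class's quantifier over ALL finite discrete domains and boundary roots — the plus-shaped domain with each arm as root and two NON-simply-connected domains (`T`: plus ∪ an 8-cycle through `N, W` around the absent site `(-1,1)`; `O`: plus ∪ a 14-cycle through `N, S`), chosen so that each carries exactly one loop-return pair; Appendix B shows that the holes are inessential: demanded only on discrete domains cut out by COMPACT STAR-SHAPED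 (hence simply connected) plane sets — the plus (four roots), the closed unit squares `Q = [-1,0]×[0,1]`, `Q̄ = [-1,0]×[-1,0]` and the closed rectangle `O₂ = [-1,0]×[-1,1]`, each with its pendant unit edges at `v = 0` and rooted at the leaf `(1,0)` — the relation still forces `c = 0` (`Q − P`, `Q̄ − P` reproduce the adjacent-return rows `x⁵(0, t⁻³, t², 0)`, `x⁵(0, 0, t⁻², t³)`, and `O₂` then the opposite-return row `x⁷(0, t⁻³, 0, t³)`, so Appendix A's elimination applies verbatim); single hole-free blocks may still carry isolated block-dependent near-solutions — numerically the `3×3`, `4×3`, `5×5` blocks with a pendant root admit isolated spins `σ ≈ 0.60486`, `0.60497`/`0.60588` (by root side), `0.60714` with the same stencil, and the seven star-shaped instances of Appendix B have smallest relative singular value `4.7·10⁻⁴`, attained at `σ ≈ 0.6053`, `x ≈ 0.38058` (floating point) — the local face of the INEXACT identities of `evasions_known` (`x` close to `z_c(ℤ²) = 0.37905…` [cite: BeatonGuttmannJensen2012, p. 5]), not an exact relation; (b) ONLY 4-term single-vertex stencils with root- and domain-independent coefficients on the mid-edge observable `Literature.Probability.RandomPlanarGeometry.SAW.midEdgeParafermionicObservable`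 (vertex-rooted walks — immaterial here, every root used being a leaf of its domain) are excluded; letting the coefficients depend on the vertex `v` adds nothing (the plus instance centred at `v` forces the Cauchy–Riemann stencil at each `v` separately and the relation is homogeneous); the 8-coefficient variant (separate coefficients for the two half-edge terms of each edge) admits only walk-wise trivial relations `1 + λt + λ̄t⁻¹ = 0`, valid for every `x` (hand computation, not formalised); NO theorem here excludes identities with an explicit remainder (signed sums over loop-return walks), larger or multi-vertex stencils, boundary/strip identities, asymptotic identities [cite: BeatonGuttmannJensen2012, p. 5], or observables of modified walks (Yang–Baxter weights) [cite: GlazmanManolescu2019, Theorems 1–3]; (c) NOT formalised: the `O(n)` plaquette model with general weights and its observable, so the printed classification "holomorphic ⇒ Nienhuis weights" (derived for the plaquette-sum holomorphicity relation on the medial lattice, with fixed external connectivities [cite: IkhlefCardy2009, §3]) stays quoted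
- status: established — the weight comparison and the emptiness of the formal technique class (`¬ HasExactVertexRelationZ2`, Appendix A; already on compact star-shaped domains, `NoExactVertexRelationZ2SC`, Appendix B) are theorems of this file and of its companion module `NienhuisWeightsExcludeVertexSAWStarConvex`; the printed weight classification is quoted [cite: IkhlefCardy2009, §3] [cite: DuminilCopin2013Parafermion, eq. (12.7)] [cite: Glazman2015WeightedSAW, Lemma 3.1]; the non-existence of exact identities of OTHER shapes for the uniform `ℤ²` walk remains the cited authors' expectation [cite: GlazmanManolescu2019, p. 1]

[cite: Glazman2015WeightedSAW, p. 3] [cite: DuminilCopin2013Parafermion, Remark 12.13 and eq. (12.7)]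
[cite: IkhlefCardy2009, §3] -/
def NienhuisWeightsExcludeVertexSAW : Prop :=
  ∀ x : ℝ, nienhuisWeights (π / 2) ≠ vertexSAWWeights x

/-- The integrable weights at `θ = π/2` differ from the vertex-SAW weights for every fugacity:
they have `w₁ > 0`, the vertex SAW has `w₁ = 0`. [cite: Glazman2015WeightedSAW, p. 3]
[cite: DuminilCopin2013Parafermion, Remark 12.13] -/
theorem nienhuisWeights_pi_div_two_ne_vertexSAWWeights (x : ℝ) :
    nienhuisWeights (π / 2) ≠ vertexSAWWeights x := by
  intro h
  have hw : (nienhuisWeights (π / 2)).w₁ = (vertexSAWWeights x).w₁ := by rw [h]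
  have hpos := weightW1_pi_div_two_pos
  simp only [nienhuisWeights, vertexSAWWeights] at hw
  linarith

/-- Discharge of `NienhuisWeightsExcludeVertexSAW`. [cite: Glazman2015WeightedSAW, p. 3] -/
theorem NienhuisWeightsExcludeVertexSAW_holds : NienhuisWeightsExcludeVertexSAW :=
  nienhuisWeights_pi_div_two_ne_vertexSAWWeights

/-- A second witness, independent of self-touching: even the one-arc weights differ from the
uniform walk's, since `v(π/2) < u₁(π/2)` while the vertex SAW has `v = u₁ = x`.
[cite: Glazman2015WeightedSAW, p. 3] -/
theorem weightV_ne_weightU1_pi_div_two : (nienhuisWeights (π / 2)).v ≠ (nienhuisWeights (π / 2)).u₁ :=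
  ne_of_lt weightV_lt_weightU1_pi_div_two

/-- The technique class is non-vacuously typed: with zero coefficients every relation holds
(which is why `HasExactVertexRelationZ2` demands `c ≠ 0`). [folklore] -/
theorem exactVertexRelationZ2_zero (x σ : ℝ) : ExactVertexRelationZ2 x σ 0 := by
  intro Ω δ a v _ _ _ _
  simp

/-! ## Appendix (barrier audit): the technique class `HasExactVertexRelationZ2` is empty

`not_hasExactVertexRelationZ2 : ¬ HasExactVertexRelationZ2` — the uniform square-lattice SAW
mid-edge observable `Literature.Probability.RandomPlanarGeometry.SAW.midEdgeParafermionicObservable` satisfies NO exact local linear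
relation `Σᵢ cᵢ F({v, v + dirᵢ}) = 0` with vertex-independent `c ≠ 0`, at any fugacity
`x ∈ (0, 1)` and any spin `σ`. The proof instantiates the relation (which quantifies over all
discrete domains, boundary roots and interior vertices) on six explicit finite domains at mesh
`δ = 1`, vertex `v = (0,0)`, and eliminates.

* **Domains as plane sets.** For an explicit list `E` of unit lattice darts, `Omega E ⊆ ℂ` is the
  union of the closed unit segments; a lattice point on a unit segment is an endpoint and a unit
  midpoint lies on no other unit segment, so (`GoodEdgeList`: unit darts + a `decide`d
  connectivity certificate) `meshDomain (Omega E) 1` = the listed vertices and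
  `discreteDomainGraph (Omega E) 1` has exactly the listed edges (`GoodEdgeList.mem_meshDomain_iff`,
  `GoodEdgeList.adj_iff`).
* **Walk enumeration.** `dfs` enumerates self-avoiding vertex lists; `GoodEdgeList.support_mem_dfs`
  (completeness) reduces "every `DomainSAW` from `a` to `z` is one of the following" to `decide`.
* **Windings.** On `ℤ²` every turn is `0` or `±π/2`; `winding_support_medial` computes the winding
  of a walk continued to a mid-edge as `(quarter turns) · π/2` from integer cross products, so each
  summand of `halfEdgeTerm` is `x^{n} t^{k}` with `t = tOf σ = e^{-iσπ/2}`.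
* **Rows.** Domain `P` (the plus: `v` and its four neighbours; root each of the four arms, a leaf)
  gives the row `(x, x²t⁻¹, x², x²t)` and its cyclic shifts; `T = P ∪` the 8-cycle
  `v, N, (0,2), (-1,2), (-2,2), (-2,1), (-2,0), W` adds `x⁹(0, t⁻³, t², 0)` (one loop-return pair
  through the ADJACENT exits `N, W`); `O = P ∪` the 14-cycle through `N`, the row `y = 2`, the
  column `x = -3`, the row `y = -2` and `S` adds `x¹⁵(0, t⁻³, 0, t³)` (one pair through the
  OPPOSITE exits `N, S`). In every instance the root `(±1,0)`/`(0,±1)` is a leaf of the domain, so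
  the vertex-rooted convention of the observable plays no role.
* **Elimination** (`vertexStencil_eq_zero_of_rows`): the four `P`-rows force `c₂ = -c₀`,
  `c₃ = -c₁` (the symmetric and alternating sums carry the non-vanishing factors
  `x(1 + x ± 2x Re t)`), `O` forces `c₁ = 0 ∨ t⁶ = 1`, `T` forces `c₀ t⁵ = c₁`; `c₁ = 0` gives
  `c = 0`, and `t⁶ = 1` with the first `P`-row gives `t²(1 - 2x) = -x`, so `|1 - 2x| = x`,
  `x = 1/3`, `t² = -1`, `t⁶ = -1`, contradiction.

Scope of this theorem: see `scope_caveats` (a)–(b) of the barrier block (all finite domains are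
used, two of them not simply connected; only the 4-term vertex-independent stencil is excluded).
-/

section TechniqueClassEmpty

open Complex ComplexConjugate

namespace NoVertexRelation

/-! ### Integer coordinates -/

/-- Integer pairs (computation-friendly coordinates for `Site 2 = Fin 2 → ℤ`). [folklore] -/
abbrev ZZ : Type := ℤ × ℤ

/-- The site with coordinates `p`. [folklore] -/
def toSite (p : ZZ) : Site 2 := ![p.1, p.2]

/-- The coordinates of a site. [folklore] -/
def ofSite (s : Site 2) : ZZ := (s 0, s 1)

/-- Coordinate bookkeeping between `ℤ × ℤ` and `Site 2`. [folklore] -/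
@[simp] theorem toSite_apply_zero (p : ZZ) : toSite p 0 = p.1 := rfl
/-- Coordinate bookkeeping between `ℤ × ℤ` and `Site 2`. [folklore] -/
@[simp] theorem toSite_apply_one (p : ZZ) : toSite p 1 = p.2 := rfl
/-- Coordinate bookkeeping between `ℤ × ℤ` and `Site 2`. [folklore] -/
@[simp] theorem ofSite_fst (s : Site 2) : (ofSite s).1 = s 0 := rfl
/-- Coordinate bookkeeping between `ℤ × ℤ` and `Site 2`. [folklore] -/
@[simp] theorem ofSite_snd (s : Site 2) : (ofSite s).2 = s 1 := rfl
/-- Coordinate bookkeeping between `ℤ × ℤ` and `Site 2`. [folklore] -/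
@[simp] theorem ofSite_toSite (p : ZZ) : ofSite (toSite p) = p := rfl

/-- Coordinate bookkeeping between `ℤ × ℤ` and `Site 2`. [folklore] -/
@[simp] theorem toSite_ofSite (s : Site 2) : toSite (ofSite s) = s := by
  funext i; fin_cases i <;> rfl

/-- The coordinate change is injective. [folklore] -/
theorem ofSite_injective : Function.Injective ofSite := fun s t h => by
  rw [← toSite_ofSite s, h, toSite_ofSite]

/-- The coordinate change is injective. [folklore] -/
theorem toSite_injective : Function.Injective toSite := fun p q h => by
  rw [← ofSite_toSite p, h, ofSite_toSite]

/-- The complex point with integer coordinates `p`. [folklore] -/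
def pt (p : ZZ) : ℂ := ⟨p.1, p.2⟩

/-- Components of the integer point `pt p`. [folklore] -/
@[simp] theorem pt_re (p : ZZ) : (pt p).re = p.1 := rfl
/-- Components of the integer point `pt p`. [folklore] -/
@[simp] theorem pt_im (p : ZZ) : (pt p).im = p.2 := rfl

/-- At mesh `1` the mesh point of a site is its integer point. [folklore] -/
theorem meshPoint_one (s : Site 2) : meshPoint 1 s = pt (ofSite s) := by
  apply Complex.ext <;> simp

/-- At mesh `1` the mesh point of a site is its integer point. [folklore] -/
theorem meshPoint_one_toSite (p : ZZ) : meshPoint 1 (toSite p) = pt p := by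
  rw [meshPoint_one, ofSite_toSite]

/-! ### Unit segments -/

/-- `e = (p, q)` is a positively oriented unit lattice edge: `q = p + (1,0)` or `q = p + (0,1)`.
[folklore] -/
def IsUnitDart (e : ZZ × ZZ) : Prop :=
  e.2 = (e.1.1 + 1, e.1.2) ∨ e.2 = (e.1.1, e.1.2 + 1)

/-- Decidability instance (kernel computation by `decide`). [folklore] -/
instance : DecidablePred IsUnitDart := fun e => by unfold IsUnitDart; infer_instance

/-- The closed segment of the plane spanned by the lattice edge `e`. [folklore] -/
def seg (e : ZZ × ZZ) : Set ℂ := segment ℝ (pt e.1) (pt e.2)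

/-- The midpoint of the lattice edge `e`. [folklore] -/
def midpt (e : ZZ × ZZ) : ℂ := (pt e.1 + pt e.2) / 2

/-- Unit segments are closed. [folklore] -/
theorem isClosed_seg (e : ZZ × ZZ) : IsClosed (seg e) := by
  rw [seg, segment_eq_image]
  exact (isCompact_Icc.image (by fun_prop)).isClosed

/-- Membership in a lattice segment, in coordinates. [folklore] -/
theorem mem_seg_iff (e : ZZ × ZZ) (z : ℂ) :
    z ∈ seg e ↔ ∃ θ : ℝ, 0 ≤ θ ∧ θ ≤ 1 ∧ z.re = (e.1.1 : ℝ) + θ * (e.2.1 - e.1.1) ∧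
      z.im = (e.1.2 : ℝ) + θ * (e.2.2 - e.1.2) := by
  rw [seg, segment_eq_image]
  constructor
  · rintro ⟨θ, ⟨h0, h1⟩, rfl⟩
    refine ⟨θ, h0, h1, ?_, ?_⟩ <;> simp [pt] <;> ring
  · rintro ⟨θ, h0, h1, hre, him⟩
    refine ⟨θ, ⟨h0, h1⟩, Complex.ext ?_ ?_⟩
    · simp [pt, hre]; ring
    · simp [pt, him]; ring

/-- A lattice point on a unit lattice segment is one of its endpoints. [folklore] -/
theorem pt_mem_seg_iff {e : ZZ × ZZ} (he : IsUnitDart e) (r : ZZ) :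
    pt r ∈ seg e ↔ r = e.1 ∨ r = e.2 := by
  constructor
  · intro h
    obtain ⟨θ, h0, h1, hre, him⟩ := (mem_seg_iff e _).1 h
    simp only [pt_re, pt_im] at hre him
    rcases he with he | he
    · rw [he] at hre him ⊢
      simp only [Int.cast_add, Int.cast_one] at hre him
      have h2 : (r.2 : ℝ) = e.1.2 := by linarith
      have h2' : r.2 = e.1.2 := by exact_mod_cast h2
      have hθ : θ = (r.1 : ℝ) - e.1.1 := by linarith
      have hb0 : (0 : ℝ) ≤ ((r.1 - e.1.1 : ℤ) : ℝ) := by push_cast; linarith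
      have hb1 : ((r.1 - e.1.1 : ℤ) : ℝ) ≤ 1 := by push_cast; linarith
      have hb0' : 0 ≤ r.1 - e.1.1 := by exact_mod_cast hb0
      have hb1' : r.1 - e.1.1 ≤ 1 := by exact_mod_cast hb1
      rcases (show r.1 = e.1.1 ∨ r.1 = e.1.1 + 1 by omega) with h | h
      · exact Or.inl (Prod.ext h h2')
      · exact Or.inr (Prod.ext h h2')
    · rw [he] at hre him ⊢
      simp only [Int.cast_add, Int.cast_one] at hre him
      have h1' : (r.1 : ℝ) = e.1.1 := by linarith
      have h1'' : r.1 = e.1.1 := by exact_mod_cast h1'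
      have hb0 : (0 : ℝ) ≤ ((r.2 - e.1.2 : ℤ) : ℝ) := by push_cast; linarith
      have hb1 : ((r.2 - e.1.2 : ℤ) : ℝ) ≤ 1 := by push_cast; linarith
      have hb0' : 0 ≤ r.2 - e.1.2 := by exact_mod_cast hb0
      have hb1' : r.2 - e.1.2 ≤ 1 := by exact_mod_cast hb1
      rcases (show r.2 = e.1.2 ∨ r.2 = e.1.2 + 1 by omega) with h | h
      · exact Or.inl (Prod.ext h1'' h)
      · exact Or.inr (Prod.ext h1'' h)
  · rintro (rfl | rfl)
    · exact left_mem_segment ℝ _ _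
    · exact right_mem_segment ℝ _ _

/-- The midpoint of a unit lattice edge lies on it. [folklore] -/
theorem midpt_mem_seg (e : ZZ × ZZ) : midpt e ∈ seg e := by
  rw [mem_seg_iff]
  refine ⟨1 / 2, by norm_num, by norm_num, ?_, ?_⟩ <;> simp [midpt, pt] <;> ring

/-- The midpoint of a unit lattice edge lies on no other unit lattice edge. [folklore] -/
theorem midpt_mem_seg_iff {e e' : ZZ × ZZ} (he : IsUnitDart e) (he' : IsUnitDart e') :
    midpt e' ∈ seg e ↔ e' = e := by
  refine ⟨fun h => ?_, fun h => h ▸ midpt_mem_seg e⟩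
  obtain ⟨θ, h0, h1, hre, him⟩ := (mem_seg_iff e _).1 h
  have hre' : (midpt e').re = ((e'.1.1 : ℝ) + e'.2.1) / 2 := by simp [midpt, pt]
  have him' : (midpt e').im = ((e'.1.2 : ℝ) + e'.2.2) / 2 := by simp [midpt, pt]
  rw [hre'] at hre; rw [him'] at him
  obtain ⟨⟨p1, p2⟩, ⟨q1, q2⟩⟩ := e
  obtain ⟨⟨p1', p2'⟩, ⟨q1', q2'⟩⟩ := e'
  simp only [IsUnitDart, Prod.mk.injEq] at he he'
  simp only at hre him
  rcases he with ⟨hq1, hq2⟩ | ⟨hq1, hq2⟩ <;> rcases he' with ⟨hq1', hq2'⟩ | ⟨hq1', hq2'⟩ <;>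
    simp only [hq1, hq2, hq1', hq2'] at hre him <;> push_cast at hre him
  · -- both horizontal
    have h2 : (p2' : ℝ) = p2 := by linarith
    have h2' : p2' = p2 := by exact_mod_cast h2
    have hb0 : (-1 : ℝ) < ((p1' - p1 : ℤ) : ℝ) := by push_cast; nlinarith
    have hb1 : ((p1' - p1 : ℤ) : ℝ) < 1 := by push_cast; nlinarith
    have hb0' : -1 < p1' - p1 := by exact_mod_cast hb0
    have hb1' : p1' - p1 < 1 := by exact_mod_cast hb1
    have h1' : p1' = p1 := by omega
    refine Prod.ext (Prod.ext ?_ ?_) (Prod.ext ?_ ?_) <;> simp only <;> omega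
  · -- e horizontal, e' vertical: the midpoint has half-integer ordinate
    exfalso
    have h2' : ((2 * p2' + 1 : ℤ) : ℝ) = ((2 * p2 : ℤ) : ℝ) := by push_cast; nlinarith
    have h2'' : 2 * p2' + 1 = 2 * p2 := by exact_mod_cast h2'
    omega
  · -- e vertical, e' horizontal
    exfalso
    have h2' : ((2 * p1' + 1 : ℤ) : ℝ) = ((2 * p1 : ℤ) : ℝ) := by push_cast; nlinarith
    have h2'' : 2 * p1' + 1 = 2 * p1 := by exact_mod_cast h2'
    omega
  · -- both vertical
    have h1' : (p1' : ℝ) = p1 := by linarith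
    have h1'' : p1' = p1 := by exact_mod_cast h1'
    have hb0 : (-1 : ℝ) < ((p2' - p2 : ℤ) : ℝ) := by push_cast; nlinarith
    have hb1 : ((p2' - p2 : ℤ) : ℝ) < 1 := by push_cast; nlinarith
    have hb0' : -1 < p2' - p2 := by exact_mod_cast hb0
    have hb1' : p2' - p2 < 1 := by exact_mod_cast hb1
    have h2' : p2' = p2 := by omega
    refine Prod.ext (Prod.ext ?_ ?_) (Prod.ext ?_ ?_) <;> simp only <;> omega

/-! ### The domain spanned by a list of unit edges -/

/-- The plane set `Ω_E`: the union of the closed unit segments of the edge list `E`. [folklore] -/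
def Omega (E : List (ZZ × ZZ)) : Set ℂ := {z | ∃ e ∈ E, z ∈ seg e}

/-- `Ω_E` is closed (a finite union of closed segments). [folklore] -/
theorem isClosed_Omega (E : List (ZZ × ZZ)) : IsClosed (Omega E) := by
  have : Omega E = ⋃ e ∈ {e | e ∈ E}, seg e := by
    ext z; simp [Omega]
  rw [this]
  exact (List.finite_toSet E).isClosed_biUnion fun e _ => isClosed_seg e

/-- `Ω_E` is closed (a finite union of closed segments). [folklore] -/
theorem closure_Omega (E : List (ZZ × ZZ)) : closure (Omega E) = Omega E :=
  (isClosed_Omega E).closure_eq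

/-- The vertex list of the edge list `E` (with repetitions). [folklore] -/
def verts (E : List (ZZ × ZZ)) : List ZZ := E.flatMap fun e => [e.1, e.2]

/-- Membership in the vertex list of an edge list. [folklore] -/
theorem mem_verts_iff {E : List (ZZ × ZZ)} {p : ZZ} : p ∈ verts E ↔ ∃ e ∈ E, p = e.1 ∨ p = e.2 := by
  simp [verts, List.mem_flatMap]

/-- Symmetrised adjacency according to the edge list. [folklore] -/
def EAdj (E : List (ZZ × ZZ)) (p q : ZZ) : Prop := (p, q) ∈ E ∨ (q, p) ∈ E

/-- Decidability instance (kernel computation by `decide`). [folklore] -/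
instance (E : List (ZZ × ZZ)) : DecidableRel (EAdj E) := fun p q => by unfold EAdj; infer_instance

/-- Elementary property of edge-list adjacency. [folklore] -/
theorem EAdj.symm {E : List (ZZ × ZZ)} {p q : ZZ} (h : EAdj E p q) : EAdj E q p := Or.symm h

/-- Elementary property of edge-list adjacency. [folklore] -/
theorem EAdj.fst_mem_verts {E : List (ZZ × ZZ)} {p q : ZZ} (h : EAdj E p q) : p ∈ verts E := by
  rcases h with h | h
  · exact mem_verts_iff.2 ⟨_, h, Or.inl rfl⟩
  · exact mem_verts_iff.2 ⟨_, h, Or.inr rfl⟩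

/-- Elementary property of edge-list adjacency. [folklore] -/
theorem EAdj.snd_mem_verts {E : List (ZZ × ZZ)} {p q : ZZ} (h : EAdj E p q) : q ∈ verts E :=
  h.symm.fst_mem_verts

variable {E : List (ZZ × ZZ)}

/-- The integer points of `Ω_E` are exactly the listed vertices (unit darts). [folklore] -/
theorem pt_mem_Omega_iff (hE : ∀ e ∈ E, IsUnitDart e) (r : ZZ) : pt r ∈ Omega E ↔ r ∈ verts E := by
  simp only [Omega, Set.mem_setOf_eq, mem_verts_iff]
  constructor
  · rintro ⟨e, he, hr⟩
    exact ⟨e, he, (pt_mem_seg_iff (hE e he) r).1 hr⟩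
  · rintro ⟨e, he, hr⟩
    exact ⟨e, he, (pt_mem_seg_iff (hE e he) r).2 hr⟩

/-- Mesh vertices of `Ω_E` at mesh `1` = listed vertices. [folklore] -/
theorem mem_meshVertices_Omega_iff (hE : ∀ e ∈ E, IsUnitDart e) (s : Site 2) :
    s ∈ meshVertices (Omega E) 1 ↔ ofSite s ∈ verts E := by
  rw [Literature.Probability.LatticeModels.mem_meshVertices_iff, meshPoint_one, pt_mem_Omega_iff hE]

/-- A unit-edge midpoint lies in `Ω_E` iff the edge is listed. [folklore] -/
theorem midpt_mem_Omega_iff (hE : ∀ e ∈ E, IsUnitDart e) {e' : ZZ × ZZ} (he' : IsUnitDart e') :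
    midpt e' ∈ Omega E ↔ e' ∈ E := by
  simp only [Omega, Set.mem_setOf_eq]
  constructor
  · rintro ⟨e, he, h⟩
    rwa [(midpt_mem_seg_iff (hE e he) he').1 h]
  · intro h
    exact ⟨e', h, midpt_mem_seg e'⟩

/-- Coordinates of a lattice neighbour. [folklore] -/
theorem ofSite_add_single (s : Site 2) (i : Fin 2) :
    ofSite (s + Pi.single i 1) = if i = 0 then ((ofSite s).1 + 1, (ofSite s).2)
      else ((ofSite s).1, (ofSite s).2 + 1) := by
  fin_cases i <;> simp [ofSite]

/-- A lattice step in a coordinate direction is a unit dart. [folklore] -/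
theorem isUnitDart_of_eq_add_single (s : Site 2) (i : Fin 2) :
    IsUnitDart (ofSite s, ofSite (s + Pi.single i 1)) := by
  rw [ofSite_add_single]
  fin_cases i
  · left; simp
  · right; simp

/-- Adjacency in the mesh graph of `Ω_E` at mesh `1` is adjacency in the edge list. [folklore] -/
theorem meshGraph_adj_iff' (hE : ∀ e ∈ E, IsUnitDart e) (s t : Site 2) :
    (meshGraph (Omega E) 1).Adj s t ↔ EAdj E (ofSite s) (ofSite t) := by
  rw [meshGraph_adj_iff, closure_Omega, zdGraph_adj_iff]
  constructor
  · rintro ⟨⟨i, h | h⟩, hseg⟩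
    · left
      have hu := isUnitDart_of_eq_add_single s i
      rw [← h] at hu
      have hmid : midpt (ofSite s, ofSite t) ∈ Omega E := by
        apply hseg
        rw [meshPoint_one, meshPoint_one]
        exact midpt_mem_seg (ofSite s, ofSite t)
      exact (midpt_mem_Omega_iff hE hu).1 hmid
    · right
      have hu := isUnitDart_of_eq_add_single t i
      rw [← h] at hu
      have hmid : midpt (ofSite t, ofSite s) ∈ Omega E := by
        apply hseg
        rw [meshPoint_one, meshPoint_one, segment_symm]
        exact midpt_mem_seg (ofSite t, ofSite s)
      exact (midpt_mem_Omega_iff hE hu).1 hmid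
  · intro h
    have key : ∀ {s t : Site 2}, (ofSite s, ofSite t) ∈ E →
        (∃ i : Fin 2, t = s + Pi.single i 1 ∨ s = t + Pi.single i 1) ∧
          segment ℝ (meshPoint 1 s) (meshPoint 1 t) ⊆ Omega E := by
      intro s t hst
      have hu := hE _ hst
      refine ⟨?_, ?_⟩
      · rcases hu with hu | hu
        · refine ⟨0, Or.inl ?_⟩
          simp only [Prod.mk.injEq, ofSite] at hu
          funext j; fin_cases j <;> simp [hu]
        · refine ⟨1, Or.inl ?_⟩
          simp only [Prod.mk.injEq, ofSite] at hu
          funext j; fin_cases j <;> simp [hu]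
      · intro z hz
        rw [meshPoint_one, meshPoint_one] at hz
        exact ⟨_, hst, hz⟩
    rcases h with h | h
    · exact key h
    · obtain ⟨⟨i, hi⟩, hseg⟩ := key h
      exact ⟨⟨i, hi.symm⟩, by rwa [segment_symm]⟩

/-! ### Neighbour lists, depth-first enumeration and connectivity -/

/-- The neighbours of `p` in the edge list. [folklore] -/
def nbrs (E : List (ZZ × ZZ)) (p : ZZ) : List ZZ :=
  (E.filter fun e => e.1 = p).map (fun e => e.2) ++ (E.filter fun e => e.2 = p).map fun e => e.1

/-- The neighbour list enumerates edge-list adjacency. [folklore] -/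
theorem mem_nbrs_iff {p q : ZZ} : q ∈ nbrs E p ↔ EAdj E p q := by
  simp only [nbrs, List.mem_append, List.mem_map, List.mem_filter, decide_eq_true_eq, EAdj]
  constructor
  · rintro (⟨⟨a, b⟩, ⟨h, rfl⟩, rfl⟩ | ⟨⟨a, b⟩, ⟨h, rfl⟩, rfl⟩)
    · exact Or.inl h
    · exact Or.inr h
  · rintro (h | h)
    · exact Or.inl ⟨(p, q), ⟨h, rfl⟩, rfl⟩
    · exact Or.inr ⟨(q, p), ⟨h, rfl⟩, rfl⟩

/-- Depth-first enumeration of the self-avoiding extensions (by at most `fuel` steps) of a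
reversed path `path` (head = current vertex); returns reversed vertex lists. [folklore] -/
def dfs (E : List (ZZ × ZZ)) : ℕ → List ZZ → List (List ZZ)
  | 0, path => [path]
  | fuel + 1, path =>
    match path with
    | [] => []
    | cur :: rest =>
      (cur :: rest) :: ((nbrs E cur).filter fun q => !((cur :: rest).contains q)).flatMap
        fun q => dfs E fuel (q :: cur :: rest)

/-- Structural property of the depth-first enumeration `dfs`. [folklore] -/
theorem self_mem_dfs (fuel : ℕ) {path : List ZZ} (h : path ≠ []) : path ∈ dfs E fuel path := by
  cases fuel with
  | zero => simp [dfs]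
  | succ f =>
    cases path with
    | nil => exact absurd rfl h
    | cons cur rest => simp [dfs]

/-- Structural property of the depth-first enumeration `dfs`. [folklore] -/
theorem mem_dfs_succ_of_mem {f : ℕ} {cur q : ZZ} {rest l : List ZZ} (hq : EAdj E cur q)
    (hnot : q ∉ cur :: rest) (hl : l ∈ dfs E f (q :: cur :: rest)) :
    l ∈ dfs E (f + 1) (cur :: rest) := by
  simp only [dfs, List.mem_cons, List.mem_flatMap, List.mem_filter]
  refine Or.inr ⟨q, ⟨mem_nbrs_iff.2 hq, ?_⟩, hl⟩
  simpa using hnot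

/-- The mesh-vertex graph of `Ω_E`. [folklore] -/
theorem meshVertexGraph_adj_iff (hE : ∀ e ∈ E, IsUnitDart e) (u w : meshVertices (Omega E) 1) :
    (meshVertexGraph (Omega E) 1).Adj u w ↔ EAdj E (ofSite u.1) (ofSite w.1) := by
  rw [SimpleGraph.induce_adj, meshGraph_adj_iff' hE]

/-- Reachability from `r` to `q` inside the mesh-vertex graph, for integer points. [folklore] -/
def Reach (E : List (ZZ × ZZ)) (r q : ZZ) : Prop :=
  ∃ (hr : toSite r ∈ meshVertices (Omega E) 1) (hq : toSite q ∈ meshVertices (Omega E) 1),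
    (meshVertexGraph (Omega E) 1).Reachable ⟨toSite r, hr⟩ ⟨toSite q, hq⟩

/-- Every vertex listed by `dfs` from `r` is reachable from `r` in the mesh-vertex graph. [folklore] -/
theorem Reach.step (hE : ∀ e ∈ E, IsUnitDart e) {r p q : ZZ} (h : Reach E r p) (hpq : EAdj E p q) :
    Reach E r q := by
  obtain ⟨hr, hp, hreach⟩ := h
  have hq : toSite q ∈ meshVertices (Omega E) 1 :=
    (mem_meshVertices_Omega_iff hE _).2 (by simpa using hpq.snd_mem_verts)
  refine ⟨hr, hq, hreach.trans (SimpleGraph.Adj.reachable ?_)⟩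
  rw [meshVertexGraph_adj_iff hE]
  simpa using hpq

/-- Every vertex listed by `dfs` from `r` is reachable from `r` in the mesh-vertex graph. [folklore] -/
theorem dfs_reach (hE : ∀ e ∈ E, IsUnitDart e) (r : ZZ) :
    ∀ (fuel : ℕ) (path : List ZZ), (∀ q ∈ path, Reach E r q) →
      ∀ l ∈ dfs E fuel path, ∀ q ∈ l, Reach E r q := by
  intro fuel
  induction fuel with
  | zero =>
    intro path hpath l hl q hq
    simp only [dfs, List.mem_singleton] at hl
    subst hl
    exact hpath q hq
  | succ f ih =>
    intro path hpath l hl q hq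
    cases path with
    | nil => simp [dfs] at hl
    | cons cur rest =>
      simp only [dfs, List.mem_cons, List.mem_flatMap, List.mem_filter] at hl
      rcases hl with rfl | ⟨q', ⟨hq', -⟩, hl⟩
      · exact hpath q hq
      · refine ih (q' :: cur :: rest) ?_ l hl q hq
        intro q'' hq''
        rcases List.mem_cons.1 hq'' with rfl | h
        · exact (hpath cur (by simp)).step hE (mem_nbrs_iff.1 hq')
        · exact hpath q'' h

/-- A kernel-checkable connectivity certificate makes the mesh-vertex graph preconnected.
[folklore] -/
theorem preconnected_of_dfs (hE : ∀ e ∈ E, IsUnitDart e) (r : ZZ) (hr : r ∈ verts E) (fuel : ℕ)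
    (hconn : ∀ p ∈ verts E, ∃ l ∈ dfs E fuel [r], p ∈ l) :
    (meshVertexGraph (Omega E) 1).Preconnected := by
  have hr' : toSite r ∈ meshVertices (Omega E) 1 := (mem_meshVertices_Omega_iff hE _).2 (by simpa using hr)
  have hroot : ∀ q ∈ [r], Reach E r q := by
    intro q hq
    simp only [List.mem_singleton] at hq
    subst hq
    exact ⟨hr', hr', SimpleGraph.Reachable.refl _⟩
  have key : ∀ u : meshVertices (Omega E) 1,
      (meshVertexGraph (Omega E) 1).Reachable ⟨toSite r, hr'⟩ u := by
    rintro ⟨s, hs⟩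
    have hs' := (mem_meshVertices_Omega_iff hE s).1 hs
    obtain ⟨l, hl, hmem⟩ := hconn _ hs'
    obtain ⟨_, hq, hreach⟩ := dfs_reach hE r fuel [r] hroot l hl _ hmem
    have : (⟨toSite (ofSite s), hq⟩ : meshVertices (Omega E) 1) = ⟨s, hs⟩ := by
      apply Subtype.ext; simp
    rw [this] at hreach
    exact hreach
  intro u w
  exact (key u).symm.trans (key w)

/-- For a preconnected mesh-vertex graph the discrete domain is all of the mesh vertices.
[folklore] -/
theorem meshDomain_eq_of_preconnected {Ω : Set ℂ} {δ : ℝ}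
    (h : (meshVertexGraph Ω δ).Preconnected) : meshDomain Ω δ = meshVertices Ω δ := by
  refine Set.Subset.antisymm (meshDomain_subset_meshVertices Ω δ) fun x hx => ?_
  have hsub := h.subsingleton_connectedComponent
  simp only [meshDomain, Set.mem_iUnion, Set.mem_image]
  refine ⟨(meshVertexGraph Ω δ).connectedComponentMk ⟨x, hx⟩, fun C' => ?_, ⟨x, hx⟩, ?_, rfl⟩
  · rw [Subsingleton.elim C' ((meshVertexGraph Ω δ).connectedComponentMk ⟨x, hx⟩)]
  · rw [SimpleGraph.ConnectedComponent.mem_supp_iff]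

/-- **The discrete domain of `Ω_E`**: vertices = `verts E`, edges = `E`, provided the edge list is
made of unit darts and is connected (kernel certificate). [folklore] -/
structure GoodEdgeList (E : List (ZZ × ZZ)) : Prop where
  unit : ∀ e ∈ E, IsUnitDart e
  conn : ∃ r ∈ verts E, ∃ fuel : ℕ, ∀ p ∈ verts E, ∃ l ∈ dfs E fuel [r], p ∈ l

/-- A good edge list spans a preconnected mesh-vertex graph. [folklore] -/
theorem GoodEdgeList.preconnected (hG : GoodEdgeList E) : (meshVertexGraph (Omega E) 1).Preconnected := by
  obtain ⟨r, hr, fuel, hconn⟩ := hG.conn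
  exact preconnected_of_dfs hG.unit r hr fuel hconn

/-- For a good edge list the discrete domain `meshDomain (Ω_E) 1` is exactly the listed vertices. [folklore] -/
theorem GoodEdgeList.mem_meshDomain_iff (hG : GoodEdgeList E) (s : Site 2) :
    s ∈ meshDomain (Omega E) 1 ↔ ofSite s ∈ verts E := by
  rw [meshDomain_eq_of_preconnected hG.preconnected, mem_meshVertices_Omega_iff hG.unit]

/-- For a good edge list the discrete-domain graph `discreteDomainGraph (Ω_E) 1` has exactly the listed edges. [folklore] -/
theorem GoodEdgeList.adj_iff (hG : GoodEdgeList E) (s t : Site 2) :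
    (discreteDomainGraph (Omega E) 1).Adj s t ↔ EAdj E (ofSite s) (ofSite t) := by
  rw [discreteDomainGraph_adj_iff, hG.mem_meshDomain_iff, hG.mem_meshDomain_iff,
    meshGraph_adj_iff' hG.unit]
  constructor
  · exact fun h => h.1
  · exact fun h => ⟨h, h.fst_mem_verts, h.snd_mem_verts⟩

/-- For a good edge list the discrete-domain graph `discreteDomainGraph (Ω_E) 1` has exactly the listed edges. [folklore] -/
theorem GoodEdgeList.adj_toSite_iff (hG : GoodEdgeList E) (p q : ZZ) :
    (discreteDomainGraph (Omega E) 1).Adj (toSite p) (toSite q) ↔ EAdj E p q := by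
  rw [hG.adj_iff, ofSite_toSite, ofSite_toSite]


/-! ### Completeness of the depth-first enumeration for self-avoiding walks -/

/-- Completeness of `dfs` for paths of a graph whose adjacency is contained in the edge list (induction on the walk). [folklore] -/
theorem dfs_complete (G : SimpleGraph (Site 2))
    (hadj : ∀ s t, G.Adj s t → EAdj E (ofSite s) (ofSite t)) :
    ∀ {u z : Site 2} (p : G.Walk u z) (fuel : ℕ) (path : List ZZ),
      p.length ≤ fuel → (p.support.map ofSite).Nodup →
      (∀ q ∈ p.support.tail, ofSite q ∉ path) →
      (p.support.tail.map ofSite).reverse ++ (ofSite u :: path) ∈ dfs E fuel (ofSite u :: path) := by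
  intro u z p
  induction p with
  | nil =>
    intro fuel path _ _ _
    simpa using self_mem_dfs (E := E) fuel (path := ofSite _ :: path) (by simp)
  | @cons u w z h q ih =>
    intro fuel path hlen hnd hpath
    obtain ⟨tl, htl⟩ : ∃ tl, q.support = w :: tl := ⟨q.support.tail, (q.cons_tail_support).symm⟩
    simp only [SimpleGraph.Walk.support_cons, List.tail_cons, List.map_cons, List.nodup_cons,
      List.mem_map, not_exists, not_and] at hnd hpath ⊢
    obtain ⟨hu, hnd⟩ := hnd
    cases fuel with
    | zero => simp at hlen
    | succ f =>
      have hlen' : q.length ≤ f := by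
        simp only [SimpleGraph.Walk.length_cons] at hlen; omega
      have hw : ofSite w ∉ ofSite u :: path := by
        simp only [List.mem_cons, not_or]
        exact ⟨fun h' => (hu w q.start_mem_support h').elim, hpath w q.start_mem_support⟩
      have ih' := ih f (ofSite u :: path) hlen' hnd (by
        intro q' hq'
        have hq'' : q' ∈ q.support := List.mem_of_mem_tail hq'
        simp only [List.mem_cons, not_or]
        exact ⟨fun h' => (hu q' hq'' h').elim, hpath q' hq''⟩)
      have hmem := mem_dfs_succ_of_mem (hadj u w h) hw ih'
      rw [htl] at hmem ⊢
      simpa [List.map_cons, List.reverse_cons, List.append_assoc] using hmem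

/-- Supports of walks stay inside the listed vertices. [folklore] -/
theorem support_subset_verts (G : SimpleGraph (Site 2))
    (hadj : ∀ s t, G.Adj s t → EAdj E (ofSite s) (ofSite t)) :
    ∀ {u z : Site 2} (p : G.Walk u z), ofSite u ∈ verts E → ∀ s ∈ p.support, ofSite s ∈ verts E := by
  intro u z p
  induction p with
  | nil => intro hu s hs; simp only [SimpleGraph.Walk.support_nil, List.mem_singleton] at hs; subst hs; exact hu
  | @cons u w z h q ih =>
    intro hu s hs
    simp only [SimpleGraph.Walk.support_cons, List.mem_cons] at hs
    rcases hs with rfl | hs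
    · exact hu
    · exact ih (hadj u w h).snd_mem_verts s hs

/-- **Completeness.** The (reversed, integer-coordinate) support of every self-avoiding walk of
`Ω_E` from `a` appears in the depth-first enumeration `dfs E fuel [a]` once `fuel ≥ #verts`.
[folklore] -/
theorem GoodEdgeList.support_mem_dfs (hG : GoodEdgeList E) {a z : Site 2}
    (γ : Literature.Probability.RandomPlanarGeometry.SAW.DomainSAW (Omega E) 1 a z) (ha : ofSite a ∈ verts E) {fuel : ℕ}
    (hfuel : (verts E).length ≤ fuel) :
    (γ.walk.support.map ofSite).reverse ∈ dfs E fuel [ofSite a] := by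
  have hadj : ∀ s t, (discreteDomainGraph (Omega E) 1).Adj s t → EAdj E (ofSite s) (ofSite t) :=
    fun s t h => (hG.adj_iff s t).1 h
  have hnd : (γ.walk.support.map ofSite).Nodup :=
    (SimpleGraph.Walk.isPath_def _ |>.1 γ.isPath).map ofSite_injective
  have hsub : γ.walk.support.map ofSite ⊆ verts E := by
    intro q hq
    obtain ⟨s, hs, rfl⟩ := List.mem_map.1 hq
    exact support_subset_verts _ hadj γ.walk ha s hs
  have hlen : γ.walk.length ≤ fuel := by
    have h1 := (List.subperm_of_subset hnd hsub).length_le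
    rw [List.length_map, SimpleGraph.Walk.length_support] at h1
    omega
  have key := dfs_complete (E := E) _ hadj γ.walk fuel [] hlen hnd (by simp)
  have hsupp : γ.walk.support = a :: γ.walk.support.tail := (γ.walk.cons_tail_support).symm
  rw [show (γ.walk.support.map ofSite).reverse = (γ.walk.support.tail.map ofSite).reverse ++ [ofSite a]
    from by conv_lhs => rw [hsupp]; simp only [List.map_cons, List.reverse_cons]]
  exact key

/-- Two self-avoiding walks with the same underlying walk are equal. [folklore] -/
theorem DomainSAW_eq {Ω : Set ℂ} {δ : ℝ} {a z : Site 2} {γ γ' : Literature.Probability.RandomPlanarGeometry.SAW.DomainSAW Ω δ a z}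
    (h : γ.walk = γ'.walk) : γ = γ' := by
  cases γ; cases γ'; cases h; rfl

/-- A self-avoiding walk is determined by its underlying walk / its support. [folklore] -/
theorem DomainSAW_eq_of_support {Ω : Set ℂ} {δ : ℝ} {a z : Site 2}
    {γ γ' : Literature.Probability.RandomPlanarGeometry.SAW.DomainSAW Ω δ a z} (h : γ.walk.support = γ'.walk.support) : γ = γ' :=
  DomainSAW_eq (SimpleGraph.Walk.support_injective h)

/-- List bookkeeping for supports of walks in integer coordinates. [folklore] -/
theorem support_eq_of_reverse_map {a z : Site 2} {G : SimpleGraph (Site 2)} (p : G.Walk a z)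
    {l : List ZZ} (h : (p.support.map ofSite).reverse = l) : p.support = l.reverse.map toSite := by
  have h' : p.support.map ofSite = l.reverse := by rw [← h, List.reverse_reverse]
  have := congrArg (List.map toSite) h'
  simpa [List.map_map, Function.comp_def] using this

/-- List bookkeeping for supports of walks in integer coordinates. [folklore] -/
theorem head?_reverse_map_support {a z : Site 2} {G : SimpleGraph (Site 2)} (p : G.Walk a z) :
    ((p.support.map ofSite).reverse).head? = some (ofSite z) := by
  rw [List.head?_reverse, List.getLast?_eq_getLast_of_ne_nil (by simp), List.getLast_map,
    SimpleGraph.Walk.getLast_support]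

/-! ### Windings of lattice polylines -/

/-- Continuing to the midpoint of `[z, w]` turns by the same angle as continuing to `w`. [folklore] -/
theorem turning_midpoint (y z w : ℂ) : turning y z ((z + w) / 2) = turning y z w := by
  unfold turning
  rw [show ((z + w) / 2 - z) / (z - y) = ((1 / 2 : ℝ) : ℂ) * ((w - z) / (z - y)) by push_cast; ring]
  exact Complex.arg_real_mul _ (by norm_num)

/-- Peeling the last turning angle off a winding. [folklore] -/
theorem winding_append_three (L : List ℂ) (y z m : ℂ) :
    winding (L ++ [y, z, m]) = winding (L ++ [y, z]) + turning y z m := by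
  induction L with
  | nil => simp
  | cons a L ih =>
    cases L with
    | nil => simp
    | cons b L' =>
      cases L' with
      | nil => simp; ring
      | cons c L'' =>
        simp only [List.cons_append] at ih
        simp only [List.cons_append, winding_cons_cons_cons]
        rw [ih]; ring

/-- Replacing the final point `w` of a polyline by the midpoint of its last segment does not change
the winding. [folklore] -/
theorem winding_append_midpoint (L : List ℂ) (z w : ℂ) :
    winding (L ++ [z] ++ [(z + w) / 2]) = winding (L ++ [z] ++ [w]) := by
  induction L using List.reverseRecOn with
  | nil => simp
  | append_singleton L y _ =>
    simp only [List.append_assoc, List.cons_append, List.nil_append]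
    rw [winding_append_three, winding_append_three, turning_midpoint]

/-- Direction vector of a step. [folklore] -/
def dirOf (p q : ZZ) : ZZ := (q.1 - p.1, q.2 - p.2)

/-- The four unit steps. [folklore] -/
def IsUnitStep (d : ZZ) : Prop := d = (1, 0) ∨ d = (0, 1) ∨ d = (-1, 0) ∨ d = (0, -1)

/-- Decidability instance (kernel computation by `decide`). [folklore] -/
instance : DecidablePred IsUnitStep := fun d => by unfold IsUnitStep; infer_instance

/-- Signed quarter turn between two unit steps (cross product): `+1` left, `-1` right, `0`
straight (or back). [folklore] -/
def turnZ (d₁ d₂ : ZZ) : ℤ := d₁.1 * d₂.2 - d₁.2 * d₂.1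

/-- Dot product of two steps (`-1` detects a reversal). [folklore] -/
def dotZ (d₁ d₂ : ZZ) : ℤ := d₁.1 * d₂.1 + d₁.2 * d₂.2

/-- Total signed quarter turns of an integer polyline. [folklore] -/
def quarterTurns : List ZZ → ℤ
  | p :: q :: r :: l => turnZ (dirOf p q) (dirOf q r) + quarterTurns (q :: r :: l)
  | _ => 0

/-- Unit steps without reversals (kernel-checkable). [folklore] -/
def goodSteps : List ZZ → Bool
  | p :: q :: r :: l =>
    decide (IsUnitStep (dirOf p q)) && decide (dotZ (dirOf p q) (dirOf q r) ≠ -1) && goodSteps (q :: r :: l)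
  | [p, q] => decide (IsUnitStep (dirOf p q))
  | _ => true

/-- Unfolding of the Boolean step check `goodSteps`. [folklore] -/
theorem goodSteps_cons_cons_cons {p q r : ZZ} {l : List ZZ} (h : goodSteps (p :: q :: r :: l) = true) :
    IsUnitStep (dirOf p q) ∧ dotZ (dirOf p q) (dirOf q r) ≠ -1 ∧ goodSteps (q :: r :: l) = true := by
  have h' : (IsUnitStep (dirOf p q) ∧ ¬dotZ (dirOf p q) (dirOf q r) = -1) ∧ goodSteps (q :: r :: l) = true := by
    simpa [goodSteps] using h
  exact ⟨h'.1.1, h'.1.2, h'.2⟩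

/-- Unfolding of the Boolean step check `goodSteps`. [folklore] -/
theorem goodSteps_isUnitStep : ∀ {l : List ZZ} {p q : ZZ}, goodSteps (p :: q :: l) = true → IsUnitStep (dirOf p q)
  | [], _, _, h => by simpa [goodSteps] using h
  | _ :: _, _, _, h => (goodSteps_cons_cons_cons h).1

/-- complex vector of an integer step [folklore] -/
def vec (d : ZZ) : ℂ := ⟨d.1, d.2⟩

/-- Complex vector of a lattice step. [folklore] -/
theorem pt_sub_pt (p q : ZZ) : pt q - pt p = vec (dirOf p q) := by
  apply Complex.ext <;> simp [pt, vec, dirOf]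

/-- Complex vector of a lattice step. [folklore] -/
theorem vec_e0 : vec (1, 0) = 1 := by apply Complex.ext <;> simp [vec]
/-- Complex vector of a lattice step. [folklore] -/
theorem vec_e1 : vec (0, 1) = I := by apply Complex.ext <;> simp [vec]
/-- Complex vector of a lattice step. [folklore] -/
theorem vec_ne0 : vec (-1, 0) = -1 := by apply Complex.ext <;> simp [vec]
/-- Complex vector of a lattice step. [folklore] -/
theorem vec_ne1 : vec (0, -1) = -I := by apply Complex.ext <;> simp [vec]

/-- The turning angle between unit lattice steps is the cross product times `π/2`. [folklore] -/
theorem turning_pt (p q r : ZZ) (h₁ : IsUnitStep (dirOf p q)) (h₂ : IsUnitStep (dirOf q r))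
    (h : dotZ (dirOf p q) (dirOf q r) ≠ -1) :
    turning (pt p) (pt q) (pt r) = (turnZ (dirOf p q) (dirOf q r) : ℝ) * (Real.pi / 2) := by
  unfold turning
  rw [pt_sub_pt, pt_sub_pt]
  generalize dirOf p q = d₁ at *
  generalize dirOf q r = d₂ at *
  rcases h₁ with rfl | rfl | rfl | rfl <;> rcases h₂ with rfl | rfl | rfl | rfl <;>
    simp [dotZ, turnZ, vec_e0, vec_e1, vec_ne0, vec_ne1, Complex.arg_I, Complex.arg_neg_I,
      Complex.I_ne_zero, div_neg, neg_div] at h ⊢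

/-- **Reflection for windings.** [folklore] -/
theorem winding_map_pt : ∀ (l : List ZZ), goodSteps l = true →
    winding (l.map pt) = (quarterTurns l : ℝ) * (Real.pi / 2)
  | [], _ => by simp [quarterTurns]
  | [_], _ => by simp [quarterTurns]
  | [_, _], _ => by simp [quarterTurns]
  | p :: q :: r :: l, h => by
    obtain ⟨h₁, hdot, hrest⟩ := goodSteps_cons_cons_cons h
    simp only [List.map_cons, winding_cons_cons_cons, quarterTurns, Int.cast_add]
    have ih := winding_map_pt (q :: r :: l) hrest
    simp only [List.map_cons] at ih
    rw [ih, turning_pt p q r h₁ (goodSteps_isUnitStep hrest) hdot]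
    ring

/-- List bookkeeping for supports of walks in integer coordinates. [folklore] -/
theorem support_map_eq_dropLast {α : Type*} {a z : Site 2} {G : SimpleGraph (Site 2)} (p : G.Walk a z)
    (f : Site 2 → α) : p.support.map f = (p.support.map f).dropLast ++ [f z] := by
  have hne : p.support.map f ≠ [] := by simp
  have hlast : (p.support.map f).getLast hne = f z := by
    simp [List.getLast_map, SimpleGraph.Walk.getLast_support]
  conv_lhs => rw [← List.dropLast_append_getLast hne, hlast]

/-- The winding of the mesh polyline of a walk continued to the middle of the edge `{z, w}`,
computed on integer coordinates. [folklore] -/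
theorem winding_support_medial {a z : Site 2} {G : SimpleGraph (Site 2)} (p : G.Walk a z) (w : Site 2)
    (hgood : goodSteps (p.support.map ofSite ++ [ofSite w]) = true) :
    winding (p.support.map (meshPoint 1) ++ [medialPoint 1 s(z, w)]) =
      (quarterTurns (p.support.map ofSite ++ [ofSite w]) : ℝ) * (Real.pi / 2) := by
  have h1 : p.support.map (meshPoint 1) = (p.support.map ofSite).map pt := by
    rw [List.map_map]
    congr 1
    funext s
    exact meshPoint_one s
  rw [← winding_map_pt _ hgood, h1, medialPoint_mk, meshPoint_one, meshPoint_one, List.map_append,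
    List.map_cons, List.map_nil]
  rw [support_map_eq_dropLast p ofSite, List.map_append, List.map_cons, List.map_nil]
  exact winding_append_midpoint _ _ _

/-! ### Evaluating half-edge terms -/

open Literature.Probability.RandomPlanarGeometry.SAW in
/-- A half-edge term with a single contributing walk `γ₀` (every other SAW to `z` has used the edge `{z, w}`) equals the summand of `γ₀`. [folklore] -/
theorem halfEdgeTerm_eq_single {Ω : Set ℂ} {δ : ℝ} {a z : Site 2} (x σ : ℝ) (w : Site 2)
    (γ₀ : DomainSAW Ω δ a z) (h : ∀ γ : DomainSAW Ω δ a z, γ ≠ γ₀ → s(z, w) ∈ γ.walk.edges) :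
    halfEdgeTerm Ω δ a x σ z w =
      if s(z, w) ∈ γ₀.walk.edges then 0 else
        Complex.exp (-Complex.I * σ *
            (Literature.Probability.LatticeModels.winding (γ₀.walk.support.map (meshPoint δ) ++ [medialPoint δ s(z, w)]) : ℝ)) *
          (x : ℂ) ^ (γ₀.length + 1) := by
  unfold halfEdgeTerm
  exact tsum_eq_single γ₀ fun γ hγ => if_pos (h γ hγ)

open Literature.Probability.RandomPlanarGeometry.SAW in
/-- A half-edge term vanishes when every SAW to `z` has used the edge `{z, w}`. [folklore] -/
theorem halfEdgeTerm_eq_zero {Ω : Set ℂ} {δ : ℝ} {a z : Site 2} (x σ : ℝ) (w : Site 2)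
    (h : ∀ γ : DomainSAW Ω δ a z, s(z, w) ∈ γ.walk.edges) : halfEdgeTerm Ω δ a x σ z w = 0 := by
  unfold halfEdgeTerm
  rw [tsum_congr (g := fun _ => (0 : ℂ)) fun γ => if_pos (h γ), tsum_zero]


/-! ### The twist `t = e^{-iσπ/2}` and the instantiation of the relation -/

/-- The phase picked up by a quarter turn to the right: `t = exp(-iσπ/2)`. [folklore] -/
def tOf (σ : ℝ) : ℂ := Complex.exp (-Complex.I * σ * ((Real.pi / 2 : ℝ) : ℂ))

/-- `|t| = 1`. [folklore] -/
theorem norm_tOf (σ : ℝ) : ‖tOf σ‖ = 1 := by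
  rw [tOf, show -Complex.I * σ * ((Real.pi / 2 : ℝ) : ℂ) = ((-(σ * (Real.pi / 2)) : ℝ) : ℂ) * Complex.I by
    push_cast; ring]
  exact Complex.norm_exp_ofReal_mul_I _

/-- The phase of an integer number of quarter turns is a power of `t = e^{-iσπ/2}`. [folklore] -/
theorem cexp_quarter_nat (σ : ℝ) (k : ℕ) :
    Complex.exp (-Complex.I * σ * (((k : ℤ) : ℝ) * (Real.pi / 2) : ℝ)) = tOf σ ^ k := by
  rw [tOf, ← Complex.exp_nat_mul]; congr 1; push_cast; ring

/-- The phase of an integer number of quarter turns is a power of `t = e^{-iσπ/2}`. [folklore] -/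
theorem cexp_quarter_neg_nat (σ : ℝ) (k : ℕ) :
    Complex.exp (-Complex.I * σ * (((-(k : ℤ) : ℤ) : ℝ) * (Real.pi / 2) : ℝ)) = (tOf σ)⁻¹ ^ k := by
  rw [tOf, ← Complex.exp_neg, ← Complex.exp_nat_mul]; congr 1; push_cast; ring

/-- The phase of an integer number of quarter turns is a power of `t = e^{-iσπ/2}`. [folklore] -/
theorem cexp_quarter_0 (σ : ℝ) :
    Complex.exp (-Complex.I * σ * (((0 : ℤ) : ℝ) * (Real.pi / 2) : ℝ)) = 1 := by simp
/-- The phase of an integer number of quarter turns is a power of `t = e^{-iσπ/2}`. [folklore] -/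
theorem cexp_quarter_1 (σ : ℝ) :
    Complex.exp (-Complex.I * σ * (((1 : ℤ) : ℝ) * (Real.pi / 2) : ℝ)) = tOf σ := by
  simpa using cexp_quarter_nat σ 1
/-- The phase of an integer number of quarter turns is a power of `t = e^{-iσπ/2}`. [folklore] -/
theorem cexp_quarter_2 (σ : ℝ) :
    Complex.exp (-Complex.I * σ * (((2 : ℤ) : ℝ) * (Real.pi / 2) : ℝ)) = tOf σ ^ 2 := by
  exact_mod_cast cexp_quarter_nat σ 2
/-- The phase of an integer number of quarter turns is a power of `t = e^{-iσπ/2}`. [folklore] -/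
theorem cexp_quarter_3 (σ : ℝ) :
    Complex.exp (-Complex.I * σ * (((3 : ℤ) : ℝ) * (Real.pi / 2) : ℝ)) = tOf σ ^ 3 := by
  exact_mod_cast cexp_quarter_nat σ 3
/-- The phase of an integer number of quarter turns is a power of `t = e^{-iσπ/2}`. [folklore] -/
theorem cexp_quarter_m1 (σ : ℝ) :
    Complex.exp (-Complex.I * σ * (((-1 : ℤ) : ℝ) * (Real.pi / 2) : ℝ)) = (tOf σ)⁻¹ := by
  simpa using cexp_quarter_neg_nat σ 1
/-- The phase of an integer number of quarter turns is a power of `t = e^{-iσπ/2}`. [folklore] -/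
theorem cexp_quarter_m2 (σ : ℝ) :
    Complex.exp (-Complex.I * σ * (((-2 : ℤ) : ℝ) * (Real.pi / 2) : ℝ)) = (tOf σ)⁻¹ ^ 2 := by
  exact_mod_cast cexp_quarter_neg_nat σ 2
/-- The phase of an integer number of quarter turns is a power of `t = e^{-iσπ/2}`. [folklore] -/
theorem cexp_quarter_m3 (σ : ℝ) :
    Complex.exp (-Complex.I * σ * (((-3 : ℤ) : ℝ) * (Real.pi / 2) : ℝ)) = (tOf σ)⁻¹ ^ 3 := by
  exact_mod_cast cexp_quarter_neg_nat σ 3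

/-- Adjacency from the edge list, discharged by `decide`. [folklore] -/
abbrev GoodEdgeList.A (hG : GoodEdgeList E) (p q : ZZ) (h : EAdj E p q := by decide) :
    (discreteDomainGraph (Omega E) 1).Adj (toSite p) (toSite q) :=
  (hG.adj_toSite_iff p q).2 h

/-- Explicit nearest-neighbour adjacency in `ℤ²`. [folklore] -/
theorem zdAdj_toSite_right (p : ZZ) : (zdGraph 2).Adj (toSite p) (toSite (p.1 + 1, p.2)) :=
  (zdGraph_adj_iff _ _).2 ⟨0, Or.inl (by funext j; fin_cases j <;> simp [toSite])⟩
/-- Explicit nearest-neighbour adjacency in `ℤ²`. [folklore] -/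
theorem zdAdj_toSite_up (p : ZZ) : (zdGraph 2).Adj (toSite p) (toSite (p.1, p.2 + 1)) :=
  (zdGraph_adj_iff _ _).2 ⟨1, Or.inl (by funext j; fin_cases j <;> simp [toSite])⟩
/-- Explicit nearest-neighbour adjacency in `ℤ²`. [folklore] -/
theorem zdAdj_toSite_left (p : ZZ) : (zdGraph 2).Adj (toSite p) (toSite (p.1 - 1, p.2)) :=
  (zdGraph_adj_iff _ _).2 ⟨0, Or.inr (by funext j; fin_cases j <;> simp [toSite])⟩
/-- Explicit nearest-neighbour adjacency in `ℤ²`. [folklore] -/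
theorem zdAdj_toSite_down (p : ZZ) : (zdGraph 2).Adj (toSite p) (toSite (p.1, p.2 - 1)) :=
  (zdGraph_adj_iff _ _).2 ⟨1, Or.inr (by funext j; fin_cases j <;> simp [toSite])⟩

/-- The four neighbours of the origin, in coordinates. [folklore] -/
theorem toSite_zero_add_dirZ2_0 : toSite (0, 0) + dirZ2 0 = toSite (1, 0) := by
  funext j; fin_cases j <;> simp [toSite, dirZ2]
/-- The four neighbours of the origin, in coordinates. [folklore] -/
theorem toSite_zero_add_dirZ2_1 : toSite (0, 0) + dirZ2 1 = toSite (0, 1) := by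
  funext j; fin_cases j <;> simp [toSite, dirZ2]
/-- The four neighbours of the origin, in coordinates. [folklore] -/
theorem toSite_zero_add_dirZ2_2 : toSite (0, 0) + dirZ2 2 = toSite (-1, 0) := by
  funext j; fin_cases j <;> simp [toSite, dirZ2]
/-- The four neighbours of the origin, in coordinates. [folklore] -/
theorem toSite_zero_add_dirZ2_3 : toSite (0, 0) + dirZ2 3 = toSite (0, -1) := by
  funext j; fin_cases j <;> simp [toSite, dirZ2]

/-- The four-term stencil sum at the origin, written out. [folklore] -/
theorem sum_four_dirZ2 (c : Fin 4 → ℂ) (F : Sym2 (Site 2) → ℂ) :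
    ∑ i : Fin 4, c i * F s(toSite (0, 0), toSite (0, 0) + dirZ2 i) =
      c 0 * F s(toSite (0, 0), toSite (1, 0)) + c 1 * F s(toSite (0, 0), toSite (0, 1)) +
        c 2 * F s(toSite (0, 0), toSite (-1, 0)) + c 3 * F s(toSite (0, 0), toSite (0, -1)) := by
  rw [Fin.sum_univ_four, toSite_zero_add_dirZ2_0, toSite_zero_add_dirZ2_1, toSite_zero_add_dirZ2_2,
    toSite_zero_add_dirZ2_3]

/-- The origin has its four neighbours in the discrete domain of a good edge list containing the four darts. [folklore] -/
theorem adj_four (hG : GoodEdgeList E) (h0 : EAdj E (0, 0) (1, 0)) (h1 : EAdj E (0, 0) (0, 1))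
    (h2 : EAdj E (0, 0) (-1, 0)) (h3 : EAdj E (0, 0) (0, -1)) :
    ∀ i : Fin 4, (discreteDomainGraph (Omega E) 1).Adj (toSite (0, 0)) (toSite (0, 0) + dirZ2 i) := by
  intro i
  fin_cases i
  · simp only [Fin.zero_eta, Fin.isValue, toSite_zero_add_dirZ2_0]; exact hG.A _ _ h0
  · simp only [Fin.mk_one, Fin.isValue, toSite_zero_add_dirZ2_1]; exact hG.A _ _ h1
  · simp only [Fin.reduceFinMk, toSite_zero_add_dirZ2_2]; exact hG.A _ _ h2
  · simp only [Fin.reduceFinMk, toSite_zero_add_dirZ2_3]; exact hG.A _ _ h3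

/-! ### The three explicit domains -/

/-- Edge list of the explicit domain `P`. [folklore] -/
def PE : List (ZZ × ZZ) :=
  [((0,0),(1,0)), ((0,0),(0,1)), ((-1,0),(0,0)), ((0,-1),(0,0))]

/-- Kernel certificate: the edge list consists of unit darts and is connected. [folklore] -/
theorem goodP : GoodEdgeList PE := ⟨by decide, ⟨(1, 0), by decide, 8, by decide⟩⟩

/-- Edge list of the explicit domain `T`. [folklore] -/
def TE : List (ZZ × ZZ) :=
  [((0,0),(1,0)), ((0,0),(0,1)), ((0,1),(0,2)), ((-1,0),(0,0)), ((0,-1),(0,0)), ((-1,2),(0,2)), ((-2,2),(-1,2)), ((-2,1),(-2,2)), ((-2,0),(-1,0)), ((-2,0),(-2,1))]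

/-- Kernel certificate: the edge list consists of unit darts and is connected. [folklore] -/
theorem goodT : GoodEdgeList TE := ⟨by decide, ⟨(1, 0), by decide, 20, by decide⟩⟩

/-- Edge list of the explicit domain `O`. [folklore] -/
def OE : List (ZZ × ZZ) :=
  [((0,0),(1,0)), ((0,0),(0,1)), ((0,1),(0,2)), ((-1,0),(0,0)), ((0,-1),(0,0)), ((-1,2),(0,2)), ((-2,2),(-1,2)), ((-3,2),(-2,2)), ((-3,1),(-3,2)), ((-3,0),(-3,1)), ((-3,-1),(-3,0)), ((-3,-2),(-2,-2)), ((-3,-2),(-3,-1)), ((-2,-2),(-1,-2)), ((-1,-2),(0,-2)), ((0,-2),(0,-1))]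

/-- Kernel certificate: the edge list consists of unit darts and is connected. [folklore] -/
theorem goodO : GoodEdgeList OE := ⟨by decide, ⟨(1, 0), by decide, 32, by decide⟩⟩

/-! #### Instance `P`, root `(1, 0)` -/

/-- explicit self-avoiding walk `(1,0) → (0,0)` [folklore] -/
def w_P_1_0_0_0 : Literature.Probability.RandomPlanarGeometry.SAW.DomainSAW (Omega PE) 1 (toSite (1, 0)) (toSite (0, 0)) :=
  ⟨SimpleGraph.Walk.cons (goodP.A (1, 0) (0, 0)) <|
  SimpleGraph.Walk.nil, (SimpleGraph.Walk.isPath_def _).2 (by decide)⟩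

/-- Enumeration certificate: the self-avoiding walks of `Ω_E` between these endpoints are exactly the listed ones (completeness of `dfs` + `decide`). [folklore] -/
theorem enum_P_1_0_0 : ∀ γ : Literature.Probability.RandomPlanarGeometry.SAW.DomainSAW (Omega PE) 1 (toSite (1, 0)) (toSite (0, 0)),
    γ = w_P_1_0_0_0 := by
  intro γ
  have hmem := goodP.support_mem_dfs γ (by decide) (fuel := 8) (by decide)
  have hhead := head?_reverse_map_support γ.walk
  have hall : ∀ l ∈ dfs PE 8 [ofSite (toSite (1, 0))], l.head? = some (ofSite (toSite (0, 0))) →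
      l = [(0, 0), (1, 0)] := by decide
  have h := hall _ hmem hhead
  apply DomainSAW_eq_of_support; rw [support_eq_of_reverse_map γ.walk h]; decide

/-- the trivial walk at the root [folklore] -/
def nil_P_1_0 : Literature.Probability.RandomPlanarGeometry.SAW.DomainSAW (Omega PE) 1 (toSite (1, 0)) (toSite (1, 0)) := Literature.Probability.RandomPlanarGeometry.SAW.DomainSAW.nil _

/-- Enumeration certificate: the self-avoiding walks of `Ω_E` between these endpoints are exactly the listed ones (completeness of `dfs` + `decide`). [folklore] -/
theorem enum_P_1_0_1 : ∀ γ : Literature.Probability.RandomPlanarGeometry.SAW.DomainSAW (Omega PE) 1 (toSite (1, 0)) (toSite (1, 0)), γ = nil_P_1_0 :=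
  Literature.Probability.RandomPlanarGeometry.SAW.DomainSAW.eq_nil_of_self

/-- explicit self-avoiding walk `(1,0) → (0,0) → (0,1)` [folklore] -/
def w_P_1_0_2_0 : Literature.Probability.RandomPlanarGeometry.SAW.DomainSAW (Omega PE) 1 (toSite (1, 0)) (toSite (0, 1)) :=
  ⟨SimpleGraph.Walk.cons (goodP.A (1, 0) (0, 0)) <|
  SimpleGraph.Walk.cons (goodP.A (0, 0) (0, 1)) <|
  SimpleGraph.Walk.nil, (SimpleGraph.Walk.isPath_def _).2 (by decide)⟩

/-- Enumeration certificate: the self-avoiding walks of `Ω_E` between these endpoints are exactly the listed ones (completeness of `dfs` + `decide`). [folklore] -/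
theorem enum_P_1_0_2 : ∀ γ : Literature.Probability.RandomPlanarGeometry.SAW.DomainSAW (Omega PE) 1 (toSite (1, 0)) (toSite (0, 1)),
    γ = w_P_1_0_2_0 := by
  intro γ
  have hmem := goodP.support_mem_dfs γ (by decide) (fuel := 8) (by decide)
  have hhead := head?_reverse_map_support γ.walk
  have hall : ∀ l ∈ dfs PE 8 [ofSite (toSite (1, 0))], l.head? = some (ofSite (toSite (0, 1))) →
      l = [(0, 1), (0, 0), (1, 0)] := by decide
  have h := hall _ hmem hhead
  apply DomainSAW_eq_of_support; rw [support_eq_of_reverse_map γ.walk h]; decide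

/-- explicit self-avoiding walk `(1,0) → (0,0) → (-1,0)` [folklore] -/
def w_P_1_0_3_0 : Literature.Probability.RandomPlanarGeometry.SAW.DomainSAW (Omega PE) 1 (toSite (1, 0)) (toSite (-1, 0)) :=
  ⟨SimpleGraph.Walk.cons (goodP.A (1, 0) (0, 0)) <|
  SimpleGraph.Walk.cons (goodP.A (0, 0) (-1, 0)) <|
  SimpleGraph.Walk.nil, (SimpleGraph.Walk.isPath_def _).2 (by decide)⟩

/-- Enumeration certificate: the self-avoiding walks of `Ω_E` between these endpoints are exactly the listed ones (completeness of `dfs` + `decide`). [folklore] -/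
theorem enum_P_1_0_3 : ∀ γ : Literature.Probability.RandomPlanarGeometry.SAW.DomainSAW (Omega PE) 1 (toSite (1, 0)) (toSite (-1, 0)),
    γ = w_P_1_0_3_0 := by
  intro γ
  have hmem := goodP.support_mem_dfs γ (by decide) (fuel := 8) (by decide)
  have hhead := head?_reverse_map_support γ.walk
  have hall : ∀ l ∈ dfs PE 8 [ofSite (toSite (1, 0))], l.head? = some (ofSite (toSite (-1, 0))) →
      l = [(-1, 0), (0, 0), (1, 0)] := by decide
  have h := hall _ hmem hhead
  apply DomainSAW_eq_of_support; rw [support_eq_of_reverse_map γ.walk h]; decide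

/-- explicit self-avoiding walk `(1,0) → (0,0) → (0,-1)` [folklore] -/
def w_P_1_0_4_0 : Literature.Probability.RandomPlanarGeometry.SAW.DomainSAW (Omega PE) 1 (toSite (1, 0)) (toSite (0, -1)) :=
  ⟨SimpleGraph.Walk.cons (goodP.A (1, 0) (0, 0)) <|
  SimpleGraph.Walk.cons (goodP.A (0, 0) (0, -1)) <|
  SimpleGraph.Walk.nil, (SimpleGraph.Walk.isPath_def _).2 (by decide)⟩

/-- Enumeration certificate: the self-avoiding walks of `Ω_E` between these endpoints are exactly the listed ones (completeness of `dfs` + `decide`). [folklore] -/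
theorem enum_P_1_0_4 : ∀ γ : Literature.Probability.RandomPlanarGeometry.SAW.DomainSAW (Omega PE) 1 (toSite (1, 0)) (toSite (0, -1)),
    γ = w_P_1_0_4_0 := by
  intro γ
  have hmem := goodP.support_mem_dfs γ (by decide) (fuel := 8) (by decide)
  have hhead := head?_reverse_map_support γ.walk
  have hall : ∀ l ∈ dfs PE 8 [ofSite (toSite (1, 0))], l.head? = some (ofSite (toSite (0, -1))) →
      l = [(0, -1), (0, 0), (1, 0)] := by decide
  have h := hall _ hmem hhead
  apply DomainSAW_eq_of_support; rw [support_eq_of_reverse_map γ.walk h]; decide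

/-- Value of one half-edge term of the mid-edge observable on the explicit domain (from the enumeration certificate and the integer winding count). [folklore] -/
theorem hET_P_1_0_E_out (x σ : ℝ) :
    Literature.Probability.RandomPlanarGeometry.SAW.halfEdgeTerm (Omega PE) 1 (toSite (1, 0)) x σ (toSite (0, 0)) (toSite (1, 0)) = 0 := by
  refine halfEdgeTerm_eq_zero x σ (toSite (1, 0)) fun γ => ?_
  rw [enum_P_1_0_0 γ]; decide

/-- Value of one half-edge term of the mid-edge observable on the explicit domain (from the enumeration certificate and the integer winding count). [folklore] -/
theorem hET_P_1_0_E_in (x σ : ℝ) :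
    Literature.Probability.RandomPlanarGeometry.SAW.halfEdgeTerm (Omega PE) 1 (toSite (1, 0)) x σ (toSite (1, 0)) (toSite (0, 0)) =
      (x : ℂ) := by
  rw [halfEdgeTerm_eq_single x σ (toSite (0, 0)) nil_P_1_0 (fun γ hγ => absurd (enum_P_1_0_1 γ) hγ)]
  rw [if_neg (by decide), winding_support_medial nil_P_1_0.walk (toSite (0, 0)) (by decide),
    show quarterTurns (List.map ofSite nil_P_1_0.walk.support ++ [ofSite (toSite (0, 0))]) = 0 from by decide,
    show Literature.Probability.RandomPlanarGeometry.SAW.DomainSAW.length nil_P_1_0 = 0 from by decide, cexp_quarter_0 σ]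
  ring

/-- Value of one half-edge term of the mid-edge observable on the explicit domain (from the enumeration certificate and the integer winding count). [folklore] -/
theorem hET_P_1_0_N_out (x σ : ℝ) :
    Literature.Probability.RandomPlanarGeometry.SAW.halfEdgeTerm (Omega PE) 1 (toSite (1, 0)) x σ (toSite (0, 0)) (toSite (0, 1)) =
      (x : ℂ) ^ 2 * (tOf σ)⁻¹ := by
  rw [halfEdgeTerm_eq_single x σ (toSite (0, 1)) w_P_1_0_0_0 (fun γ hγ => absurd (enum_P_1_0_0 γ) hγ)]
  rw [if_neg (by decide), winding_support_medial w_P_1_0_0_0.walk (toSite (0, 1)) (by decide),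
    show quarterTurns (List.map ofSite w_P_1_0_0_0.walk.support ++ [ofSite (toSite (0, 1))]) = -1 from by decide,
    show Literature.Probability.RandomPlanarGeometry.SAW.DomainSAW.length w_P_1_0_0_0 = 1 from by decide, cexp_quarter_m1 σ]
  ring

/-- Value of one half-edge term of the mid-edge observable on the explicit domain (from the enumeration certificate and the integer winding count). [folklore] -/
theorem hET_P_1_0_N_in (x σ : ℝ) :
    Literature.Probability.RandomPlanarGeometry.SAW.halfEdgeTerm (Omega PE) 1 (toSite (1, 0)) x σ (toSite (0, 1)) (toSite (0, 0)) = 0 := by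
  refine halfEdgeTerm_eq_zero x σ (toSite (0, 0)) fun γ => ?_
  rw [enum_P_1_0_2 γ]; decide

/-- Value of one half-edge term of the mid-edge observable on the explicit domain (from the enumeration certificate and the integer winding count). [folklore] -/
theorem hET_P_1_0_W_out (x σ : ℝ) :
    Literature.Probability.RandomPlanarGeometry.SAW.halfEdgeTerm (Omega PE) 1 (toSite (1, 0)) x σ (toSite (0, 0)) (toSite (-1, 0)) =
      (x : ℂ) ^ 2 := by
  rw [halfEdgeTerm_eq_single x σ (toSite (-1, 0)) w_P_1_0_0_0 (fun γ hγ => absurd (enum_P_1_0_0 γ) hγ)]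
  rw [if_neg (by decide), winding_support_medial w_P_1_0_0_0.walk (toSite (-1, 0)) (by decide),
    show quarterTurns (List.map ofSite w_P_1_0_0_0.walk.support ++ [ofSite (toSite (-1, 0))]) = 0 from by decide,
    show Literature.Probability.RandomPlanarGeometry.SAW.DomainSAW.length w_P_1_0_0_0 = 1 from by decide, cexp_quarter_0 σ]
  ring

/-- Value of one half-edge term of the mid-edge observable on the explicit domain (from the enumeration certificate and the integer winding count). [folklore] -/
theorem hET_P_1_0_W_in (x σ : ℝ) :
    Literature.Probability.RandomPlanarGeometry.SAW.halfEdgeTerm (Omega PE) 1 (toSite (1, 0)) x σ (toSite (-1, 0)) (toSite (0, 0)) = 0 := by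
  refine halfEdgeTerm_eq_zero x σ (toSite (0, 0)) fun γ => ?_
  rw [enum_P_1_0_3 γ]; decide

/-- Value of one half-edge term of the mid-edge observable on the explicit domain (from the enumeration certificate and the integer winding count). [folklore] -/
theorem hET_P_1_0_S_out (x σ : ℝ) :
    Literature.Probability.RandomPlanarGeometry.SAW.halfEdgeTerm (Omega PE) 1 (toSite (1, 0)) x σ (toSite (0, 0)) (toSite (0, -1)) =
      (x : ℂ) ^ 2 * tOf σ := by
  rw [halfEdgeTerm_eq_single x σ (toSite (0, -1)) w_P_1_0_0_0 (fun γ hγ => absurd (enum_P_1_0_0 γ) hγ)]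
  rw [if_neg (by decide), winding_support_medial w_P_1_0_0_0.walk (toSite (0, -1)) (by decide),
    show quarterTurns (List.map ofSite w_P_1_0_0_0.walk.support ++ [ofSite (toSite (0, -1))]) = 1 from by decide,
    show Literature.Probability.RandomPlanarGeometry.SAW.DomainSAW.length w_P_1_0_0_0 = 1 from by decide, cexp_quarter_1 σ]
  ring

/-- Value of one half-edge term of the mid-edge observable on the explicit domain (from the enumeration certificate and the integer winding count). [folklore] -/
theorem hET_P_1_0_S_in (x σ : ℝ) :
    Literature.Probability.RandomPlanarGeometry.SAW.halfEdgeTerm (Omega PE) 1 (toSite (1, 0)) x σ (toSite (0, -1)) (toSite (0, 0)) = 0 := by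
  refine halfEdgeTerm_eq_zero x σ (toSite (0, 0)) fun γ => ?_
  rw [enum_P_1_0_4 γ]; decide

/-- Value of the mid-edge observable at one of the four edges at the origin, on the explicit domain. [folklore] -/
theorem F_P_1_0_E (x σ : ℝ) :
    Literature.Probability.RandomPlanarGeometry.SAW.midEdgeParafermionicObservable (Omega PE) 1 (toSite (1, 0)) x σ s(toSite (0, 0), toSite (1, 0)) =
      (x : ℂ) := by
  simp only [Literature.Probability.RandomPlanarGeometry.SAW.midEdgeParafermionicObservable_mk, hET_P_1_0_E_out, hET_P_1_0_E_in, zero_add]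

/-- Value of the mid-edge observable at one of the four edges at the origin, on the explicit domain. [folklore] -/
theorem F_P_1_0_N (x σ : ℝ) :
    Literature.Probability.RandomPlanarGeometry.SAW.midEdgeParafermionicObservable (Omega PE) 1 (toSite (1, 0)) x σ s(toSite (0, 0), toSite (0, 1)) =
      (x : ℂ) ^ 2 * (tOf σ)⁻¹ := by
  simp only [Literature.Probability.RandomPlanarGeometry.SAW.midEdgeParafermionicObservable_mk, hET_P_1_0_N_out, hET_P_1_0_N_in, add_zero]

/-- Value of the mid-edge observable at one of the four edges at the origin, on the explicit domain. [folklore] -/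
theorem F_P_1_0_W (x σ : ℝ) :
    Literature.Probability.RandomPlanarGeometry.SAW.midEdgeParafermionicObservable (Omega PE) 1 (toSite (1, 0)) x σ s(toSite (0, 0), toSite (-1, 0)) =
      (x : ℂ) ^ 2 := by
  simp only [Literature.Probability.RandomPlanarGeometry.SAW.midEdgeParafermionicObservable_mk, hET_P_1_0_W_out, hET_P_1_0_W_in, add_zero]

/-- Value of the mid-edge observable at one of the four edges at the origin, on the explicit domain. [folklore] -/
theorem F_P_1_0_S (x σ : ℝ) :
    Literature.Probability.RandomPlanarGeometry.SAW.midEdgeParafermionicObservable (Omega PE) 1 (toSite (1, 0)) x σ s(toSite (0, 0), toSite (0, -1)) =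
      (x : ℂ) ^ 2 * tOf σ := by
  simp only [Literature.Probability.RandomPlanarGeometry.SAW.midEdgeParafermionicObservable_mk, hET_P_1_0_S_out, hET_P_1_0_S_in, add_zero]

/-- The exact relation instantiated on domain `P` with root `(1, 0)`. [folklore] -/
theorem inst_P_1_0 {x σ : ℝ} {c : Fin 4 → ℂ} (hrel : ExactVertexRelationZ2 x σ c) :
    c 0 * ((x : ℂ)) + c 1 * ((x : ℂ) ^ 2 * (tOf σ)⁻¹) + c 2 * ((x : ℂ) ^ 2) + c 3 * ((x : ℂ) ^ 2 * tOf σ) = 0 := by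
  have h := hrel (Omega PE) 1 (toSite (1, 0)) (toSite (0, 0)) one_pos
    ((goodP.mem_meshDomain_iff _).2 (by decide))
    ⟨toSite (2, 0), zdAdj_toSite_right (1, 0), by
      rw [meshPoint_one_toSite, pt_mem_Omega_iff goodP.unit]; decide⟩
    (adj_four goodP (by decide) (by decide) (by decide) (by decide))
  rw [sum_four_dirZ2] at h
  rw [F_P_1_0_E, F_P_1_0_N, F_P_1_0_W, F_P_1_0_S] at h
  linear_combination h

/-! #### Instance `P`, root `(0, 1)` -/

/-- explicit self-avoiding walk `(0,1) → (0,0)` [folklore] -/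
def w_P_0_1_0_0 : Literature.Probability.RandomPlanarGeometry.SAW.DomainSAW (Omega PE) 1 (toSite (0, 1)) (toSite (0, 0)) :=
  ⟨SimpleGraph.Walk.cons (goodP.A (0, 1) (0, 0)) <|
  SimpleGraph.Walk.nil, (SimpleGraph.Walk.isPath_def _).2 (by decide)⟩

/-- Enumeration certificate: the self-avoiding walks of `Ω_E` between these endpoints are exactly the listed ones (completeness of `dfs` + `decide`). [folklore] -/
theorem enum_P_0_1_0 : ∀ γ : Literature.Probability.RandomPlanarGeometry.SAW.DomainSAW (Omega PE) 1 (toSite (0, 1)) (toSite (0, 0)),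
    γ = w_P_0_1_0_0 := by
  intro γ
  have hmem := goodP.support_mem_dfs γ (by decide) (fuel := 8) (by decide)
  have hhead := head?_reverse_map_support γ.walk
  have hall : ∀ l ∈ dfs PE 8 [ofSite (toSite (0, 1))], l.head? = some (ofSite (toSite (0, 0))) →
      l = [(0, 0), (0, 1)] := by decide
  have h := hall _ hmem hhead
  apply DomainSAW_eq_of_support; rw [support_eq_of_reverse_map γ.walk h]; decide

/-- explicit self-avoiding walk `(0,1) → (0,0) → (1,0)` [folklore] -/
def w_P_0_1_1_0 : Literature.Probability.RandomPlanarGeometry.SAW.DomainSAW (Omega PE) 1 (toSite (0, 1)) (toSite (1, 0)) :=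
  ⟨SimpleGraph.Walk.cons (goodP.A (0, 1) (0, 0)) <|
  SimpleGraph.Walk.cons (goodP.A (0, 0) (1, 0)) <|
  SimpleGraph.Walk.nil, (SimpleGraph.Walk.isPath_def _).2 (by decide)⟩

/-- Enumeration certificate: the self-avoiding walks of `Ω_E` between these endpoints are exactly the listed ones (completeness of `dfs` + `decide`). [folklore] -/
theorem enum_P_0_1_1 : ∀ γ : Literature.Probability.RandomPlanarGeometry.SAW.DomainSAW (Omega PE) 1 (toSite (0, 1)) (toSite (1, 0)),
    γ = w_P_0_1_1_0 := by
  intro γ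
  have hmem := goodP.support_mem_dfs γ (by decide) (fuel := 8) (by decide)
  have hhead := head?_reverse_map_support γ.walk
  have hall : ∀ l ∈ dfs PE 8 [ofSite (toSite (0, 1))], l.head? = some (ofSite (toSite (1, 0))) →
      l = [(1, 0), (0, 0), (0, 1)] := by decide
  have h := hall _ hmem hhead
  apply DomainSAW_eq_of_support; rw [support_eq_of_reverse_map γ.walk h]; decide

/-- the trivial walk at the root [folklore] -/
def nil_P_0_1 : Literature.Probability.RandomPlanarGeometry.SAW.DomainSAW (Omega PE) 1 (toSite (0, 1)) (toSite (0, 1)) := Literature.Probability.RandomPlanarGeometry.SAW.DomainSAW.nil _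

/-- Enumeration certificate: the self-avoiding walks of `Ω_E` between these endpoints are exactly the listed ones (completeness of `dfs` + `decide`). [folklore] -/
theorem enum_P_0_1_2 : ∀ γ : Literature.Probability.RandomPlanarGeometry.SAW.DomainSAW (Omega PE) 1 (toSite (0, 1)) (toSite (0, 1)), γ = nil_P_0_1 :=
  Literature.Probability.RandomPlanarGeometry.SAW.DomainSAW.eq_nil_of_self

/-- explicit self-avoiding walk `(0,1) → (0,0) → (-1,0)` [folklore] -/
def w_P_0_1_3_0 : Literature.Probability.RandomPlanarGeometry.SAW.DomainSAW (Omega PE) 1 (toSite (0, 1)) (toSite (-1, 0)) :=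
  ⟨SimpleGraph.Walk.cons (goodP.A (0, 1) (0, 0)) <|
  SimpleGraph.Walk.cons (goodP.A (0, 0) (-1, 0)) <|
  SimpleGraph.Walk.nil, (SimpleGraph.Walk.isPath_def _).2 (by decide)⟩

/-- Enumeration certificate: the self-avoiding walks of `Ω_E` between these endpoints are exactly the listed ones (completeness of `dfs` + `decide`). [folklore] -/
theorem enum_P_0_1_3 : ∀ γ : Literature.Probability.RandomPlanarGeometry.SAW.DomainSAW (Omega PE) 1 (toSite (0, 1)) (toSite (-1, 0)),
    γ = w_P_0_1_3_0 := by
  intro γ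
  have hmem := goodP.support_mem_dfs γ (by decide) (fuel := 8) (by decide)
  have hhead := head?_reverse_map_support γ.walk
  have hall : ∀ l ∈ dfs PE 8 [ofSite (toSite (0, 1))], l.head? = some (ofSite (toSite (-1, 0))) →
      l = [(-1, 0), (0, 0), (0, 1)] := by decide
  have h := hall _ hmem hhead
  apply DomainSAW_eq_of_support; rw [support_eq_of_reverse_map γ.walk h]; decide

/-- explicit self-avoiding walk `(0,1) → (0,0) → (0,-1)` [folklore] -/
def w_P_0_1_4_0 : Literature.Probability.RandomPlanarGeometry.SAW.DomainSAW (Omega PE) 1 (toSite (0, 1)) (toSite (0, -1)) :=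
  ⟨SimpleGraph.Walk.cons (goodP.A (0, 1) (0, 0)) <|
  SimpleGraph.Walk.cons (goodP.A (0, 0) (0, -1)) <|
  SimpleGraph.Walk.nil, (SimpleGraph.Walk.isPath_def _).2 (by decide)⟩

/-- Enumeration certificate: the self-avoiding walks of `Ω_E` between these endpoints are exactly the listed ones (completeness of `dfs` + `decide`). [folklore] -/
theorem enum_P_0_1_4 : ∀ γ : Literature.Probability.RandomPlanarGeometry.SAW.DomainSAW (Omega PE) 1 (toSite (0, 1)) (toSite (0, -1)),
    γ = w_P_0_1_4_0 := by
  intro γ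
  have hmem := goodP.support_mem_dfs γ (by decide) (fuel := 8) (by decide)
  have hhead := head?_reverse_map_support γ.walk
  have hall : ∀ l ∈ dfs PE 8 [ofSite (toSite (0, 1))], l.head? = some (ofSite (toSite (0, -1))) →
      l = [(0, -1), (0, 0), (0, 1)] := by decide
  have h := hall _ hmem hhead
  apply DomainSAW_eq_of_support; rw [support_eq_of_reverse_map γ.walk h]; decide

/-- Value of one half-edge term of the mid-edge observable on the explicit domain (from the enumeration certificate and the integer winding count). [folklore] -/
theorem hET_P_0_1_E_out (x σ : ℝ) :
    Literature.Probability.RandomPlanarGeometry.SAW.halfEdgeTerm (Omega PE) 1 (toSite (0, 1)) x σ (toSite (0, 0)) (toSite (1, 0)) =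
      (x : ℂ) ^ 2 * tOf σ := by
  rw [halfEdgeTerm_eq_single x σ (toSite (1, 0)) w_P_0_1_0_0 (fun γ hγ => absurd (enum_P_0_1_0 γ) hγ)]
  rw [if_neg (by decide), winding_support_medial w_P_0_1_0_0.walk (toSite (1, 0)) (by decide),
    show quarterTurns (List.map ofSite w_P_0_1_0_0.walk.support ++ [ofSite (toSite (1, 0))]) = 1 from by decide,
    show Literature.Probability.RandomPlanarGeometry.SAW.DomainSAW.length w_P_0_1_0_0 = 1 from by decide, cexp_quarter_1 σ]
  ring

/-- Value of one half-edge term of the mid-edge observable on the explicit domain (from the enumeration certificate and the integer winding count). [folklore] -/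
theorem hET_P_0_1_E_in (x σ : ℝ) :
    Literature.Probability.RandomPlanarGeometry.SAW.halfEdgeTerm (Omega PE) 1 (toSite (0, 1)) x σ (toSite (1, 0)) (toSite (0, 0)) = 0 := by
  refine halfEdgeTerm_eq_zero x σ (toSite (0, 0)) fun γ => ?_
  rw [enum_P_0_1_1 γ]; decide

/-- Value of one half-edge term of the mid-edge observable on the explicit domain (from the enumeration certificate and the integer winding count). [folklore] -/
theorem hET_P_0_1_N_out (x σ : ℝ) :
    Literature.Probability.RandomPlanarGeometry.SAW.halfEdgeTerm (Omega PE) 1 (toSite (0, 1)) x σ (toSite (0, 0)) (toSite (0, 1)) = 0 := by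
  refine halfEdgeTerm_eq_zero x σ (toSite (0, 1)) fun γ => ?_
  rw [enum_P_0_1_0 γ]; decide

/-- Value of one half-edge term of the mid-edge observable on the explicit domain (from the enumeration certificate and the integer winding count). [folklore] -/
theorem hET_P_0_1_N_in (x σ : ℝ) :
    Literature.Probability.RandomPlanarGeometry.SAW.halfEdgeTerm (Omega PE) 1 (toSite (0, 1)) x σ (toSite (0, 1)) (toSite (0, 0)) =
      (x : ℂ) := by
  rw [halfEdgeTerm_eq_single x σ (toSite (0, 0)) nil_P_0_1 (fun γ hγ => absurd (enum_P_0_1_2 γ) hγ)]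
  rw [if_neg (by decide), winding_support_medial nil_P_0_1.walk (toSite (0, 0)) (by decide),
    show quarterTurns (List.map ofSite nil_P_0_1.walk.support ++ [ofSite (toSite (0, 0))]) = 0 from by decide,
    show Literature.Probability.RandomPlanarGeometry.SAW.DomainSAW.length nil_P_0_1 = 0 from by decide, cexp_quarter_0 σ]
  ring

/-- Value of one half-edge term of the mid-edge observable on the explicit domain (from the enumeration certificate and the integer winding count). [folklore] -/
theorem hET_P_0_1_W_out (x σ : ℝ) :
    Literature.Probability.RandomPlanarGeometry.SAW.halfEdgeTerm (Omega PE) 1 (toSite (0, 1)) x σ (toSite (0, 0)) (toSite (-1, 0)) =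
      (x : ℂ) ^ 2 * (tOf σ)⁻¹ := by
  rw [halfEdgeTerm_eq_single x σ (toSite (-1, 0)) w_P_0_1_0_0 (fun γ hγ => absurd (enum_P_0_1_0 γ) hγ)]
  rw [if_neg (by decide), winding_support_medial w_P_0_1_0_0.walk (toSite (-1, 0)) (by decide),
    show quarterTurns (List.map ofSite w_P_0_1_0_0.walk.support ++ [ofSite (toSite (-1, 0))]) = -1 from by decide,
    show Literature.Probability.RandomPlanarGeometry.SAW.DomainSAW.length w_P_0_1_0_0 = 1 from by decide, cexp_quarter_m1 σ]
  ring

/-- Value of one half-edge term of the mid-edge observable on the explicit domain (from the enumeration certificate and the integer winding count). [folklore] -/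
theorem hET_P_0_1_W_in (x σ : ℝ) :
    Literature.Probability.RandomPlanarGeometry.SAW.halfEdgeTerm (Omega PE) 1 (toSite (0, 1)) x σ (toSite (-1, 0)) (toSite (0, 0)) = 0 := by
  refine halfEdgeTerm_eq_zero x σ (toSite (0, 0)) fun γ => ?_
  rw [enum_P_0_1_3 γ]; decide

/-- Value of one half-edge term of the mid-edge observable on the explicit domain (from the enumeration certificate and the integer winding count). [folklore] -/
theorem hET_P_0_1_S_out (x σ : ℝ) :
    Literature.Probability.RandomPlanarGeometry.SAW.halfEdgeTerm (Omega PE) 1 (toSite (0, 1)) x σ (toSite (0, 0)) (toSite (0, -1)) =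
      (x : ℂ) ^ 2 := by
  rw [halfEdgeTerm_eq_single x σ (toSite (0, -1)) w_P_0_1_0_0 (fun γ hγ => absurd (enum_P_0_1_0 γ) hγ)]
  rw [if_neg (by decide), winding_support_medial w_P_0_1_0_0.walk (toSite (0, -1)) (by decide),
    show quarterTurns (List.map ofSite w_P_0_1_0_0.walk.support ++ [ofSite (toSite (0, -1))]) = 0 from by decide,
    show Literature.Probability.RandomPlanarGeometry.SAW.DomainSAW.length w_P_0_1_0_0 = 1 from by decide, cexp_quarter_0 σ]
  ring

/-- Value of one half-edge term of the mid-edge observable on the explicit domain (from the enumeration certificate and the integer winding count). [folklore] -/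
theorem hET_P_0_1_S_in (x σ : ℝ) :
    Literature.Probability.RandomPlanarGeometry.SAW.halfEdgeTerm (Omega PE) 1 (toSite (0, 1)) x σ (toSite (0, -1)) (toSite (0, 0)) = 0 := by
  refine halfEdgeTerm_eq_zero x σ (toSite (0, 0)) fun γ => ?_
  rw [enum_P_0_1_4 γ]; decide

/-- Value of the mid-edge observable at one of the four edges at the origin, on the explicit domain. [folklore] -/
theorem F_P_0_1_E (x σ : ℝ) :
    Literature.Probability.RandomPlanarGeometry.SAW.midEdgeParafermionicObservable (Omega PE) 1 (toSite (0, 1)) x σ s(toSite (0, 0), toSite (1, 0)) =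
      (x : ℂ) ^ 2 * tOf σ := by
  simp only [Literature.Probability.RandomPlanarGeometry.SAW.midEdgeParafermionicObservable_mk, hET_P_0_1_E_out, hET_P_0_1_E_in, add_zero]

/-- Value of the mid-edge observable at one of the four edges at the origin, on the explicit domain. [folklore] -/
theorem F_P_0_1_N (x σ : ℝ) :
    Literature.Probability.RandomPlanarGeometry.SAW.midEdgeParafermionicObservable (Omega PE) 1 (toSite (0, 1)) x σ s(toSite (0, 0), toSite (0, 1)) =
      (x : ℂ) := by
  simp only [Literature.Probability.RandomPlanarGeometry.SAW.midEdgeParafermionicObservable_mk, hET_P_0_1_N_out, hET_P_0_1_N_in, zero_add]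

/-- Value of the mid-edge observable at one of the four edges at the origin, on the explicit domain. [folklore] -/
theorem F_P_0_1_W (x σ : ℝ) :
    Literature.Probability.RandomPlanarGeometry.SAW.midEdgeParafermionicObservable (Omega PE) 1 (toSite (0, 1)) x σ s(toSite (0, 0), toSite (-1, 0)) =
      (x : ℂ) ^ 2 * (tOf σ)⁻¹ := by
  simp only [Literature.Probability.RandomPlanarGeometry.SAW.midEdgeParafermionicObservable_mk, hET_P_0_1_W_out, hET_P_0_1_W_in, add_zero]

/-- Value of the mid-edge observable at one of the four edges at the origin, on the explicit domain. [folklore] -/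
theorem F_P_0_1_S (x σ : ℝ) :
    Literature.Probability.RandomPlanarGeometry.SAW.midEdgeParafermionicObservable (Omega PE) 1 (toSite (0, 1)) x σ s(toSite (0, 0), toSite (0, -1)) =
      (x : ℂ) ^ 2 := by
  simp only [Literature.Probability.RandomPlanarGeometry.SAW.midEdgeParafermionicObservable_mk, hET_P_0_1_S_out, hET_P_0_1_S_in, add_zero]

/-- The exact relation instantiated on domain `P` with root `(0, 1)`. [folklore] -/
theorem inst_P_0_1 {x σ : ℝ} {c : Fin 4 → ℂ} (hrel : ExactVertexRelationZ2 x σ c) :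
    c 0 * ((x : ℂ) ^ 2 * tOf σ) + c 1 * ((x : ℂ)) + c 2 * ((x : ℂ) ^ 2 * (tOf σ)⁻¹) + c 3 * ((x : ℂ) ^ 2) = 0 := by
  have h := hrel (Omega PE) 1 (toSite (0, 1)) (toSite (0, 0)) one_pos
    ((goodP.mem_meshDomain_iff _).2 (by decide))
    ⟨toSite (0, 2), zdAdj_toSite_up (0, 1), by
      rw [meshPoint_one_toSite, pt_mem_Omega_iff goodP.unit]; decide⟩
    (adj_four goodP (by decide) (by decide) (by decide) (by decide))
  rw [sum_four_dirZ2] at h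
  rw [F_P_0_1_E, F_P_0_1_N, F_P_0_1_W, F_P_0_1_S] at h
  linear_combination h

/-! #### Instance `P`, root `(-1, 0)` -/

/-- explicit self-avoiding walk `(-1,0) → (0,0)` [folklore] -/
def w_P_m1_0_0_0 : Literature.Probability.RandomPlanarGeometry.SAW.DomainSAW (Omega PE) 1 (toSite (-1, 0)) (toSite (0, 0)) :=
  ⟨SimpleGraph.Walk.cons (goodP.A (-1, 0) (0, 0)) <|
  SimpleGraph.Walk.nil, (SimpleGraph.Walk.isPath_def _).2 (by decide)⟩

/-- Enumeration certificate: the self-avoiding walks of `Ω_E` between these endpoints are exactly the listed ones (completeness of `dfs` + `decide`). [folklore] -/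
theorem enum_P_m1_0_0 : ∀ γ : Literature.Probability.RandomPlanarGeometry.SAW.DomainSAW (Omega PE) 1 (toSite (-1, 0)) (toSite (0, 0)),
    γ = w_P_m1_0_0_0 := by
  intro γ
  have hmem := goodP.support_mem_dfs γ (by decide) (fuel := 8) (by decide)
  have hhead := head?_reverse_map_support γ.walk
  have hall : ∀ l ∈ dfs PE 8 [ofSite (toSite (-1, 0))], l.head? = some (ofSite (toSite (0, 0))) →
      l = [(0, 0), (-1, 0)] := by decide
  have h := hall _ hmem hhead
  apply DomainSAW_eq_of_support; rw [support_eq_of_reverse_map γ.walk h]; decide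

/-- explicit self-avoiding walk `(-1,0) → (0,0) → (1,0)` [folklore] -/
def w_P_m1_0_1_0 : Literature.Probability.RandomPlanarGeometry.SAW.DomainSAW (Omega PE) 1 (toSite (-1, 0)) (toSite (1, 0)) :=
  ⟨SimpleGraph.Walk.cons (goodP.A (-1, 0) (0, 0)) <|
  SimpleGraph.Walk.cons (goodP.A (0, 0) (1, 0)) <|
  SimpleGraph.Walk.nil, (SimpleGraph.Walk.isPath_def _).2 (by decide)⟩

/-- Enumeration certificate: the self-avoiding walks of `Ω_E` between these endpoints are exactly the listed ones (completeness of `dfs` + `decide`). [folklore] -/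
theorem enum_P_m1_0_1 : ∀ γ : Literature.Probability.RandomPlanarGeometry.SAW.DomainSAW (Omega PE) 1 (toSite (-1, 0)) (toSite (1, 0)),
    γ = w_P_m1_0_1_0 := by
  intro γ
  have hmem := goodP.support_mem_dfs γ (by decide) (fuel := 8) (by decide)
  have hhead := head?_reverse_map_support γ.walk
  have hall : ∀ l ∈ dfs PE 8 [ofSite (toSite (-1, 0))], l.head? = some (ofSite (toSite (1, 0))) →
      l = [(1, 0), (0, 0), (-1, 0)] := by decide
  have h := hall _ hmem hhead
  apply DomainSAW_eq_of_support; rw [support_eq_of_reverse_map γ.walk h]; decide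

/-- explicit self-avoiding walk `(-1,0) → (0,0) → (0,1)` [folklore] -/
def w_P_m1_0_2_0 : Literature.Probability.RandomPlanarGeometry.SAW.DomainSAW (Omega PE) 1 (toSite (-1, 0)) (toSite (0, 1)) :=
  ⟨SimpleGraph.Walk.cons (goodP.A (-1, 0) (0, 0)) <|
  SimpleGraph.Walk.cons (goodP.A (0, 0) (0, 1)) <|
  SimpleGraph.Walk.nil, (SimpleGraph.Walk.isPath_def _).2 (by decide)⟩

/-- Enumeration certificate: the self-avoiding walks of `Ω_E` between these endpoints are exactly the listed ones (completeness of `dfs` + `decide`). [folklore] -/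
theorem enum_P_m1_0_2 : ∀ γ : Literature.Probability.RandomPlanarGeometry.SAW.DomainSAW (Omega PE) 1 (toSite (-1, 0)) (toSite (0, 1)),
    γ = w_P_m1_0_2_0 := by
  intro γ
  have hmem := goodP.support_mem_dfs γ (by decide) (fuel := 8) (by decide)
  have hhead := head?_reverse_map_support γ.walk
  have hall : ∀ l ∈ dfs PE 8 [ofSite (toSite (-1, 0))], l.head? = some (ofSite (toSite (0, 1))) →
      l = [(0, 1), (0, 0), (-1, 0)] := by decide
  have h := hall _ hmem hhead
  apply DomainSAW_eq_of_support; rw [support_eq_of_reverse_map γ.walk h]; decide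

/-- the trivial walk at the root [folklore] -/
def nil_P_m1_0 : Literature.Probability.RandomPlanarGeometry.SAW.DomainSAW (Omega PE) 1 (toSite (-1, 0)) (toSite (-1, 0)) := Literature.Probability.RandomPlanarGeometry.SAW.DomainSAW.nil _

/-- Enumeration certificate: the self-avoiding walks of `Ω_E` between these endpoints are exactly the listed ones (completeness of `dfs` + `decide`). [folklore] -/
theorem enum_P_m1_0_3 : ∀ γ : Literature.Probability.RandomPlanarGeometry.SAW.DomainSAW (Omega PE) 1 (toSite (-1, 0)) (toSite (-1, 0)), γ = nil_P_m1_0 :=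
  Literature.Probability.RandomPlanarGeometry.SAW.DomainSAW.eq_nil_of_self

/-- explicit self-avoiding walk `(-1,0) → (0,0) → (0,-1)` [folklore] -/
def w_P_m1_0_4_0 : Literature.Probability.RandomPlanarGeometry.SAW.DomainSAW (Omega PE) 1 (toSite (-1, 0)) (toSite (0, -1)) :=
  ⟨SimpleGraph.Walk.cons (goodP.A (-1, 0) (0, 0)) <|
  SimpleGraph.Walk.cons (goodP.A (0, 0) (0, -1)) <|
  SimpleGraph.Walk.nil, (SimpleGraph.Walk.isPath_def _).2 (by decide)⟩

/-- Enumeration certificate: the self-avoiding walks of `Ω_E` between these endpoints are exactly the listed ones (completeness of `dfs` + `decide`). [folklore] -/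
theorem enum_P_m1_0_4 : ∀ γ : Literature.Probability.RandomPlanarGeometry.SAW.DomainSAW (Omega PE) 1 (toSite (-1, 0)) (toSite (0, -1)),
    γ = w_P_m1_0_4_0 := by
  intro γ
  have hmem := goodP.support_mem_dfs γ (by decide) (fuel := 8) (by decide)
  have hhead := head?_reverse_map_support γ.walk
  have hall : ∀ l ∈ dfs PE 8 [ofSite (toSite (-1, 0))], l.head? = some (ofSite (toSite (0, -1))) →
      l = [(0, -1), (0, 0), (-1, 0)] := by decide
  have h := hall _ hmem hhead
  apply DomainSAW_eq_of_support; rw [support_eq_of_reverse_map γ.walk h]; decide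

/-- Value of one half-edge term of the mid-edge observable on the explicit domain (from the enumeration certificate and the integer winding count). [folklore] -/
theorem hET_P_m1_0_E_out (x σ : ℝ) :
    Literature.Probability.RandomPlanarGeometry.SAW.halfEdgeTerm (Omega PE) 1 (toSite (-1, 0)) x σ (toSite (0, 0)) (toSite (1, 0)) =
      (x : ℂ) ^ 2 := by
  rw [halfEdgeTerm_eq_single x σ (toSite (1, 0)) w_P_m1_0_0_0 (fun γ hγ => absurd (enum_P_m1_0_0 γ) hγ)]
  rw [if_neg (by decide), winding_support_medial w_P_m1_0_0_0.walk (toSite (1, 0)) (by decide),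
    show quarterTurns (List.map ofSite w_P_m1_0_0_0.walk.support ++ [ofSite (toSite (1, 0))]) = 0 from by decide,
    show Literature.Probability.RandomPlanarGeometry.SAW.DomainSAW.length w_P_m1_0_0_0 = 1 from by decide, cexp_quarter_0 σ]
  ring

/-- Value of one half-edge term of the mid-edge observable on the explicit domain (from the enumeration certificate and the integer winding count). [folklore] -/
theorem hET_P_m1_0_E_in (x σ : ℝ) :
    Literature.Probability.RandomPlanarGeometry.SAW.halfEdgeTerm (Omega PE) 1 (toSite (-1, 0)) x σ (toSite (1, 0)) (toSite (0, 0)) = 0 := by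
  refine halfEdgeTerm_eq_zero x σ (toSite (0, 0)) fun γ => ?_
  rw [enum_P_m1_0_1 γ]; decide

/-- Value of one half-edge term of the mid-edge observable on the explicit domain (from the enumeration certificate and the integer winding count). [folklore] -/
theorem hET_P_m1_0_N_out (x σ : ℝ) :
    Literature.Probability.RandomPlanarGeometry.SAW.halfEdgeTerm (Omega PE) 1 (toSite (-1, 0)) x σ (toSite (0, 0)) (toSite (0, 1)) =
      (x : ℂ) ^ 2 * tOf σ := by
  rw [halfEdgeTerm_eq_single x σ (toSite (0, 1)) w_P_m1_0_0_0 (fun γ hγ => absurd (enum_P_m1_0_0 γ) hγ)]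
  rw [if_neg (by decide), winding_support_medial w_P_m1_0_0_0.walk (toSite (0, 1)) (by decide),
    show quarterTurns (List.map ofSite w_P_m1_0_0_0.walk.support ++ [ofSite (toSite (0, 1))]) = 1 from by decide,
    show Literature.Probability.RandomPlanarGeometry.SAW.DomainSAW.length w_P_m1_0_0_0 = 1 from by decide, cexp_quarter_1 σ]
  ring

/-- Value of one half-edge term of the mid-edge observable on the explicit domain (from the enumeration certificate and the integer winding count). [folklore] -/
theorem hET_P_m1_0_N_in (x σ : ℝ) :
    Literature.Probability.RandomPlanarGeometry.SAW.halfEdgeTerm (Omega PE) 1 (toSite (-1, 0)) x σ (toSite (0, 1)) (toSite (0, 0)) = 0 := by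
  refine halfEdgeTerm_eq_zero x σ (toSite (0, 0)) fun γ => ?_
  rw [enum_P_m1_0_2 γ]; decide

/-- Value of one half-edge term of the mid-edge observable on the explicit domain (from the enumeration certificate and the integer winding count). [folklore] -/
theorem hET_P_m1_0_W_out (x σ : ℝ) :
    Literature.Probability.RandomPlanarGeometry.SAW.halfEdgeTerm (Omega PE) 1 (toSite (-1, 0)) x σ (toSite (0, 0)) (toSite (-1, 0)) = 0 := by
  refine halfEdgeTerm_eq_zero x σ (toSite (-1, 0)) fun γ => ?_
  rw [enum_P_m1_0_0 γ]; decide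

/-- Value of one half-edge term of the mid-edge observable on the explicit domain (from the enumeration certificate and the integer winding count). [folklore] -/
theorem hET_P_m1_0_W_in (x σ : ℝ) :
    Literature.Probability.RandomPlanarGeometry.SAW.halfEdgeTerm (Omega PE) 1 (toSite (-1, 0)) x σ (toSite (-1, 0)) (toSite (0, 0)) =
      (x : ℂ) := by
  rw [halfEdgeTerm_eq_single x σ (toSite (0, 0)) nil_P_m1_0 (fun γ hγ => absurd (enum_P_m1_0_3 γ) hγ)]
  rw [if_neg (by decide), winding_support_medial nil_P_m1_0.walk (toSite (0, 0)) (by decide),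
    show quarterTurns (List.map ofSite nil_P_m1_0.walk.support ++ [ofSite (toSite (0, 0))]) = 0 from by decide,
    show Literature.Probability.RandomPlanarGeometry.SAW.DomainSAW.length nil_P_m1_0 = 0 from by decide, cexp_quarter_0 σ]
  ring

/-- Value of one half-edge term of the mid-edge observable on the explicit domain (from the enumeration certificate and the integer winding count). [folklore] -/
theorem hET_P_m1_0_S_out (x σ : ℝ) :
    Literature.Probability.RandomPlanarGeometry.SAW.halfEdgeTerm (Omega PE) 1 (toSite (-1, 0)) x σ (toSite (0, 0)) (toSite (0, -1)) =
      (x : ℂ) ^ 2 * (tOf σ)⁻¹ := by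
  rw [halfEdgeTerm_eq_single x σ (toSite (0, -1)) w_P_m1_0_0_0 (fun γ hγ => absurd (enum_P_m1_0_0 γ) hγ)]
  rw [if_neg (by decide), winding_support_medial w_P_m1_0_0_0.walk (toSite (0, -1)) (by decide),
    show quarterTurns (List.map ofSite w_P_m1_0_0_0.walk.support ++ [ofSite (toSite (0, -1))]) = -1 from by decide,
    show Literature.Probability.RandomPlanarGeometry.SAW.DomainSAW.length w_P_m1_0_0_0 = 1 from by decide, cexp_quarter_m1 σ]
  ring

/-- Value of one half-edge term of the mid-edge observable on the explicit domain (from the enumeration certificate and the integer winding count). [folklore] -/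
theorem hET_P_m1_0_S_in (x σ : ℝ) :
    Literature.Probability.RandomPlanarGeometry.SAW.halfEdgeTerm (Omega PE) 1 (toSite (-1, 0)) x σ (toSite (0, -1)) (toSite (0, 0)) = 0 := by
  refine halfEdgeTerm_eq_zero x σ (toSite (0, 0)) fun γ => ?_
  rw [enum_P_m1_0_4 γ]; decide

/-- Value of the mid-edge observable at one of the four edges at the origin, on the explicit domain. [folklore] -/
theorem F_P_m1_0_E (x σ : ℝ) :
    Literature.Probability.RandomPlanarGeometry.SAW.midEdgeParafermionicObservable (Omega PE) 1 (toSite (-1, 0)) x σ s(toSite (0, 0), toSite (1, 0)) =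
      (x : ℂ) ^ 2 := by
  simp only [Literature.Probability.RandomPlanarGeometry.SAW.midEdgeParafermionicObservable_mk, hET_P_m1_0_E_out, hET_P_m1_0_E_in, add_zero]

/-- Value of the mid-edge observable at one of the four edges at the origin, on the explicit domain. [folklore] -/
theorem F_P_m1_0_N (x σ : ℝ) :
    Literature.Probability.RandomPlanarGeometry.SAW.midEdgeParafermionicObservable (Omega PE) 1 (toSite (-1, 0)) x σ s(toSite (0, 0), toSite (0, 1)) =
      (x : ℂ) ^ 2 * tOf σ := by
  simp only [Literature.Probability.RandomPlanarGeometry.SAW.midEdgeParafermionicObservable_mk, hET_P_m1_0_N_out, hET_P_m1_0_N_in, add_zero]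

/-- Value of the mid-edge observable at one of the four edges at the origin, on the explicit domain. [folklore] -/
theorem F_P_m1_0_W (x σ : ℝ) :
    Literature.Probability.RandomPlanarGeometry.SAW.midEdgeParafermionicObservable (Omega PE) 1 (toSite (-1, 0)) x σ s(toSite (0, 0), toSite (-1, 0)) =
      (x : ℂ) := by
  simp only [Literature.Probability.RandomPlanarGeometry.SAW.midEdgeParafermionicObservable_mk, hET_P_m1_0_W_out, hET_P_m1_0_W_in, zero_add]

/-- Value of the mid-edge observable at one of the four edges at the origin, on the explicit domain. [folklore] -/
theorem F_P_m1_0_S (x σ : ℝ) :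
    Literature.Probability.RandomPlanarGeometry.SAW.midEdgeParafermionicObservable (Omega PE) 1 (toSite (-1, 0)) x σ s(toSite (0, 0), toSite (0, -1)) =
      (x : ℂ) ^ 2 * (tOf σ)⁻¹ := by
  simp only [Literature.Probability.RandomPlanarGeometry.SAW.midEdgeParafermionicObservable_mk, hET_P_m1_0_S_out, hET_P_m1_0_S_in, add_zero]

/-- The exact relation instantiated on domain `P` with root `(-1, 0)`. [folklore] -/
theorem inst_P_m1_0 {x σ : ℝ} {c : Fin 4 → ℂ} (hrel : ExactVertexRelationZ2 x σ c) :
    c 0 * ((x : ℂ) ^ 2) + c 1 * ((x : ℂ) ^ 2 * tOf σ) + c 2 * ((x : ℂ)) + c 3 * ((x : ℂ) ^ 2 * (tOf σ)⁻¹) = 0 := by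
  have h := hrel (Omega PE) 1 (toSite (-1, 0)) (toSite (0, 0)) one_pos
    ((goodP.mem_meshDomain_iff _).2 (by decide))
    ⟨toSite (-2, 0), zdAdj_toSite_left (-1, 0), by
      rw [meshPoint_one_toSite, pt_mem_Omega_iff goodP.unit]; decide⟩
    (adj_four goodP (by decide) (by decide) (by decide) (by decide))
  rw [sum_four_dirZ2] at h
  rw [F_P_m1_0_E, F_P_m1_0_N, F_P_m1_0_W, F_P_m1_0_S] at h
  linear_combination h

/-! #### Instance `P`, root `(0, -1)` -/

/-- explicit self-avoiding walk `(0,-1) → (0,0)` [folklore] -/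
def w_P_0_m1_0_0 : Literature.Probability.RandomPlanarGeometry.SAW.DomainSAW (Omega PE) 1 (toSite (0, -1)) (toSite (0, 0)) :=
  ⟨SimpleGraph.Walk.cons (goodP.A (0, -1) (0, 0)) <|
  SimpleGraph.Walk.nil, (SimpleGraph.Walk.isPath_def _).2 (by decide)⟩

/-- Enumeration certificate: the self-avoiding walks of `Ω_E` between these endpoints are exactly the listed ones (completeness of `dfs` + `decide`). [folklore] -/
theorem enum_P_0_m1_0 : ∀ γ : Literature.Probability.RandomPlanarGeometry.SAW.DomainSAW (Omega PE) 1 (toSite (0, -1)) (toSite (0, 0)),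
    γ = w_P_0_m1_0_0 := by
  intro γ
  have hmem := goodP.support_mem_dfs γ (by decide) (fuel := 8) (by decide)
  have hhead := head?_reverse_map_support γ.walk
  have hall : ∀ l ∈ dfs PE 8 [ofSite (toSite (0, -1))], l.head? = some (ofSite (toSite (0, 0))) →
      l = [(0, 0), (0, -1)] := by decide
  have h := hall _ hmem hhead
  apply DomainSAW_eq_of_support; rw [support_eq_of_reverse_map γ.walk h]; decide

/-- explicit self-avoiding walk `(0,-1) → (0,0) → (1,0)` [folklore] -/
def w_P_0_m1_1_0 : Literature.Probability.RandomPlanarGeometry.SAW.DomainSAW (Omega PE) 1 (toSite (0, -1)) (toSite (1, 0)) :=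
  ⟨SimpleGraph.Walk.cons (goodP.A (0, -1) (0, 0)) <|
  SimpleGraph.Walk.cons (goodP.A (0, 0) (1, 0)) <|
  SimpleGraph.Walk.nil, (SimpleGraph.Walk.isPath_def _).2 (by decide)⟩

/-- Enumeration certificate: the self-avoiding walks of `Ω_E` between these endpoints are exactly the listed ones (completeness of `dfs` + `decide`). [folklore] -/
theorem enum_P_0_m1_1 : ∀ γ : Literature.Probability.RandomPlanarGeometry.SAW.DomainSAW (Omega PE) 1 (toSite (0, -1)) (toSite (1, 0)),
    γ = w_P_0_m1_1_0 := by
  intro γ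
  have hmem := goodP.support_mem_dfs γ (by decide) (fuel := 8) (by decide)
  have hhead := head?_reverse_map_support γ.walk
  have hall : ∀ l ∈ dfs PE 8 [ofSite (toSite (0, -1))], l.head? = some (ofSite (toSite (1, 0))) →
      l = [(1, 0), (0, 0), (0, -1)] := by decide
  have h := hall _ hmem hhead
  apply DomainSAW_eq_of_support; rw [support_eq_of_reverse_map γ.walk h]; decide

/-- explicit self-avoiding walk `(0,-1) → (0,0) → (0,1)` [folklore] -/
def w_P_0_m1_2_0 : Literature.Probability.RandomPlanarGeometry.SAW.DomainSAW (Omega PE) 1 (toSite (0, -1)) (toSite (0, 1)) :=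
  ⟨SimpleGraph.Walk.cons (goodP.A (0, -1) (0, 0)) <|
  SimpleGraph.Walk.cons (goodP.A (0, 0) (0, 1)) <|
  SimpleGraph.Walk.nil, (SimpleGraph.Walk.isPath_def _).2 (by decide)⟩

/-- Enumeration certificate: the self-avoiding walks of `Ω_E` between these endpoints are exactly the listed ones (completeness of `dfs` + `decide`). [folklore] -/
theorem enum_P_0_m1_2 : ∀ γ : Literature.Probability.RandomPlanarGeometry.SAW.DomainSAW (Omega PE) 1 (toSite (0, -1)) (toSite (0, 1)),
    γ = w_P_0_m1_2_0 := by
  intro γ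
  have hmem := goodP.support_mem_dfs γ (by decide) (fuel := 8) (by decide)
  have hhead := head?_reverse_map_support γ.walk
  have hall : ∀ l ∈ dfs PE 8 [ofSite (toSite (0, -1))], l.head? = some (ofSite (toSite (0, 1))) →
      l = [(0, 1), (0, 0), (0, -1)] := by decide
  have h := hall _ hmem hhead
  apply DomainSAW_eq_of_support; rw [support_eq_of_reverse_map γ.walk h]; decide

/-- explicit self-avoiding walk `(0,-1) → (0,0) → (-1,0)` [folklore] -/
def w_P_0_m1_3_0 : Literature.Probability.RandomPlanarGeometry.SAW.DomainSAW (Omega PE) 1 (toSite (0, -1)) (toSite (-1, 0)) :=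
  ⟨SimpleGraph.Walk.cons (goodP.A (0, -1) (0, 0)) <|
  SimpleGraph.Walk.cons (goodP.A (0, 0) (-1, 0)) <|
  SimpleGraph.Walk.nil, (SimpleGraph.Walk.isPath_def _).2 (by decide)⟩

/-- Enumeration certificate: the self-avoiding walks of `Ω_E` between these endpoints are exactly the listed ones (completeness of `dfs` + `decide`). [folklore] -/
theorem enum_P_0_m1_3 : ∀ γ : Literature.Probability.RandomPlanarGeometry.SAW.DomainSAW (Omega PE) 1 (toSite (0, -1)) (toSite (-1, 0)),
    γ = w_P_0_m1_3_0 := by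
  intro γ
  have hmem := goodP.support_mem_dfs γ (by decide) (fuel := 8) (by decide)
  have hhead := head?_reverse_map_support γ.walk
  have hall : ∀ l ∈ dfs PE 8 [ofSite (toSite (0, -1))], l.head? = some (ofSite (toSite (-1, 0))) →
      l = [(-1, 0), (0, 0), (0, -1)] := by decide
  have h := hall _ hmem hhead
  apply DomainSAW_eq_of_support; rw [support_eq_of_reverse_map γ.walk h]; decide

/-- the trivial walk at the root [folklore] -/
def nil_P_0_m1 : Literature.Probability.RandomPlanarGeometry.SAW.DomainSAW (Omega PE) 1 (toSite (0, -1)) (toSite (0, -1)) := Literature.Probability.RandomPlanarGeometry.SAW.DomainSAW.nil _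

/-- Enumeration certificate: the self-avoiding walks of `Ω_E` between these endpoints are exactly the listed ones (completeness of `dfs` + `decide`). [folklore] -/
theorem enum_P_0_m1_4 : ∀ γ : Literature.Probability.RandomPlanarGeometry.SAW.DomainSAW (Omega PE) 1 (toSite (0, -1)) (toSite (0, -1)), γ = nil_P_0_m1 :=
  Literature.Probability.RandomPlanarGeometry.SAW.DomainSAW.eq_nil_of_self

/-- Value of one half-edge term of the mid-edge observable on the explicit domain (from the enumeration certificate and the integer winding count). [folklore] -/
theorem hET_P_0_m1_E_out (x σ : ℝ) :
    Literature.Probability.RandomPlanarGeometry.SAW.halfEdgeTerm (Omega PE) 1 (toSite (0, -1)) x σ (toSite (0, 0)) (toSite (1, 0)) =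
      (x : ℂ) ^ 2 * (tOf σ)⁻¹ := by
  rw [halfEdgeTerm_eq_single x σ (toSite (1, 0)) w_P_0_m1_0_0 (fun γ hγ => absurd (enum_P_0_m1_0 γ) hγ)]
  rw [if_neg (by decide), winding_support_medial w_P_0_m1_0_0.walk (toSite (1, 0)) (by decide),
    show quarterTurns (List.map ofSite w_P_0_m1_0_0.walk.support ++ [ofSite (toSite (1, 0))]) = -1 from by decide,
    show Literature.Probability.RandomPlanarGeometry.SAW.DomainSAW.length w_P_0_m1_0_0 = 1 from by decide, cexp_quarter_m1 σ]
  ring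

/-- Value of one half-edge term of the mid-edge observable on the explicit domain (from the enumeration certificate and the integer winding count). [folklore] -/
theorem hET_P_0_m1_E_in (x σ : ℝ) :
    Literature.Probability.RandomPlanarGeometry.SAW.halfEdgeTerm (Omega PE) 1 (toSite (0, -1)) x σ (toSite (1, 0)) (toSite (0, 0)) = 0 := by
  refine halfEdgeTerm_eq_zero x σ (toSite (0, 0)) fun γ => ?_
  rw [enum_P_0_m1_1 γ]; decide

/-- Value of one half-edge term of the mid-edge observable on the explicit domain (from the enumeration certificate and the integer winding count). [folklore] -/
theorem hET_P_0_m1_N_out (x σ : ℝ) :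
    Literature.Probability.RandomPlanarGeometry.SAW.halfEdgeTerm (Omega PE) 1 (toSite (0, -1)) x σ (toSite (0, 0)) (toSite (0, 1)) =
      (x : ℂ) ^ 2 := by
  rw [halfEdgeTerm_eq_single x σ (toSite (0, 1)) w_P_0_m1_0_0 (fun γ hγ => absurd (enum_P_0_m1_0 γ) hγ)]
  rw [if_neg (by decide), winding_support_medial w_P_0_m1_0_0.walk (toSite (0, 1)) (by decide),
    show quarterTurns (List.map ofSite w_P_0_m1_0_0.walk.support ++ [ofSite (toSite (0, 1))]) = 0 from by decide,
    show Literature.Probability.RandomPlanarGeometry.SAW.DomainSAW.length w_P_0_m1_0_0 = 1 from by decide, cexp_quarter_0 σ]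
  ring

/-- Value of one half-edge term of the mid-edge observable on the explicit domain (from the enumeration certificate and the integer winding count). [folklore] -/
theorem hET_P_0_m1_N_in (x σ : ℝ) :
    Literature.Probability.RandomPlanarGeometry.SAW.halfEdgeTerm (Omega PE) 1 (toSite (0, -1)) x σ (toSite (0, 1)) (toSite (0, 0)) = 0 := by
  refine halfEdgeTerm_eq_zero x σ (toSite (0, 0)) fun γ => ?_
  rw [enum_P_0_m1_2 γ]; decide

/-- Value of one half-edge term of the mid-edge observable on the explicit domain (from the enumeration certificate and the integer winding count). [folklore] -/
theorem hET_P_0_m1_W_out (x σ : ℝ) :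
    Literature.Probability.RandomPlanarGeometry.SAW.halfEdgeTerm (Omega PE) 1 (toSite (0, -1)) x σ (toSite (0, 0)) (toSite (-1, 0)) =
      (x : ℂ) ^ 2 * tOf σ := by
  rw [halfEdgeTerm_eq_single x σ (toSite (-1, 0)) w_P_0_m1_0_0 (fun γ hγ => absurd (enum_P_0_m1_0 γ) hγ)]
  rw [if_neg (by decide), winding_support_medial w_P_0_m1_0_0.walk (toSite (-1, 0)) (by decide),
    show quarterTurns (List.map ofSite w_P_0_m1_0_0.walk.support ++ [ofSite (toSite (-1, 0))]) = 1 from by decide,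
    show Literature.Probability.RandomPlanarGeometry.SAW.DomainSAW.length w_P_0_m1_0_0 = 1 from by decide, cexp_quarter_1 σ]
  ring

/-- Value of one half-edge term of the mid-edge observable on the explicit domain (from the enumeration certificate and the integer winding count). [folklore] -/
theorem hET_P_0_m1_W_in (x σ : ℝ) :
    Literature.Probability.RandomPlanarGeometry.SAW.halfEdgeTerm (Omega PE) 1 (toSite (0, -1)) x σ (toSite (-1, 0)) (toSite (0, 0)) = 0 := by
  refine halfEdgeTerm_eq_zero x σ (toSite (0, 0)) fun γ => ?_
  rw [enum_P_0_m1_3 γ]; decide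

/-- Value of one half-edge term of the mid-edge observable on the explicit domain (from the enumeration certificate and the integer winding count). [folklore] -/
theorem hET_P_0_m1_S_out (x σ : ℝ) :
    Literature.Probability.RandomPlanarGeometry.SAW.halfEdgeTerm (Omega PE) 1 (toSite (0, -1)) x σ (toSite (0, 0)) (toSite (0, -1)) = 0 := by
  refine halfEdgeTerm_eq_zero x σ (toSite (0, -1)) fun γ => ?_
  rw [enum_P_0_m1_0 γ]; decide

/-- Value of one half-edge term of the mid-edge observable on the explicit domain (from the enumeration certificate and the integer winding count). [folklore] -/
theorem hET_P_0_m1_S_in (x σ : ℝ) :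
    Literature.Probability.RandomPlanarGeometry.SAW.halfEdgeTerm (Omega PE) 1 (toSite (0, -1)) x σ (toSite (0, -1)) (toSite (0, 0)) =
      (x : ℂ) := by
  rw [halfEdgeTerm_eq_single x σ (toSite (0, 0)) nil_P_0_m1 (fun γ hγ => absurd (enum_P_0_m1_4 γ) hγ)]
  rw [if_neg (by decide), winding_support_medial nil_P_0_m1.walk (toSite (0, 0)) (by decide),
    show quarterTurns (List.map ofSite nil_P_0_m1.walk.support ++ [ofSite (toSite (0, 0))]) = 0 from by decide,
    show Literature.Probability.RandomPlanarGeometry.SAW.DomainSAW.length nil_P_0_m1 = 0 from by decide, cexp_quarter_0 σ]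
  ring

/-- Value of the mid-edge observable at one of the four edges at the origin, on the explicit domain. [folklore] -/
theorem F_P_0_m1_E (x σ : ℝ) :
    Literature.Probability.RandomPlanarGeometry.SAW.midEdgeParafermionicObservable (Omega PE) 1 (toSite (0, -1)) x σ s(toSite (0, 0), toSite (1, 0)) =
      (x : ℂ) ^ 2 * (tOf σ)⁻¹ := by
  simp only [Literature.Probability.RandomPlanarGeometry.SAW.midEdgeParafermionicObservable_mk, hET_P_0_m1_E_out, hET_P_0_m1_E_in, add_zero]

/-- Value of the mid-edge observable at one of the four edges at the origin, on the explicit domain. [folklore] -/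
theorem F_P_0_m1_N (x σ : ℝ) :
    Literature.Probability.RandomPlanarGeometry.SAW.midEdgeParafermionicObservable (Omega PE) 1 (toSite (0, -1)) x σ s(toSite (0, 0), toSite (0, 1)) =
      (x : ℂ) ^ 2 := by
  simp only [Literature.Probability.RandomPlanarGeometry.SAW.midEdgeParafermionicObservable_mk, hET_P_0_m1_N_out, hET_P_0_m1_N_in, add_zero]

/-- Value of the mid-edge observable at one of the four edges at the origin, on the explicit domain. [folklore] -/
theorem F_P_0_m1_W (x σ : ℝ) :
    Literature.Probability.RandomPlanarGeometry.SAW.midEdgeParafermionicObservable (Omega PE) 1 (toSite (0, -1)) x σ s(toSite (0, 0), toSite (-1, 0)) =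
      (x : ℂ) ^ 2 * tOf σ := by
  simp only [Literature.Probability.RandomPlanarGeometry.SAW.midEdgeParafermionicObservable_mk, hET_P_0_m1_W_out, hET_P_0_m1_W_in, add_zero]

/-- Value of the mid-edge observable at one of the four edges at the origin, on the explicit domain. [folklore] -/
theorem F_P_0_m1_S (x σ : ℝ) :
    Literature.Probability.RandomPlanarGeometry.SAW.midEdgeParafermionicObservable (Omega PE) 1 (toSite (0, -1)) x σ s(toSite (0, 0), toSite (0, -1)) =
      (x : ℂ) := by
  simp only [Literature.Probability.RandomPlanarGeometry.SAW.midEdgeParafermionicObservable_mk, hET_P_0_m1_S_out, hET_P_0_m1_S_in, zero_add]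

/-- The exact relation instantiated on domain `P` with root `(0, -1)`. [folklore] -/
theorem inst_P_0_m1 {x σ : ℝ} {c : Fin 4 → ℂ} (hrel : ExactVertexRelationZ2 x σ c) :
    c 0 * ((x : ℂ) ^ 2 * (tOf σ)⁻¹) + c 1 * ((x : ℂ) ^ 2) + c 2 * ((x : ℂ) ^ 2 * tOf σ) + c 3 * ((x : ℂ)) = 0 := by
  have h := hrel (Omega PE) 1 (toSite (0, -1)) (toSite (0, 0)) one_pos
    ((goodP.mem_meshDomain_iff _).2 (by decide))
    ⟨toSite (0, -2), zdAdj_toSite_down (0, -1), by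
      rw [meshPoint_one_toSite, pt_mem_Omega_iff goodP.unit]; decide⟩
    (adj_four goodP (by decide) (by decide) (by decide) (by decide))
  rw [sum_four_dirZ2] at h
  rw [F_P_0_m1_E, F_P_0_m1_N, F_P_0_m1_W, F_P_0_m1_S] at h
  linear_combination h

/-! #### Instance `T`, root `(1, 0)` -/

/-- explicit self-avoiding walk `(1,0) → (0,0)` [folklore] -/
def w_T_1_0_0_0 : Literature.Probability.RandomPlanarGeometry.SAW.DomainSAW (Omega TE) 1 (toSite (1, 0)) (toSite (0, 0)) :=
  ⟨SimpleGraph.Walk.cons (goodT.A (1, 0) (0, 0)) <|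
  SimpleGraph.Walk.nil, (SimpleGraph.Walk.isPath_def _).2 (by decide)⟩

/-- Enumeration certificate: the self-avoiding walks of `Ω_E` between these endpoints are exactly the listed ones (completeness of `dfs` + `decide`). [folklore] -/
theorem enum_T_1_0_0 : ∀ γ : Literature.Probability.RandomPlanarGeometry.SAW.DomainSAW (Omega TE) 1 (toSite (1, 0)) (toSite (0, 0)),
    γ = w_T_1_0_0_0 := by
  intro γ
  have hmem := goodT.support_mem_dfs γ (by decide) (fuel := 20) (by decide)
  have hhead := head?_reverse_map_support γ.walk
  have hall : ∀ l ∈ dfs TE 20 [ofSite (toSite (1, 0))], l.head? = some (ofSite (toSite (0, 0))) →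
      l = [(0, 0), (1, 0)] := by decide
  have h := hall _ hmem hhead
  apply DomainSAW_eq_of_support; rw [support_eq_of_reverse_map γ.walk h]; decide

/-- the trivial walk at the root [folklore] -/
def nil_T_1_0 : Literature.Probability.RandomPlanarGeometry.SAW.DomainSAW (Omega TE) 1 (toSite (1, 0)) (toSite (1, 0)) := Literature.Probability.RandomPlanarGeometry.SAW.DomainSAW.nil _

/-- Enumeration certificate: the self-avoiding walks of `Ω_E` between these endpoints are exactly the listed ones (completeness of `dfs` + `decide`). [folklore] -/
theorem enum_T_1_0_1 : ∀ γ : Literature.Probability.RandomPlanarGeometry.SAW.DomainSAW (Omega TE) 1 (toSite (1, 0)) (toSite (1, 0)), γ = nil_T_1_0 :=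
  Literature.Probability.RandomPlanarGeometry.SAW.DomainSAW.eq_nil_of_self

/-- explicit self-avoiding walk `(1,0) → (0,0) → (0,1)` [folklore] -/
def w_T_1_0_2_0 : Literature.Probability.RandomPlanarGeometry.SAW.DomainSAW (Omega TE) 1 (toSite (1, 0)) (toSite (0, 1)) :=
  ⟨SimpleGraph.Walk.cons (goodT.A (1, 0) (0, 0)) <|
  SimpleGraph.Walk.cons (goodT.A (0, 0) (0, 1)) <|
  SimpleGraph.Walk.nil, (SimpleGraph.Walk.isPath_def _).2 (by decide)⟩

/-- explicit self-avoiding walk `(1,0) → (0,0) → (-1,0) → (-2,0) → (-2,1) → (-2,2) → (-1,2) → (0,2) → (0,1)` [folklore] -/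
def w_T_1_0_2_1 : Literature.Probability.RandomPlanarGeometry.SAW.DomainSAW (Omega TE) 1 (toSite (1, 0)) (toSite (0, 1)) :=
  ⟨SimpleGraph.Walk.cons (goodT.A (1, 0) (0, 0)) <|
  SimpleGraph.Walk.cons (goodT.A (0, 0) (-1, 0)) <|
  SimpleGraph.Walk.cons (goodT.A (-1, 0) (-2, 0)) <|
  SimpleGraph.Walk.cons (goodT.A (-2, 0) (-2, 1)) <|
  SimpleGraph.Walk.cons (goodT.A (-2, 1) (-2, 2)) <|
  SimpleGraph.Walk.cons (goodT.A (-2, 2) (-1, 2)) <|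
  SimpleGraph.Walk.cons (goodT.A (-1, 2) (0, 2)) <|
  SimpleGraph.Walk.cons (goodT.A (0, 2) (0, 1)) <|
  SimpleGraph.Walk.nil, (SimpleGraph.Walk.isPath_def _).2 (by decide)⟩

/-- Enumeration certificate: the self-avoiding walks of `Ω_E` between these endpoints are exactly the listed ones (completeness of `dfs` + `decide`). [folklore] -/
theorem enum_T_1_0_2 : ∀ γ : Literature.Probability.RandomPlanarGeometry.SAW.DomainSAW (Omega TE) 1 (toSite (1, 0)) (toSite (0, 1)),
    γ = w_T_1_0_2_0 ∨ γ = w_T_1_0_2_1 := by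
  intro γ
  have hmem := goodT.support_mem_dfs γ (by decide) (fuel := 20) (by decide)
  have hhead := head?_reverse_map_support γ.walk
  have hall : ∀ l ∈ dfs TE 20 [ofSite (toSite (1, 0))], l.head? = some (ofSite (toSite (0, 1))) →
      l = [(0, 1), (0, 0), (1, 0)] ∨ l = [(0, 1), (0, 2), (-1, 2), (-2, 2), (-2, 1), (-2, 0), (-1, 0), (0, 0), (1, 0)] := by decide
  rcases hall _ hmem hhead with h | h
  · left; apply DomainSAW_eq_of_support; rw [support_eq_of_reverse_map γ.walk h]; decide
  · right; apply DomainSAW_eq_of_support; rw [support_eq_of_reverse_map γ.walk h]; decide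

/-- explicit self-avoiding walk `(1,0) → (0,0) → (0,1) → (0,2) → (-1,2) → (-2,2) → (-2,1) → (-2,0) → (-1,0)` [folklore] -/
def w_T_1_0_3_0 : Literature.Probability.RandomPlanarGeometry.SAW.DomainSAW (Omega TE) 1 (toSite (1, 0)) (toSite (-1, 0)) :=
  ⟨SimpleGraph.Walk.cons (goodT.A (1, 0) (0, 0)) <|
  SimpleGraph.Walk.cons (goodT.A (0, 0) (0, 1)) <|
  SimpleGraph.Walk.cons (goodT.A (0, 1) (0, 2)) <|
  SimpleGraph.Walk.cons (goodT.A (0, 2) (-1, 2)) <|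
  SimpleGraph.Walk.cons (goodT.A (-1, 2) (-2, 2)) <|
  SimpleGraph.Walk.cons (goodT.A (-2, 2) (-2, 1)) <|
  SimpleGraph.Walk.cons (goodT.A (-2, 1) (-2, 0)) <|
  SimpleGraph.Walk.cons (goodT.A (-2, 0) (-1, 0)) <|
  SimpleGraph.Walk.nil, (SimpleGraph.Walk.isPath_def _).2 (by decide)⟩

/-- explicit self-avoiding walk `(1,0) → (0,0) → (-1,0)` [folklore] -/
def w_T_1_0_3_1 : Literature.Probability.RandomPlanarGeometry.SAW.DomainSAW (Omega TE) 1 (toSite (1, 0)) (toSite (-1, 0)) :=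
  ⟨SimpleGraph.Walk.cons (goodT.A (1, 0) (0, 0)) <|
  SimpleGraph.Walk.cons (goodT.A (0, 0) (-1, 0)) <|
  SimpleGraph.Walk.nil, (SimpleGraph.Walk.isPath_def _).2 (by decide)⟩

/-- Enumeration certificate: the self-avoiding walks of `Ω_E` between these endpoints are exactly the listed ones (completeness of `dfs` + `decide`). [folklore] -/
theorem enum_T_1_0_3 : ∀ γ : Literature.Probability.RandomPlanarGeometry.SAW.DomainSAW (Omega TE) 1 (toSite (1, 0)) (toSite (-1, 0)),
    γ = w_T_1_0_3_0 ∨ γ = w_T_1_0_3_1 := by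
  intro γ
  have hmem := goodT.support_mem_dfs γ (by decide) (fuel := 20) (by decide)
  have hhead := head?_reverse_map_support γ.walk
  have hall : ∀ l ∈ dfs TE 20 [ofSite (toSite (1, 0))], l.head? = some (ofSite (toSite (-1, 0))) →
      l = [(-1, 0), (-2, 0), (-2, 1), (-2, 2), (-1, 2), (0, 2), (0, 1), (0, 0), (1, 0)] ∨ l = [(-1, 0), (0, 0), (1, 0)] := by decide
  rcases hall _ hmem hhead with h | h
  · left; apply DomainSAW_eq_of_support; rw [support_eq_of_reverse_map γ.walk h]; decide
  · right; apply DomainSAW_eq_of_support; rw [support_eq_of_reverse_map γ.walk h]; decide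

/-- explicit self-avoiding walk `(1,0) → (0,0) → (0,-1)` [folklore] -/
def w_T_1_0_4_0 : Literature.Probability.RandomPlanarGeometry.SAW.DomainSAW (Omega TE) 1 (toSite (1, 0)) (toSite (0, -1)) :=
  ⟨SimpleGraph.Walk.cons (goodT.A (1, 0) (0, 0)) <|
  SimpleGraph.Walk.cons (goodT.A (0, 0) (0, -1)) <|
  SimpleGraph.Walk.nil, (SimpleGraph.Walk.isPath_def _).2 (by decide)⟩

/-- Enumeration certificate: the self-avoiding walks of `Ω_E` between these endpoints are exactly the listed ones (completeness of `dfs` + `decide`). [folklore] -/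
theorem enum_T_1_0_4 : ∀ γ : Literature.Probability.RandomPlanarGeometry.SAW.DomainSAW (Omega TE) 1 (toSite (1, 0)) (toSite (0, -1)),
    γ = w_T_1_0_4_0 := by
  intro γ
  have hmem := goodT.support_mem_dfs γ (by decide) (fuel := 20) (by decide)
  have hhead := head?_reverse_map_support γ.walk
  have hall : ∀ l ∈ dfs TE 20 [ofSite (toSite (1, 0))], l.head? = some (ofSite (toSite (0, -1))) →
      l = [(0, -1), (0, 0), (1, 0)] := by decide
  have h := hall _ hmem hhead
  apply DomainSAW_eq_of_support; rw [support_eq_of_reverse_map γ.walk h]; decide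

/-- Value of one half-edge term of the mid-edge observable on the explicit domain (from the enumeration certificate and the integer winding count). [folklore] -/
theorem hET_T_1_0_E_out (x σ : ℝ) :
    Literature.Probability.RandomPlanarGeometry.SAW.halfEdgeTerm (Omega TE) 1 (toSite (1, 0)) x σ (toSite (0, 0)) (toSite (1, 0)) = 0 := by
  refine halfEdgeTerm_eq_zero x σ (toSite (1, 0)) fun γ => ?_
  rw [enum_T_1_0_0 γ]; decide

/-- Value of one half-edge term of the mid-edge observable on the explicit domain (from the enumeration certificate and the integer winding count). [folklore] -/
theorem hET_T_1_0_E_in (x σ : ℝ) :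
    Literature.Probability.RandomPlanarGeometry.SAW.halfEdgeTerm (Omega TE) 1 (toSite (1, 0)) x σ (toSite (1, 0)) (toSite (0, 0)) =
      (x : ℂ) := by
  rw [halfEdgeTerm_eq_single x σ (toSite (0, 0)) nil_T_1_0 (fun γ hγ => absurd (enum_T_1_0_1 γ) hγ)]
  rw [if_neg (by decide), winding_support_medial nil_T_1_0.walk (toSite (0, 0)) (by decide),
    show quarterTurns (List.map ofSite nil_T_1_0.walk.support ++ [ofSite (toSite (0, 0))]) = 0 from by decide,
    show Literature.Probability.RandomPlanarGeometry.SAW.DomainSAW.length nil_T_1_0 = 0 from by decide, cexp_quarter_0 σ]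
  ring

/-- Value of one half-edge term of the mid-edge observable on the explicit domain (from the enumeration certificate and the integer winding count). [folklore] -/
theorem hET_T_1_0_N_out (x σ : ℝ) :
    Literature.Probability.RandomPlanarGeometry.SAW.halfEdgeTerm (Omega TE) 1 (toSite (1, 0)) x σ (toSite (0, 0)) (toSite (0, 1)) =
      (x : ℂ) ^ 2 * (tOf σ)⁻¹ := by
  rw [halfEdgeTerm_eq_single x σ (toSite (0, 1)) w_T_1_0_0_0 (fun γ hγ => absurd (enum_T_1_0_0 γ) hγ)]
  rw [if_neg (by decide), winding_support_medial w_T_1_0_0_0.walk (toSite (0, 1)) (by decide),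
    show quarterTurns (List.map ofSite w_T_1_0_0_0.walk.support ++ [ofSite (toSite (0, 1))]) = -1 from by decide,
    show Literature.Probability.RandomPlanarGeometry.SAW.DomainSAW.length w_T_1_0_0_0 = 1 from by decide, cexp_quarter_m1 σ]
  ring

/-- Value of one half-edge term of the mid-edge observable on the explicit domain (from the enumeration certificate and the integer winding count). [folklore] -/
theorem hET_T_1_0_N_in (x σ : ℝ) :
    Literature.Probability.RandomPlanarGeometry.SAW.halfEdgeTerm (Omega TE) 1 (toSite (1, 0)) x σ (toSite (0, 1)) (toSite (0, 0)) =
      (x : ℂ) ^ 9 * (tOf σ)⁻¹ ^ 3 := by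
  rw [halfEdgeTerm_eq_single x σ (toSite (0, 0)) w_T_1_0_2_1 (fun γ hγ => by
    rcases enum_T_1_0_2 γ with rfl | rfl
    · decide
    · exact absurd rfl hγ
    )]
  rw [if_neg (by decide), winding_support_medial w_T_1_0_2_1.walk (toSite (0, 0)) (by decide),
    show quarterTurns (List.map ofSite w_T_1_0_2_1.walk.support ++ [ofSite (toSite (0, 0))]) = -3 from by decide,
    show Literature.Probability.RandomPlanarGeometry.SAW.DomainSAW.length w_T_1_0_2_1 = 8 from by decide, cexp_quarter_m3 σ]
  ring

/-- Value of one half-edge term of the mid-edge observable on the explicit domain (from the enumeration certificate and the integer winding count). [folklore] -/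
theorem hET_T_1_0_W_out (x σ : ℝ) :
    Literature.Probability.RandomPlanarGeometry.SAW.halfEdgeTerm (Omega TE) 1 (toSite (1, 0)) x σ (toSite (0, 0)) (toSite (-1, 0)) =
      (x : ℂ) ^ 2 := by
  rw [halfEdgeTerm_eq_single x σ (toSite (-1, 0)) w_T_1_0_0_0 (fun γ hγ => absurd (enum_T_1_0_0 γ) hγ)]
  rw [if_neg (by decide), winding_support_medial w_T_1_0_0_0.walk (toSite (-1, 0)) (by decide),
    show quarterTurns (List.map ofSite w_T_1_0_0_0.walk.support ++ [ofSite (toSite (-1, 0))]) = 0 from by decide,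
    show Literature.Probability.RandomPlanarGeometry.SAW.DomainSAW.length w_T_1_0_0_0 = 1 from by decide, cexp_quarter_0 σ]
  ring

/-- Value of one half-edge term of the mid-edge observable on the explicit domain (from the enumeration certificate and the integer winding count). [folklore] -/
theorem hET_T_1_0_W_in (x σ : ℝ) :
    Literature.Probability.RandomPlanarGeometry.SAW.halfEdgeTerm (Omega TE) 1 (toSite (1, 0)) x σ (toSite (-1, 0)) (toSite (0, 0)) =
      (x : ℂ) ^ 9 * tOf σ ^ 2 := by
  rw [halfEdgeTerm_eq_single x σ (toSite (0, 0)) w_T_1_0_3_0 (fun γ hγ => by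
    rcases enum_T_1_0_3 γ with rfl | rfl
    · exact absurd rfl hγ
    · decide
    )]
  rw [if_neg (by decide), winding_support_medial w_T_1_0_3_0.walk (toSite (0, 0)) (by decide),
    show quarterTurns (List.map ofSite w_T_1_0_3_0.walk.support ++ [ofSite (toSite (0, 0))]) = 2 from by decide,
    show Literature.Probability.RandomPlanarGeometry.SAW.DomainSAW.length w_T_1_0_3_0 = 8 from by decide, cexp_quarter_2 σ]
  ring

/-- Value of one half-edge term of the mid-edge observable on the explicit domain (from the enumeration certificate and the integer winding count). [folklore] -/
theorem hET_T_1_0_S_out (x σ : ℝ) :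
    Literature.Probability.RandomPlanarGeometry.SAW.halfEdgeTerm (Omega TE) 1 (toSite (1, 0)) x σ (toSite (0, 0)) (toSite (0, -1)) =
      (x : ℂ) ^ 2 * tOf σ := by
  rw [halfEdgeTerm_eq_single x σ (toSite (0, -1)) w_T_1_0_0_0 (fun γ hγ => absurd (enum_T_1_0_0 γ) hγ)]
  rw [if_neg (by decide), winding_support_medial w_T_1_0_0_0.walk (toSite (0, -1)) (by decide),
    show quarterTurns (List.map ofSite w_T_1_0_0_0.walk.support ++ [ofSite (toSite (0, -1))]) = 1 from by decide,
    show Literature.Probability.RandomPlanarGeometry.SAW.DomainSAW.length w_T_1_0_0_0 = 1 from by decide, cexp_quarter_1 σ]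
  ring

/-- Value of one half-edge term of the mid-edge observable on the explicit domain (from the enumeration certificate and the integer winding count). [folklore] -/
theorem hET_T_1_0_S_in (x σ : ℝ) :
    Literature.Probability.RandomPlanarGeometry.SAW.halfEdgeTerm (Omega TE) 1 (toSite (1, 0)) x σ (toSite (0, -1)) (toSite (0, 0)) = 0 := by
  refine halfEdgeTerm_eq_zero x σ (toSite (0, 0)) fun γ => ?_
  rw [enum_T_1_0_4 γ]; decide

/-- Value of the mid-edge observable at one of the four edges at the origin, on the explicit domain. [folklore] -/
theorem F_T_1_0_E (x σ : ℝ) :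
    Literature.Probability.RandomPlanarGeometry.SAW.midEdgeParafermionicObservable (Omega TE) 1 (toSite (1, 0)) x σ s(toSite (0, 0), toSite (1, 0)) =
      (x : ℂ) := by
  simp only [Literature.Probability.RandomPlanarGeometry.SAW.midEdgeParafermionicObservable_mk, hET_T_1_0_E_out, hET_T_1_0_E_in, zero_add]

/-- Value of the mid-edge observable at one of the four edges at the origin, on the explicit domain. [folklore] -/
theorem F_T_1_0_N (x σ : ℝ) :
    Literature.Probability.RandomPlanarGeometry.SAW.midEdgeParafermionicObservable (Omega TE) 1 (toSite (1, 0)) x σ s(toSite (0, 0), toSite (0, 1)) =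
      (x : ℂ) ^ 2 * (tOf σ)⁻¹ + (x : ℂ) ^ 9 * (tOf σ)⁻¹ ^ 3 := by
  simp only [Literature.Probability.RandomPlanarGeometry.SAW.midEdgeParafermionicObservable_mk, hET_T_1_0_N_out, hET_T_1_0_N_in]

/-- Value of the mid-edge observable at one of the four edges at the origin, on the explicit domain. [folklore] -/
theorem F_T_1_0_W (x σ : ℝ) :
    Literature.Probability.RandomPlanarGeometry.SAW.midEdgeParafermionicObservable (Omega TE) 1 (toSite (1, 0)) x σ s(toSite (0, 0), toSite (-1, 0)) =
      (x : ℂ) ^ 2 + (x : ℂ) ^ 9 * tOf σ ^ 2 := by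
  simp only [Literature.Probability.RandomPlanarGeometry.SAW.midEdgeParafermionicObservable_mk, hET_T_1_0_W_out, hET_T_1_0_W_in]

/-- Value of the mid-edge observable at one of the four edges at the origin, on the explicit domain. [folklore] -/
theorem F_T_1_0_S (x σ : ℝ) :
    Literature.Probability.RandomPlanarGeometry.SAW.midEdgeParafermionicObservable (Omega TE) 1 (toSite (1, 0)) x σ s(toSite (0, 0), toSite (0, -1)) =
      (x : ℂ) ^ 2 * tOf σ := by
  simp only [Literature.Probability.RandomPlanarGeometry.SAW.midEdgeParafermionicObservable_mk, hET_T_1_0_S_out, hET_T_1_0_S_in, add_zero]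

/-- The exact relation instantiated on domain `T` with root `(1, 0)`. [folklore] -/
theorem inst_T_1_0 {x σ : ℝ} {c : Fin 4 → ℂ} (hrel : ExactVertexRelationZ2 x σ c) :
    c 0 * ((x : ℂ)) + c 1 * ((x : ℂ) ^ 2 * (tOf σ)⁻¹ + (x : ℂ) ^ 9 * (tOf σ)⁻¹ ^ 3) + c 2 * ((x : ℂ) ^ 2 + (x : ℂ) ^ 9 * tOf σ ^ 2) + c 3 * ((x : ℂ) ^ 2 * tOf σ) = 0 := by
  have h := hrel (Omega TE) 1 (toSite (1, 0)) (toSite (0, 0)) one_pos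
    ((goodT.mem_meshDomain_iff _).2 (by decide))
    ⟨toSite (2, 0), zdAdj_toSite_right (1, 0), by
      rw [meshPoint_one_toSite, pt_mem_Omega_iff goodT.unit]; decide⟩
    (adj_four goodT (by decide) (by decide) (by decide) (by decide))
  rw [sum_four_dirZ2] at h
  rw [F_T_1_0_E, F_T_1_0_N, F_T_1_0_W, F_T_1_0_S] at h
  linear_combination h

/-! #### Instance `O`, root `(1, 0)` -/

/-- explicit self-avoiding walk `(1,0) → (0,0)` [folklore] -/
def w_O_1_0_0_0 : Literature.Probability.RandomPlanarGeometry.SAW.DomainSAW (Omega OE) 1 (toSite (1, 0)) (toSite (0, 0)) :=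
  ⟨SimpleGraph.Walk.cons (goodO.A (1, 0) (0, 0)) <|
  SimpleGraph.Walk.nil, (SimpleGraph.Walk.isPath_def _).2 (by decide)⟩

/-- Enumeration certificate: the self-avoiding walks of `Ω_E` between these endpoints are exactly the listed ones (completeness of `dfs` + `decide`). [folklore] -/
theorem enum_O_1_0_0 : ∀ γ : Literature.Probability.RandomPlanarGeometry.SAW.DomainSAW (Omega OE) 1 (toSite (1, 0)) (toSite (0, 0)),
    γ = w_O_1_0_0_0 := by
  intro γ
  have hmem := goodO.support_mem_dfs γ (by decide) (fuel := 32) (by decide)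
  have hhead := head?_reverse_map_support γ.walk
  have hall : ∀ l ∈ dfs OE 32 [ofSite (toSite (1, 0))], l.head? = some (ofSite (toSite (0, 0))) →
      l = [(0, 0), (1, 0)] := by decide
  have h := hall _ hmem hhead
  apply DomainSAW_eq_of_support; rw [support_eq_of_reverse_map γ.walk h]; decide

/-- the trivial walk at the root [folklore] -/
def nil_O_1_0 : Literature.Probability.RandomPlanarGeometry.SAW.DomainSAW (Omega OE) 1 (toSite (1, 0)) (toSite (1, 0)) := Literature.Probability.RandomPlanarGeometry.SAW.DomainSAW.nil _

/-- Enumeration certificate: the self-avoiding walks of `Ω_E` between these endpoints are exactly the listed ones (completeness of `dfs` + `decide`). [folklore] -/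
theorem enum_O_1_0_1 : ∀ γ : Literature.Probability.RandomPlanarGeometry.SAW.DomainSAW (Omega OE) 1 (toSite (1, 0)) (toSite (1, 0)), γ = nil_O_1_0 :=
  Literature.Probability.RandomPlanarGeometry.SAW.DomainSAW.eq_nil_of_self

/-- explicit self-avoiding walk `(1,0) → (0,0) → (0,1)` [folklore] -/
def w_O_1_0_2_0 : Literature.Probability.RandomPlanarGeometry.SAW.DomainSAW (Omega OE) 1 (toSite (1, 0)) (toSite (0, 1)) :=
  ⟨SimpleGraph.Walk.cons (goodO.A (1, 0) (0, 0)) <|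
  SimpleGraph.Walk.cons (goodO.A (0, 0) (0, 1)) <|
  SimpleGraph.Walk.nil, (SimpleGraph.Walk.isPath_def _).2 (by decide)⟩

/-- explicit self-avoiding walk `(1,0) → (0,0) → (0,-1) → (0,-2) → (-1,-2) → (-2,-2) → (-3,-2) → (-3,-1) → (-3,0) → (-3,1) → (-3,2) → (-2,2) → (-1,2) → (0,2) → (0,1)` [folklore] -/
def w_O_1_0_2_1 : Literature.Probability.RandomPlanarGeometry.SAW.DomainSAW (Omega OE) 1 (toSite (1, 0)) (toSite (0, 1)) :=
  ⟨SimpleGraph.Walk.cons (goodO.A (1, 0) (0, 0)) <|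
  SimpleGraph.Walk.cons (goodO.A (0, 0) (0, -1)) <|
  SimpleGraph.Walk.cons (goodO.A (0, -1) (0, -2)) <|
  SimpleGraph.Walk.cons (goodO.A (0, -2) (-1, -2)) <|
  SimpleGraph.Walk.cons (goodO.A (-1, -2) (-2, -2)) <|
  SimpleGraph.Walk.cons (goodO.A (-2, -2) (-3, -2)) <|
  SimpleGraph.Walk.cons (goodO.A (-3, -2) (-3, -1)) <|
  SimpleGraph.Walk.cons (goodO.A (-3, -1) (-3, 0)) <|
  SimpleGraph.Walk.cons (goodO.A (-3, 0) (-3, 1)) <|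
  SimpleGraph.Walk.cons (goodO.A (-3, 1) (-3, 2)) <|
  SimpleGraph.Walk.cons (goodO.A (-3, 2) (-2, 2)) <|
  SimpleGraph.Walk.cons (goodO.A (-2, 2) (-1, 2)) <|
  SimpleGraph.Walk.cons (goodO.A (-1, 2) (0, 2)) <|
  SimpleGraph.Walk.cons (goodO.A (0, 2) (0, 1)) <|
  SimpleGraph.Walk.nil, (SimpleGraph.Walk.isPath_def _).2 (by decide)⟩

/-- Enumeration certificate: the self-avoiding walks of `Ω_E` between these endpoints are exactly the listed ones (completeness of `dfs` + `decide`). [folklore] -/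
theorem enum_O_1_0_2 : ∀ γ : Literature.Probability.RandomPlanarGeometry.SAW.DomainSAW (Omega OE) 1 (toSite (1, 0)) (toSite (0, 1)),
    γ = w_O_1_0_2_0 ∨ γ = w_O_1_0_2_1 := by
  intro γ
  have hmem := goodO.support_mem_dfs γ (by decide) (fuel := 32) (by decide)
  have hhead := head?_reverse_map_support γ.walk
  have hall : ∀ l ∈ dfs OE 32 [ofSite (toSite (1, 0))], l.head? = some (ofSite (toSite (0, 1))) →
      l = [(0, 1), (0, 0), (1, 0)] ∨ l = [(0, 1), (0, 2), (-1, 2), (-2, 2), (-3, 2), (-3, 1), (-3, 0), (-3, -1), (-3, -2), (-2, -2), (-1, -2), (0, -2), (0, -1), (0, 0), (1, 0)] := by decide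
  rcases hall _ hmem hhead with h | h
  · left; apply DomainSAW_eq_of_support; rw [support_eq_of_reverse_map γ.walk h]; decide
  · right; apply DomainSAW_eq_of_support; rw [support_eq_of_reverse_map γ.walk h]; decide

/-- explicit self-avoiding walk `(1,0) → (0,0) → (-1,0)` [folklore] -/
def w_O_1_0_3_0 : Literature.Probability.RandomPlanarGeometry.SAW.DomainSAW (Omega OE) 1 (toSite (1, 0)) (toSite (-1, 0)) :=
  ⟨SimpleGraph.Walk.cons (goodO.A (1, 0) (0, 0)) <|
  SimpleGraph.Walk.cons (goodO.A (0, 0) (-1, 0)) <|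
  SimpleGraph.Walk.nil, (SimpleGraph.Walk.isPath_def _).2 (by decide)⟩

/-- Enumeration certificate: the self-avoiding walks of `Ω_E` between these endpoints are exactly the listed ones (completeness of `dfs` + `decide`). [folklore] -/
theorem enum_O_1_0_3 : ∀ γ : Literature.Probability.RandomPlanarGeometry.SAW.DomainSAW (Omega OE) 1 (toSite (1, 0)) (toSite (-1, 0)),
    γ = w_O_1_0_3_0 := by
  intro γ
  have hmem := goodO.support_mem_dfs γ (by decide) (fuel := 32) (by decide)
  have hhead := head?_reverse_map_support γ.walk
  have hall : ∀ l ∈ dfs OE 32 [ofSite (toSite (1, 0))], l.head? = some (ofSite (toSite (-1, 0))) →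
      l = [(-1, 0), (0, 0), (1, 0)] := by decide
  have h := hall _ hmem hhead
  apply DomainSAW_eq_of_support; rw [support_eq_of_reverse_map γ.walk h]; decide

/-- explicit self-avoiding walk `(1,0) → (0,0) → (0,1) → (0,2) → (-1,2) → (-2,2) → (-3,2) → (-3,1) → (-3,0) → (-3,-1) → (-3,-2) → (-2,-2) → (-1,-2) → (0,-2) → (0,-1)` [folklore] -/
def w_O_1_0_4_0 : Literature.Probability.RandomPlanarGeometry.SAW.DomainSAW (Omega OE) 1 (toSite (1, 0)) (toSite (0, -1)) :=
  ⟨SimpleGraph.Walk.cons (goodO.A (1, 0) (0, 0)) <|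
  SimpleGraph.Walk.cons (goodO.A (0, 0) (0, 1)) <|
  SimpleGraph.Walk.cons (goodO.A (0, 1) (0, 2)) <|
  SimpleGraph.Walk.cons (goodO.A (0, 2) (-1, 2)) <|
  SimpleGraph.Walk.cons (goodO.A (-1, 2) (-2, 2)) <|
  SimpleGraph.Walk.cons (goodO.A (-2, 2) (-3, 2)) <|
  SimpleGraph.Walk.cons (goodO.A (-3, 2) (-3, 1)) <|
  SimpleGraph.Walk.cons (goodO.A (-3, 1) (-3, 0)) <|
  SimpleGraph.Walk.cons (goodO.A (-3, 0) (-3, -1)) <|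
  SimpleGraph.Walk.cons (goodO.A (-3, -1) (-3, -2)) <|
  SimpleGraph.Walk.cons (goodO.A (-3, -2) (-2, -2)) <|
  SimpleGraph.Walk.cons (goodO.A (-2, -2) (-1, -2)) <|
  SimpleGraph.Walk.cons (goodO.A (-1, -2) (0, -2)) <|
  SimpleGraph.Walk.cons (goodO.A (0, -2) (0, -1)) <|
  SimpleGraph.Walk.nil, (SimpleGraph.Walk.isPath_def _).2 (by decide)⟩

/-- explicit self-avoiding walk `(1,0) → (0,0) → (0,-1)` [folklore] -/
def w_O_1_0_4_1 : Literature.Probability.RandomPlanarGeometry.SAW.DomainSAW (Omega OE) 1 (toSite (1, 0)) (toSite (0, -1)) :=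
  ⟨SimpleGraph.Walk.cons (goodO.A (1, 0) (0, 0)) <|
  SimpleGraph.Walk.cons (goodO.A (0, 0) (0, -1)) <|
  SimpleGraph.Walk.nil, (SimpleGraph.Walk.isPath_def _).2 (by decide)⟩

/-- Enumeration certificate: the self-avoiding walks of `Ω_E` between these endpoints are exactly the listed ones (completeness of `dfs` + `decide`). [folklore] -/
theorem enum_O_1_0_4 : ∀ γ : Literature.Probability.RandomPlanarGeometry.SAW.DomainSAW (Omega OE) 1 (toSite (1, 0)) (toSite (0, -1)),
    γ = w_O_1_0_4_0 ∨ γ = w_O_1_0_4_1 := by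
  intro γ
  have hmem := goodO.support_mem_dfs γ (by decide) (fuel := 32) (by decide)
  have hhead := head?_reverse_map_support γ.walk
  have hall : ∀ l ∈ dfs OE 32 [ofSite (toSite (1, 0))], l.head? = some (ofSite (toSite (0, -1))) →
      l = [(0, -1), (0, -2), (-1, -2), (-2, -2), (-3, -2), (-3, -1), (-3, 0), (-3, 1), (-3, 2), (-2, 2), (-1, 2), (0, 2), (0, 1), (0, 0), (1, 0)] ∨ l = [(0, -1), (0, 0), (1, 0)] := by decide
  rcases hall _ hmem hhead with h | h
  · left; apply DomainSAW_eq_of_support; rw [support_eq_of_reverse_map γ.walk h]; decide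
  · right; apply DomainSAW_eq_of_support; rw [support_eq_of_reverse_map γ.walk h]; decide

/-- Value of one half-edge term of the mid-edge observable on the explicit domain (from the enumeration certificate and the integer winding count). [folklore] -/
theorem hET_O_1_0_E_out (x σ : ℝ) :
    Literature.Probability.RandomPlanarGeometry.SAW.halfEdgeTerm (Omega OE) 1 (toSite (1, 0)) x σ (toSite (0, 0)) (toSite (1, 0)) = 0 := by
  refine halfEdgeTerm_eq_zero x σ (toSite (1, 0)) fun γ => ?_
  rw [enum_O_1_0_0 γ]; decide

/-- Value of one half-edge term of the mid-edge observable on the explicit domain (from the enumeration certificate and the integer winding count). [folklore] -/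
theorem hET_O_1_0_E_in (x σ : ℝ) :
    Literature.Probability.RandomPlanarGeometry.SAW.halfEdgeTerm (Omega OE) 1 (toSite (1, 0)) x σ (toSite (1, 0)) (toSite (0, 0)) =
      (x : ℂ) := by
  rw [halfEdgeTerm_eq_single x σ (toSite (0, 0)) nil_O_1_0 (fun γ hγ => absurd (enum_O_1_0_1 γ) hγ)]
  rw [if_neg (by decide), winding_support_medial nil_O_1_0.walk (toSite (0, 0)) (by decide),
    show quarterTurns (List.map ofSite nil_O_1_0.walk.support ++ [ofSite (toSite (0, 0))]) = 0 from by decide,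
    show Literature.Probability.RandomPlanarGeometry.SAW.DomainSAW.length nil_O_1_0 = 0 from by decide, cexp_quarter_0 σ]
  ring

/-- Value of one half-edge term of the mid-edge observable on the explicit domain (from the enumeration certificate and the integer winding count). [folklore] -/
theorem hET_O_1_0_N_out (x σ : ℝ) :
    Literature.Probability.RandomPlanarGeometry.SAW.halfEdgeTerm (Omega OE) 1 (toSite (1, 0)) x σ (toSite (0, 0)) (toSite (0, 1)) =
      (x : ℂ) ^ 2 * (tOf σ)⁻¹ := by
  rw [halfEdgeTerm_eq_single x σ (toSite (0, 1)) w_O_1_0_0_0 (fun γ hγ => absurd (enum_O_1_0_0 γ) hγ)]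
  rw [if_neg (by decide), winding_support_medial w_O_1_0_0_0.walk (toSite (0, 1)) (by decide),
    show quarterTurns (List.map ofSite w_O_1_0_0_0.walk.support ++ [ofSite (toSite (0, 1))]) = -1 from by decide,
    show Literature.Probability.RandomPlanarGeometry.SAW.DomainSAW.length w_O_1_0_0_0 = 1 from by decide, cexp_quarter_m1 σ]
  ring

/-- Value of one half-edge term of the mid-edge observable on the explicit domain (from the enumeration certificate and the integer winding count). [folklore] -/
theorem hET_O_1_0_N_in (x σ : ℝ) :
    Literature.Probability.RandomPlanarGeometry.SAW.halfEdgeTerm (Omega OE) 1 (toSite (1, 0)) x σ (toSite (0, 1)) (toSite (0, 0)) =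
      (x : ℂ) ^ 15 * (tOf σ)⁻¹ ^ 3 := by
  rw [halfEdgeTerm_eq_single x σ (toSite (0, 0)) w_O_1_0_2_1 (fun γ hγ => by
    rcases enum_O_1_0_2 γ with rfl | rfl
    · decide
    · exact absurd rfl hγ
    )]
  rw [if_neg (by decide), winding_support_medial w_O_1_0_2_1.walk (toSite (0, 0)) (by decide),
    show quarterTurns (List.map ofSite w_O_1_0_2_1.walk.support ++ [ofSite (toSite (0, 0))]) = -3 from by decide,
    show Literature.Probability.RandomPlanarGeometry.SAW.DomainSAW.length w_O_1_0_2_1 = 14 from by decide, cexp_quarter_m3 σ]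
  ring

/-- Value of one half-edge term of the mid-edge observable on the explicit domain (from the enumeration certificate and the integer winding count). [folklore] -/
theorem hET_O_1_0_W_out (x σ : ℝ) :
    Literature.Probability.RandomPlanarGeometry.SAW.halfEdgeTerm (Omega OE) 1 (toSite (1, 0)) x σ (toSite (0, 0)) (toSite (-1, 0)) =
      (x : ℂ) ^ 2 := by
  rw [halfEdgeTerm_eq_single x σ (toSite (-1, 0)) w_O_1_0_0_0 (fun γ hγ => absurd (enum_O_1_0_0 γ) hγ)]
  rw [if_neg (by decide), winding_support_medial w_O_1_0_0_0.walk (toSite (-1, 0)) (by decide),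
    show quarterTurns (List.map ofSite w_O_1_0_0_0.walk.support ++ [ofSite (toSite (-1, 0))]) = 0 from by decide,
    show Literature.Probability.RandomPlanarGeometry.SAW.DomainSAW.length w_O_1_0_0_0 = 1 from by decide, cexp_quarter_0 σ]
  ring

/-- Value of one half-edge term of the mid-edge observable on the explicit domain (from the enumeration certificate and the integer winding count). [folklore] -/
theorem hET_O_1_0_W_in (x σ : ℝ) :
    Literature.Probability.RandomPlanarGeometry.SAW.halfEdgeTerm (Omega OE) 1 (toSite (1, 0)) x σ (toSite (-1, 0)) (toSite (0, 0)) = 0 := by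
  refine halfEdgeTerm_eq_zero x σ (toSite (0, 0)) fun γ => ?_
  rw [enum_O_1_0_3 γ]; decide

/-- Value of one half-edge term of the mid-edge observable on the explicit domain (from the enumeration certificate and the integer winding count). [folklore] -/
theorem hET_O_1_0_S_out (x σ : ℝ) :
    Literature.Probability.RandomPlanarGeometry.SAW.halfEdgeTerm (Omega OE) 1 (toSite (1, 0)) x σ (toSite (0, 0)) (toSite (0, -1)) =
      (x : ℂ) ^ 2 * tOf σ := by
  rw [halfEdgeTerm_eq_single x σ (toSite (0, -1)) w_O_1_0_0_0 (fun γ hγ => absurd (enum_O_1_0_0 γ) hγ)]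
  rw [if_neg (by decide), winding_support_medial w_O_1_0_0_0.walk (toSite (0, -1)) (by decide),
    show quarterTurns (List.map ofSite w_O_1_0_0_0.walk.support ++ [ofSite (toSite (0, -1))]) = 1 from by decide,
    show Literature.Probability.RandomPlanarGeometry.SAW.DomainSAW.length w_O_1_0_0_0 = 1 from by decide, cexp_quarter_1 σ]
  ring

/-- Value of one half-edge term of the mid-edge observable on the explicit domain (from the enumeration certificate and the integer winding count). [folklore] -/
theorem hET_O_1_0_S_in (x σ : ℝ) :
    Literature.Probability.RandomPlanarGeometry.SAW.halfEdgeTerm (Omega OE) 1 (toSite (1, 0)) x σ (toSite (0, -1)) (toSite (0, 0)) =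
      (x : ℂ) ^ 15 * tOf σ ^ 3 := by
  rw [halfEdgeTerm_eq_single x σ (toSite (0, 0)) w_O_1_0_4_0 (fun γ hγ => by
    rcases enum_O_1_0_4 γ with rfl | rfl
    · exact absurd rfl hγ
    · decide
    )]
  rw [if_neg (by decide), winding_support_medial w_O_1_0_4_0.walk (toSite (0, 0)) (by decide),
    show quarterTurns (List.map ofSite w_O_1_0_4_0.walk.support ++ [ofSite (toSite (0, 0))]) = 3 from by decide,
    show Literature.Probability.RandomPlanarGeometry.SAW.DomainSAW.length w_O_1_0_4_0 = 14 from by decide, cexp_quarter_3 σ]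
  ring

/-- Value of the mid-edge observable at one of the four edges at the origin, on the explicit domain. [folklore] -/
theorem F_O_1_0_E (x σ : ℝ) :
    Literature.Probability.RandomPlanarGeometry.SAW.midEdgeParafermionicObservable (Omega OE) 1 (toSite (1, 0)) x σ s(toSite (0, 0), toSite (1, 0)) =
      (x : ℂ) := by
  simp only [Literature.Probability.RandomPlanarGeometry.SAW.midEdgeParafermionicObservable_mk, hET_O_1_0_E_out, hET_O_1_0_E_in, zero_add]

/-- Value of the mid-edge observable at one of the four edges at the origin, on the explicit domain. [folklore] -/
theorem F_O_1_0_N (x σ : ℝ) :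
    Literature.Probability.RandomPlanarGeometry.SAW.midEdgeParafermionicObservable (Omega OE) 1 (toSite (1, 0)) x σ s(toSite (0, 0), toSite (0, 1)) =
      (x : ℂ) ^ 2 * (tOf σ)⁻¹ + (x : ℂ) ^ 15 * (tOf σ)⁻¹ ^ 3 := by
  simp only [Literature.Probability.RandomPlanarGeometry.SAW.midEdgeParafermionicObservable_mk, hET_O_1_0_N_out, hET_O_1_0_N_in]

/-- Value of the mid-edge observable at one of the four edges at the origin, on the explicit domain. [folklore] -/
theorem F_O_1_0_W (x σ : ℝ) :
    Literature.Probability.RandomPlanarGeometry.SAW.midEdgeParafermionicObservable (Omega OE) 1 (toSite (1, 0)) x σ s(toSite (0, 0), toSite (-1, 0)) =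
      (x : ℂ) ^ 2 := by
  simp only [Literature.Probability.RandomPlanarGeometry.SAW.midEdgeParafermionicObservable_mk, hET_O_1_0_W_out, hET_O_1_0_W_in, add_zero]

/-- Value of the mid-edge observable at one of the four edges at the origin, on the explicit domain. [folklore] -/
theorem F_O_1_0_S (x σ : ℝ) :
    Literature.Probability.RandomPlanarGeometry.SAW.midEdgeParafermionicObservable (Omega OE) 1 (toSite (1, 0)) x σ s(toSite (0, 0), toSite (0, -1)) =
      (x : ℂ) ^ 2 * tOf σ + (x : ℂ) ^ 15 * tOf σ ^ 3 := by
  simp only [Literature.Probability.RandomPlanarGeometry.SAW.midEdgeParafermionicObservable_mk, hET_O_1_0_S_out, hET_O_1_0_S_in]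

/-- The exact relation instantiated on domain `O` with root `(1, 0)`. [folklore] -/
theorem inst_O_1_0 {x σ : ℝ} {c : Fin 4 → ℂ} (hrel : ExactVertexRelationZ2 x σ c) :
    c 0 * ((x : ℂ)) + c 1 * ((x : ℂ) ^ 2 * (tOf σ)⁻¹ + (x : ℂ) ^ 15 * (tOf σ)⁻¹ ^ 3) + c 2 * ((x : ℂ) ^ 2) + c 3 * ((x : ℂ) ^ 2 * tOf σ + (x : ℂ) ^ 15 * tOf σ ^ 3) = 0 := by
  have h := hrel (Omega OE) 1 (toSite (1, 0)) (toSite (0, 0)) one_pos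
    ((goodO.mem_meshDomain_iff _).2 (by decide))
    ⟨toSite (2, 0), zdAdj_toSite_right (1, 0), by
      rw [meshPoint_one_toSite, pt_mem_Omega_iff goodO.unit]; decide⟩
    (adj_four goodO (by decide) (by decide) (by decide) (by decide))
  rw [sum_four_dirZ2] at h
  rw [F_O_1_0_E, F_O_1_0_N, F_O_1_0_W, F_O_1_0_S] at h
  linear_combination h


/-! ### Assembly -/

/-- On the six instances the relation reads: rows `(x, x²t⁻¹, x², x²t)` and its three cyclic
shifts (domain `P`, roots `(1,0)`, `(0,1)`, `(-1,0)`, `(0,-1)`), and the loop corrections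
`x⁹ (0, t⁻³, t², 0)` (domain `T`) and `x¹⁵ (0, t⁻³, 0, t³)` (domain `O`), `t = e^{-iσπ/2}`.
[folklore] -/
theorem rows_of_exactVertexRelationZ2 {x σ : ℝ} {c : Fin 4 → ℂ} (hrel : ExactVertexRelationZ2 x σ c)
    (hx : 0 < x) :
    (c 0 * x + c 1 * (x ^ 2 * (tOf σ)⁻¹) + c 2 * x ^ 2 + c 3 * (x ^ 2 * tOf σ) = 0 ∧
      c 1 * x + c 2 * (x ^ 2 * (tOf σ)⁻¹) + c 3 * x ^ 2 + c 0 * (x ^ 2 * tOf σ) = 0 ∧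
      c 2 * x + c 3 * (x ^ 2 * (tOf σ)⁻¹) + c 0 * x ^ 2 + c 1 * (x ^ 2 * tOf σ) = 0 ∧
      c 3 * x + c 0 * (x ^ 2 * (tOf σ)⁻¹) + c 1 * x ^ 2 + c 2 * (x ^ 2 * tOf σ) = 0) ∧
    c 1 * (tOf σ)⁻¹ ^ 3 + c 2 * tOf σ ^ 2 = 0 ∧
    c 1 * (tOf σ)⁻¹ ^ 3 + c 3 * tOf σ ^ 3 = 0 := by
  have hP0 := inst_P_1_0 hrel
  have hP1 := inst_P_0_1 hrel
  have hP2 := inst_P_m1_0 hrel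
  have hP3 := inst_P_0_m1 hrel
  have hT' := inst_T_1_0 hrel
  have hO' := inst_O_1_0 hrel
  have hx0 : (x : ℂ) ≠ 0 := by exact_mod_cast hx.ne'
  refine ⟨⟨?_, ?_, ?_, ?_⟩, ?_, ?_⟩
  · linear_combination hP0
  · linear_combination hP1
  · linear_combination hP2
  · linear_combination hP3
  · have h : (x : ℂ) ^ 9 * (c 1 * (tOf σ)⁻¹ ^ 3 + c 2 * tOf σ ^ 2) = 0 := by
      linear_combination hT' - hP0
    exact (mul_eq_zero.1 h).resolve_left (pow_ne_zero 9 hx0)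
  · have h : (x : ℂ) ^ 15 * (c 1 * (tOf σ)⁻¹ ^ 3 + c 3 * tOf σ ^ 3) = 0 := by
      linear_combination hO' - hP0
    exact (mul_eq_zero.1 h).resolve_left (pow_ne_zero 15 hx0)

end NoVertexRelation

/-- **Algebraic core of `¬ HasExactVertexRelationZ2`.** With `t = e^{-iσπ/2}` (`‖t‖ = 1`) and
`0 < x < 1`, the six exact linear relations that a stencil `c : Fin 4 → ℂ` must satisfy on the
three explicit domains `plus` (four rotations), `T` (8-cycle) and `O` (14-cycle) — rows
`(x, x²t⁻¹, x², x²t)` and its cyclic shifts, loop corrections `x⁹(0, t⁻³, t², 0)` and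
`x¹⁵(0, t⁻³, 0, t³)` — force `c = 0`. [folklore] -/
theorem vertexStencil_eq_zero_of_rows (x : ℝ) (hx0 : 0 < x) (hx1 : x < 1) (t : ℂ) (ht : ‖t‖ = 1)
    (c : Fin 4 → ℂ)
    (h0 : c 0 * x + c 1 * (x ^ 2 * t⁻¹) + c 2 * x ^ 2 + c 3 * (x ^ 2 * t) = 0)
    (h1 : c 1 * x + c 2 * (x ^ 2 * t⁻¹) + c 3 * x ^ 2 + c 0 * (x ^ 2 * t) = 0)
    (h2 : c 2 * x + c 3 * (x ^ 2 * t⁻¹) + c 0 * x ^ 2 + c 1 * (x ^ 2 * t) = 0)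
    (h3 : c 3 * x + c 0 * (x ^ 2 * t⁻¹) + c 1 * x ^ 2 + c 2 * (x ^ 2 * t) = 0)
    (hT : c 1 * t⁻¹ ^ 3 + c 2 * t ^ 2 = 0)
    (hO : c 1 * t⁻¹ ^ 3 + c 3 * t ^ 3 = 0) : c = 0 := by
  have ht0 : t ≠ 0 := by
    intro h; rw [h, norm_zero] at ht; exact zero_ne_one ht
  have htinv : t⁻¹ = conj t := by
    rw [Complex.inv_def, Complex.normSq_eq_norm_sq, ht]; simp
  have hre_le : |t.re| ≤ 1 := ht ▸ Complex.abs_re_le_norm t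
  have hre1 : -1 ≤ t.re := (abs_le.1 hre_le).1
  have hre2 : t.re ≤ 1 := (abs_le.1 hre_le).2
  -- the two scalar factors of the symmetric / alternating sums are non-zero (positive real part)
  set p : ℂ := (x : ℂ) + x ^ 2 * t⁻¹ + x ^ 2 + x ^ 2 * t with hp_def
  set q : ℂ := (x : ℂ) - x ^ 2 * t⁻¹ + x ^ 2 - x ^ 2 * t with hq_def
  have hxx : 0 < x - x ^ 2 := by nlinarith
  have hp : p ≠ 0 := by
    intro h
    have hre : p.re = x + x ^ 2 * t.re + x ^ 2 + x ^ 2 * t.re := by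
      simp [hp_def, htinv, Complex.conj_re, pow_two]
    have : p.re = 0 := by rw [h]; rfl
    rw [hre] at this
    nlinarith
  have hq : q ≠ 0 := by
    intro h
    have hre : q.re = x - x ^ 2 * t.re + x ^ 2 - x ^ 2 * t.re := by
      simp [hq_def, htinv, Complex.conj_re, pow_two]
    have : q.re = 0 := by rw [h]; rfl
    rw [hre] at this
    nlinarith
  have hS : c 0 + c 1 + c 2 + c 3 = 0 := by
    have h : (c 0 + c 1 + c 2 + c 3) * p = 0 := by
      rw [hp_def]; linear_combination h0 + h1 + h2 + h3
    exact (mul_eq_zero.1 h).resolve_right hp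
  have hA : c 0 - c 1 + c 2 - c 3 = 0 := by
    have h : (c 0 - c 1 + c 2 - c 3) * q = 0 := by
      rw [hq_def]; linear_combination h0 - h1 + h2 - h3
    exact (mul_eq_zero.1 h).resolve_right hq
  have hc2 : c 2 = -c 0 := by linear_combination (hS + hA) / 2
  have hc3 : c 3 = -c 1 := by linear_combination (hS - hA) / 2
  -- the O-loop: c₁ (t⁻³ - t³) = 0
  have hO' : c 1 * (t⁻¹ ^ 3 - t ^ 3) = 0 := by linear_combination hO - (t ^ 3) * hc3
  rcases mul_eq_zero.1 hO' with hc1 | ht6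
  · -- c₁ = 0 ⇒ c = 0
    have hc3' : c 3 = 0 := by rw [hc3, hc1, neg_zero]
    have hc2' : c 2 = 0 := by
      have h : c 2 * t ^ 2 = 0 := by linear_combination hT - (t⁻¹ ^ 3) * hc1
      exact (mul_eq_zero.1 h).resolve_right (pow_ne_zero 2 ht0)
    have hc0' : c 0 = 0 := by linear_combination hc2 - hc2'
    funext i; fin_cases i <;> simp [hc0', hc1, hc2', hc3']
  · -- t⁶ = 1, c₁ ≠ 0 is impossible
    by_contra hc
    have hc1 : c 1 ≠ 0 := by
      intro hc1
      apply hc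
      have hc3' : c 3 = 0 := by rw [hc3, hc1, neg_zero]
      have hc2' : c 2 = 0 := by
        have h : c 2 * t ^ 2 = 0 := by linear_combination hT - (t⁻¹ ^ 3) * hc1
        exact (mul_eq_zero.1 h).resolve_right (pow_ne_zero 2 ht0)
      have hc0' : c 0 = 0 := by linear_combination hc2 - hc2'
      funext i; fin_cases i <;> simp [hc0', hc1, hc2', hc3']
    have ht6' : t ^ 6 = 1 := by
      have h := sub_eq_zero.1 ht6
      field_simp at h
      linear_combination -h
    -- from hT and c₂ = -c₀: c₀ = c₁ t⁻⁵ = c₁ t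
    have hc0 : c 0 = c 1 * t := by
      have h : c 0 * t ^ 2 = c 1 * t⁻¹ ^ 3 := by linear_combination -hT + (t ^ 2) * hc2
      have h' : c 0 * t ^ 5 = c 1 := by
        field_simp at h
        linear_combination h
      calc c 0 = c 0 * t ^ 6 := by rw [ht6', mul_one]
        _ = c 0 * t ^ 5 * t := by ring
        _ = c 1 * t := by rw [h']
    -- plug into h0
    have key : c 1 * (t * x + x ^ 2 * t⁻¹ - t * x ^ 2 - x ^ 2 * t) = 0 := by
      linear_combination h0 - (x : ℂ) * hc0 - ((x : ℂ) ^ 2) * hc2 - ((x : ℂ) ^ 2 * t) * hc3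
        + ((x : ℂ) ^ 2) * hc0
    have key' : t * x + x ^ 2 * t⁻¹ - t * x ^ 2 - x ^ 2 * t = 0 :=
      (mul_eq_zero.1 key).resolve_left hc1
    have key2 : t ^ 2 * (1 - 2 * x) = -x := by
      have hx0' : (x : ℂ) ≠ 0 := by exact_mod_cast hx0.ne'
      field_simp at key'
      have : t ^ 2 * ((x : ℂ) * (1 - 2 * x)) = -(x : ℂ) * x := by linear_combination key'
      have h2 : (t ^ 2 * (1 - 2 * x) + x) * (x : ℂ) = 0 := by linear_combination this
      have h3 := (mul_eq_zero.1 h2).resolve_right hx0'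
      linear_combination h3
    -- norms: |1 - 2x| = x
    have hnorm : |1 - 2 * x| = x := by
      have h := congrArg norm key2
      rw [norm_mul, norm_pow, ht, one_pow, one_mul, norm_neg] at h
      have h1 : ‖((1 - 2 * x : ℝ) : ℂ)‖ = |1 - 2 * x| := by
        rw [Complex.norm_real, Real.norm_eq_abs]
      have h2 : ‖((x : ℝ) : ℂ)‖ = x := by
        rw [Complex.norm_real, Real.norm_eq_abs, abs_of_pos hx0]
      push_cast at h1 h2
      rw [h1, h2] at h
      exact h
    have hx3 : x = 1 / 3 := by
      rcases le_or_gt 0 (1 - 2 * x) with h | h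
      · rw [abs_of_nonneg h] at hnorm; linarith
      · rw [abs_of_neg h] at hnorm; linarith
    have ht2 : t ^ 2 = -1 := by
      rw [hx3] at key2
      push_cast at key2
      linear_combination 3 * key2
    have : t ^ 6 = -1 := by
      calc t ^ 6 = (t ^ 2) ^ 3 := by ring
        _ = -1 := by rw [ht2]; norm_num
    rw [ht6'] at this
    norm_num at this

-- the theorem below IS the refutation of the `@[deprecated]` record `HasExactVertexRelationZ2`
-- (verdict clean-up 2026-08-16) and must name it: `linter.deprecated` off for it alone
set_option linter.deprecated false in
/-- **The technique class of the barrier is empty: the uniform square-lattice SAW observable admits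
NO exact local linear relation with vertex-independent coefficients, at any fugacity `x ∈ (0,1)`
and any spin `σ`.** Evaluate the relation on the plus-shaped domain (four roots), which forces the
discrete Cauchy–Riemann stencil `c ∝ (1, ±i, -1, ∓i)` and `x = 1/(1 + 2|sin(πσ/2)|)`, and on two
domains carrying a single loop returning to the neighbourhood of `v` through ADJACENT exits
(`T`: needs `t⁵ = ±i`) and through OPPOSITE exits (`O`: needs `t⁶ = 1`), `t = e^{-iσπ/2}`;
the three conditions are incompatible (`vertexStencil_eq_zero_of_rows`). On the hexagonal lattice
the degree-3 vertex has a single loop class and a single extension class, whence DCS's Lemma 1 at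
`σ = 5/8`, `x = 1/√(2+√2)`; the degree-4 vertex of `ℤ²` has two inequivalent loop classes.
This theorem IS the refutation of the deprecated record `HasExactVertexRelationZ2` (verdict
clean-up 2026-08-16) and must name it, so `linter.deprecated` is off for it alone. [folklore] -/
theorem not_hasExactVertexRelationZ2 : ¬ HasExactVertexRelationZ2 := by
  rintro ⟨x, σ, c, hx0, hx1, hc, hrel⟩
  obtain ⟨⟨h0, h1, h2, h3⟩, hT, hO⟩ := NoVertexRelation.rows_of_exactVertexRelationZ2 hrel hx0
  exact hc (vertexStencil_eq_zero_of_rows x hx0 hx1 (NoVertexRelation.tOf σ)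
    (NoVertexRelation.norm_tOf σ) c h0 h1 h2 h3 hT hO)

/-- Equivalently: for every `x ∈ (0,1)`, `σ` and `c`, an exact vertex relation forces `c = 0`
(the route guard `NoExactVertexRelation` of route `SAWParafermion`, in the barrier's notation).
[folklore] -/
theorem exactVertexRelationZ2_eq_zero {x σ : ℝ} {c : Fin 4 → ℂ} (hx0 : 0 < x) (hx1 : x < 1)
    (h : ExactVertexRelationZ2 x σ c) : c = 0 := by
  by_contra hc
  exact not_hasExactVertexRelationZ2 ⟨x, σ, c, hx0, hx1, hc, h⟩

end TechniqueClassEmpty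

end Literature.Barriers.CriticalPhenomena
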